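import Mathlib.Analysis.Complex.RealDeriv
import Mathlib.Analysis.Complex.CauchyIntegral
import Mathlib.Analysis.Calculus.FDeriv.Analytic
import Mathlib.Analysis.Calculus.Deriv.Slope
import Mathlib.Analysis.SpecificLimits.Basic
import Mathlib.Analysis.Complex.HasPrimitives
import Mathlib.Analysis.Complex.TaylorSeries
import Mathlib.Analysis.Complex.BorelCaratheodory
import Mathlib.Analysis.Complex.Liouville
import Mathlib.Analysis.Normed.Group.Tannery
import Mathlib.Topology.Sequences
import Literature.Probability.LatticeModels.LeeYangFirstZeroLimit
import Literature.Probability.LatticeModels.IsingThermodynamicsProofs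
import Literature.Probability.LatticeModels.LeeYangProofs
import Literature.Probability.LatticeModels.LeeYangTrigProduct
import Literature.Probability.LatticeModels.SusceptibilityMeanFieldBound
import Literature.Probability.LatticeModels.UrsellMonotonicity
import HarnessLib

/-!
# Thermodynamic limit of the first Lee–Yang zero (Jiang–Newman 2023) — proofs

Topic `Probability/LatticeModels`, namespace `Literature.Probability.LatticeModels.JiangNewman`.
Sibling PROOF file of `LeeYangFirstZeroLimit.lean`, which vendors J. Jiang, C. M. Newman,
*Thermodynamic limit of the first Lee–Yang zero*, Comm. Pure Appl. Math. 77 (2024) 1224–1234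
(arXiv:2210.03602) [JiangNewman2023] as the named fact `JiangNewman.FirstZeroLimit` (Theorem 1
with Propositions 1–3 and Lemma 1, for the boxes `B_n = [-n,n]^d`). This file proves, sorry-free
and from the tree, the parts of that statement whose printed proofs use only inputs the tree
already has (Friedli–Velenik Thm. 3.6, the Lee–Yang circle theorem, GKS, the divergence of the
susceptibility at and above `β_c`), following the architecture of the paper (§2):

* `tendsto_freeEnergyIn` — clause (0) of the fact, JN eq. (1.5): for ALL real `β, h` the
  finite-volume free energies `f_{B_n,β}(h) = ln Z_{B_n,β,h}/|B_n|` converge to `f_β(h)`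
  (Friedli–Velenik 2017, Thm. 3.6, in the tree `hasBoxLimit_pressureIn_holds`; Jiang–Newman's
  field `h` is Friedli–Velenik's `βh`, `freeEnergyIn_eq_pressureIn`; the case `β = 0` is the
  explicit `Z_{Λ,0,h} = (e^h + e^{-h})^{|Λ|}`); `freeEnergy_neg` (evenness).
* `partitionFunction_ne_zero_of_re_ne_zero` — the **Lee–Yang theorem** for the complex-field
  partition function `Z_{Λ,β,h}` of the fact file (JN §1, "all zeros are purely imaginary"): the
  tree's `lee_yang_circle_theorem_finite_holds` (`LeeYangProofs`, Asano contractions) transported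
  from `Fin n → Bool` to `Λ → ℤˣ`; `partitionFunction_neg`, `partitionFunction_conj` (evenness,
  reality).
* `exists_trig_prod_partitionFunction` — the finite trigonometric product
  `Z_{Λ,β,it} = Z_{Λ,β,0} cos(t)^a ∏_θ (1 - sin²t/sin²(θ/2))`, `a + 2|S| = |Λ|` (the tree's
  `LeeYangTrig.exists_trig_prod` for the lattice law of `M_Λ`; this replaces the Hadamard
  factorisation `Z_{Λ,β,h} = Z_{Λ,β,0}∏(1 + h²/α_j²)` of JN (2.13) / [HouJiangNewman2023, Lemma 1]
  and makes the count "`2|Λ|` zeros of `Z_{Λ,β,ih}` per period" before JN (2.16) explicit);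
  `firstZero_spec` (`0 < α₁(Λ,β) ≤ π/2` is an attained zero, JN (1.3)),
  `partitionFunction_ne_zero_of_norm_lt` (the zero-free disc `|h| < α₁`, JN (2.4)).
* `isingExpect_sq_magnetization_le` — JN (2.15)–(2.17) for `k = 1`:
  `u₂(M_Λ) = ⟨M_Λ²⟩^∅_{Λ;β,0} ≤ (π²/4)|Λ| α₁(Λ,β)^{-2}` (JN print `8|Λ|α₁^{-2}`), read off the
  trigonometric product to second order at `t = 0` with Jordan's inequality.
* `tendsto_volumeSusceptibility_box_atTop`, `tendsto_isingExpect_sq_div_card_atTop` — JN (2.10),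
  (2.18): for `d ≥ 2`, `β ≥ β_c(d)`, `∑_{v ∈ B_n}⟨σ₀σ_v⟩_{B_n,β,0} → ∞` and
  `⟨M_{B_n}²⟩/|B_n| → ∞` (the tree's `χ(β) = ∞`, `susceptibility_eq_top_of_criticalBeta_le`, with GKS
  volume monotonicity and translation covariance as in JN (2.8)).
* `tendsto_firstZero_zero_of_criticalBeta_le` — **JN Prop. 2 for `β ≥ β_c`**, eq. (2.19):
  `α₁(B_n, β) → 0`.
* `not_analyticOnDisc_of_criticalBeta_le` — **JN Lemma 1** (second half) in the language of the
  fact: for `d ≥ 2`, `β ≥ β_c(d)` and every `ρ > 0`, `f_β` does NOT extend holomorphically to the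
  disc `|h| < ρ` (`¬ AnalyticOnDisc d β ρ`).
* `firstZeroLimit_clauses_of_criticalBeta_le`, `firstZeroLimit_at_of_criticalBeta_le_of_antitone`
  — assembly: for `β ≥ β_c(d)` every clause of `FirstZeroLimit` holds with `a = 0`, except the
  antitonicity of `n ↦ α₁(B_n,β)`, from which the whole conjunction at such `β` follows.
* `magnetizationCumulant_one`, `magnetizationCumulant_two`, `magnetizationCumulant_two_le`,
  `tendsto_magnetizationCumulant_two_div_card_atTop` — JN (2.3)/(2.15) for `k ≤ 2` in the fact's own
  terms: `u₁(M_Λ) = 0`, `u₂(M_Λ) = ⟨M_Λ²⟩^∅_{Λ;β,0}`, hence JN (2.17) (`k = 1`) and (2.18) for the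
  cumulant densities `u₂(M_{B_n})/|B_n|` of the fact.
* `magnetizationCumulant_odd` (JN (2.15): `u_{2k-1}(M_Λ) = 0`),
  `lt_criticalBeta_of_tendsto_firstZero_pos` (a positive limit of `α₁(B_n,β)` forces `β < β_c`),
  `firstZeroLimit_of_antitone_of_subcritical` — the residual obligations: `FirstZeroLimit`
  follows from the antitonicity of `α₁(B_n,β)` in `n` (CJN 2022, Cor. 1) and the subcritical
  package of JN Props. 1–3 (`β < β_c`; Ott 2020, Cor. 1.4); everything else is proved here.
* `exists_log_partitionFunction`, `hasSum_magnetizationCumulant`, `inv_firstZero_eq_limsup` —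
  JN (2.4) and (2.22) in finite volume: on the zero-free disc `|h| < α₁(Λ,β)` the partition
  function has an analytic logarithm (a primitive of `Z'/Z`, Mathlib's
  `DifferentiableOn.isExactOn_ball`), the cumulant series `∑_k u_k(M_Λ) hᵏ/k!` converges to
  `ln Z_{Λ,β,h}` for real `|h| < α₁` (`Complex.hasSum_taylorSeries_on_ball`, the real and complex
  iterated derivatives agreeing on the diameter), and its radius of convergence is EXACTLY `α₁`:
  `1/α₁(Λ,β) = limsup_k [|u_{2k}(M_Λ)|/(2k)!]^{1/(2k)}` (Cauchy–Hadamard for `≤`; for `≥`, a larger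
  radius would continue `exp ∘ (cumulant series) = Z` analytically past the zero `iα₁`).
* `abs_magnetizationCumulant_div_card_le` — a UNIFORM substitute for JN (2.17) at all orders:
  `|u_n(M_Λ)|/|Λ| ≤ n!·(2Rr/(R-r))·r^{-n}` for `0 < r < R < α₁(Λ,β)` (Borel–Carathéodory applied to
  `(ln Z_{Λ,β,h} - ln Z_{Λ,β,0})/|Λ|`, whose real part is `≤ |Re h|`, then Cauchy's estimate).
* `analyticOnDisc_of_eventually_lt_firstZero`, `analyticOnDisc_of_lt_liminf`,
  `analyticOnDisc_of_lt_lim` — **the free energy is analytic on `|h| < r` for every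
  `r < liminf_n α₁(B_n, β)`** (the clause "`∀ ρ ≤ a, AnalyticOnDisc d β ρ`" of the fact for `ρ < a`,
  granted the limit `a`; no input from Ott 2020 or Camia–Jiang–Newman 2022): the uniform
  coefficient bounds make the finite-volume expansions a compact family of power series, a
  subsequence of coefficient vectors converges, the sums converge by dominated convergence
  (Tannery) and to `f_β(h) - f_β(0)` by clause (0), exhibiting `f_β` as a power series of radius
  `≥ r` on the real segment.
* `exists_cumulantCoeff_limit`, `tendsto_magnetizationCumulant_div_card`,
  `analyticOnDisc_of_tendsto_firstZero`, `limsup_iteratedDeriv_freeEnergy_le` — granted a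
  POSITIVE limit `α₁(B_n,β) → a > 0`: every subsequential limit of the normalised coefficient
  vectors represents `f_β - f_β(0)` and hence (real/complex derivative matching,
  `HasFPowerSeriesOnBall.factorial_smul`) equals `(f_β^{(k)}(0)/k!)_k`; so the cumulant densities
  converge, `u_k(M_{B_n})/|B_n| → f_β^{(k)}(0)` (clause (iv)(a) of the fact; JN (2.21), there via
  Lebowitz 1972 + ABF 1987), `f_β` extends holomorphically to the full disc `|h| < a` (clause
  `ρ = a`), and `limsup_k [|f_β^{(2k)}(0)|/(2k)!]^{1/(2k)} ≤ 1/a` (half of clause (iv)(b)).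
* `firstZeroLimit_of_residual` — the named fact from exactly three residual inputs: antitonicity
  of `α₁(B_n,β)` (CJN 2022 Cor. 1), positivity of its limit for `β < β_c` (JN Cor. 1, i.e. Ott 2020
  + CJN), and the direction `1/α₁(B_n) ≤ 1/r(β)` of JN (2.23) (no extension beyond `a`,
  `1/a ≤ limsup`; CJN 2022 Thm. 1).
* `firstZero_mono_of_CJN`, `antitone_firstZero_of_CJN`, `firstZeroLimit_of_CJN_of_residual` —
  residual input (i) REDUCED TO THE TREE'S NAMED FACT `CamiaJiangNewman2023_thm2`
  (`UrsellMonotonicity.lean`, CJN 2023 Thm. 2 in zero form): the model on `Λ₀ ⊆ Λ` is the model on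
  `Λ` with the couplings outside `Λ₀` switched off (one ordered representative per edge, so the CJN
  mgf numerator with the `Λ`-couplings IS `Z_{Λ,β,h}`, `sum_exp_mul_weight_eq_partitionFunction`,
  and with the `Λ₀`-couplings it factorises through `Z_{Λ₀,β,h}`,
  `sum_exp_mul_weight_eq_zero_of`), so CJN Thm. 2 at the zero `iα₁(Λ₀)` produces a zero of
  `Z_{Λ,β,·}` of modulus `≤ α₁(Λ₀)`, purely imaginary by Lee–Yang: `α₁(Λ) ≤ α₁(Λ₀)` (CJN Cor. 1).

## The proof of Lemma 1 given here

Jiang–Newman (proof of Lemma 1, p. 8) argue through the infinite-volume magnetisation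
`f'_{β_c}(h) = ⟨σ₀⟩_{ℤ^d,β_c,h}` (Friedli–Velenik Thm. 3.34 + Prop. 3.29, uniqueness of the Gibbs
state at `β_c`, i.e. continuity of the magnetisation: Yang 1952 / Aizenman–Fernández 1986 /
Aizenman–Duminil-Copin–Sidoravicius 2015), GKS volume monotonicity and the mean value theorem in
finite volume, and for `β > β_c` through the non-differentiability of `f_β` at `0`. We run the SAME
mean-value/GKS argument directly on the free energy, which avoids the infinite-volume state, the
uniqueness question at `β_c` and the case distinction `β = β_c` / `β > β_c` altogether:

1. (`mul_isingCorr_le_freeEnergy_sub`) For `0 ≤ h₁ < h₂` and every `m`,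
   `(h₂ - h₁) ⟨σ₀⟩_{B_m,β,h₁} ≤ f_β(h₂) - f_β(h₁)`: in the volume `B_{k+m}` the increment of
   `ln Z` is at least `(h₂ - h₁) ∑_{x} ⟨σ_x⟩_{B_{k+m},β,h₁}` (convexity of `ln Z` in `h`, i.e. the
   mean value theorem and the GKS monotonicity of `⟨σ_x⟩` in `h ≥ 0`), each of the `|B_k|` sites
   `x ∈ B_k` has `⟨σ_x⟩_{B_{k+m}} ≥ ⟨σ_x⟩_{x+B_m} = ⟨σ₀⟩_{B_m}` (GKS II volume monotonicity and
   translation covariance), the other terms are `≥ 0` (GKS I), and `|B_k|/|B_{k+m}| → 1`.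
2. If `f_β` extended holomorphically to `|h| < ρ`, then `f_β` would be differentiable on
   `(-ρ, ρ)` with `f'_β(0) = 0` (evenness, `freeEnergy_neg`) and `f'_β` differentiable at `0`;
   step 1 gives `f'_β(h) ≥ ⟨σ₀⟩_{B_m,β,h}` for `0 < h < ρ`, hence dividing by `h` and letting
   `h ↓ 0`, `f''_β(0) ≥ d/dh ⟨σ₀⟩_{B_m,β,h}|_{h=0} = ∑_{v ∈ B_m} ⟨σ₀σ_v⟩_{B_m,β,0}` for every `m`
   (JN display (2.26)–(2.27)), contradicting the divergence of these sums for `β ≥ β_c`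
   (JN (2.10), (2.28)).

Normalisation: Jiang–Newman's field `h` enters the weight as `h ∑σ`, Friedli–Velenik's (the
tree's `isingPartitionFunction`, `isingExpect`) as `βh ∑σ`; throughout, a JN field `h` is the tree
field `h/β` (`β > 0` in the regime `β ≥ β_c(d) > 0`); at zero field the two coincide.

What is NOT proved here (recorded in the fact file and the unit's notes): the monotonicity of
`α₁(B_n, β)` in `n` (Camia–Jiang–Newman 2022, Thm. 1 / Cor. 1, monotonicity of Ursell functions —
not in the tree), the limit `α₁(B_n,β) → r(β)` with `r(β) > 0` and the analyticity radius for
`β < β_c` (Props. 1–3, which use the same monotonicity and S. Ott's analyticity of the pressure,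
CMP 377 (2020), Cor. 1.4 — not in the tree). No definition and no named fact is introduced.

## References

* [JiangNewman2023] J. Jiang, C. M. Newman, CPAM 77 (2024) 1224–1234, arXiv:2210.03602:
  eq. (1.3)–(1.5), (2.2)–(2.4), (2.7)–(2.10), (2.13)–(2.19), (2.22), Prop. 2, Lemma 1 and its
  proof (displays (2.24)–(2.28)).
* [LeeYang1952] T. D. Lee, C. N. Yang, Phys. Rev. 87 (1952) 410–419, Appendix II.
* [FriedliVelenik2017] S. Friedli, Y. Velenik, *Statistical Mechanics of Lattice Systems*,
  CUP 2017: Thm. 3.6 (pressure), §3.7 proof of Prop. 3.29 (`m_Λ = ∂ψ_Λ/∂h`), Exercises 3.12,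
  3.14, 3.16 (GKS volume monotonicity, translation covariance, free state), §3.7.4 eq. (3.67)
  (susceptibility).
-/

noncomputable section

open Filter Topology Finset Complex

namespace Literature.Probability.LatticeModels

namespace JiangNewman

variable (d : ℕ)

/-! ### Clause (0): the free energy `f_β(h) = lim_n f_{B_n,β}(h)` exists (JN eq. (1.5)) -/

/-- **Normalisation bridge for the free energy**: for `β ≠ 0`, Jiang–Newman's finite-volume free
energy at field `h` is the tree's finite-volume pressure (Friedli–Velenik) at field `h/β`:
`f_{Λ,β}(h) = ψ^∅_Λ(β, h/β)`. [cite: JiangNewman2023, §1 eq. (1.4)] -/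
theorem freeEnergyIn_eq_pressureIn {β : ℝ} (hβ : β ≠ 0) (Λ : Finset (Site d)) (h : ℝ) :
    freeEnergyIn d Λ β h = pressureIn (zdGraph d) Λ β (h / β) .free := by
  have hh : ((h : ℝ) : ℂ) = ((β * (h / β) : ℝ) : ℂ) := by rw [mul_div_cancel₀ h hβ]
  rw [freeEnergyIn, pressureIn, hh, partitionFunction_ofReal_mul, Complex.ofReal_re]

/-- For `β ≠ 0`, `f_β(h) = ψ(β, h/β)` (the two `limUnder`s are of the same sequence).
[cite: JiangNewman2023, §1 eq. (1.5)] -/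
theorem freeEnergy_eq_pressure {β : ℝ} (hβ : β ≠ 0) (h : ℝ) :
    freeEnergy d β h = pressure d β (h / β) := by
  unfold freeEnergy pressure
  congr 1
  funext n
  exact freeEnergyIn_eq_pressureIn d hβ _ _

/-- Clause (0) for `β ≠ 0`: `f_{B_n,β}(h) → f_β(h)` (Friedli–Velenik 2017, Thm. 3.6, in the tree
`hasBoxLimit_pressureIn_holds`). [cite: JiangNewman2023, §1 eq. (1.5)] -/
theorem tendsto_freeEnergyIn_of_ne_zero {β : ℝ} (hβ : β ≠ 0) (h : ℝ) :
    Tendsto (fun n : ℕ => freeEnergyIn d (box d n) β h) atTop (𝓝 (freeEnergy d β h)) := by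
  have hlim : HasBoxLimit (fun Λ => pressureIn (zdGraph d) Λ β (h / β) .free)
      (pressure d β (h / β)) := hasBoxLimit_pressureIn_holds (d := d) β (h / β) .free
  rw [freeEnergy_eq_pressure d hβ]
  refine (show Tendsto _ atTop _ from hlim).congr fun n => ?_
  exact (freeEnergyIn_eq_pressureIn d hβ _ _).symm

/-- The total magnetisation of a glued configuration is the sum of the spins of `τ`. [folklore] -/
theorem sum_spinAt_glue (Λ : Finset (Site d)) (τ : Λ → ℤˣ) (bc : BoundaryCondition (Site d)) :
    ∑ x ∈ Λ, spinAt x (glue Λ τ bc) = ∑ z : Λ, ((τ z : ℤ) : ℝ) := by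
  rw [← Finset.sum_coe_sort Λ]
  refine Finset.sum_congr rfl fun z _ => ?_
  rw [spinAt_glue_coe τ bc z]
  rfl

/-- **`β = 0`**: `Z_{Λ,0,h} = (e^h + e^{-h})^{|Λ|}` at real `h` (independent spins). [folklore] -/
theorem partitionFunction_zero_ofReal_re (Λ : Finset (Site d)) (h : ℝ) :
    (partitionFunction d Λ 0 (h : ℂ)).re = (Real.exp h + Real.exp (-h)) ^ #Λ := by
  classical
  rw [partitionFunction_ofReal, Complex.ofReal_re]
  have hτ : ∀ τ : Λ → ℤˣ, Real.exp (0 * ∑ e ∈ edgesIn (zdGraph d) Λ, bondSpin (glue Λ τ .free) e +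
      h * ∑ x ∈ Λ, spinAt x (glue Λ τ .free)) = ∏ z : Λ, Real.exp (h * ((τ z : ℤ) : ℝ)) := by
    intro τ
    rw [zero_mul, zero_add, sum_spinAt_glue, Finset.mul_sum, Real.exp_sum]
  simp_rw [hτ]
  rw [← Fintype.prod_sum fun (_ : Λ) (u : ℤˣ) => Real.exp (h * ((u : ℤ) : ℝ)), Finset.prod_const,
    Finset.card_univ, Fintype.card_coe]
  congr 1
  rw [UnitsInt.univ, Finset.sum_pair (by decide : (1 : ℤˣ) ≠ -1)]
  simp

/-- **`β = 0`**: `f_{Λ,0}(h) = log (e^h + e^{-h})` for nonempty `Λ`. [folklore] -/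
theorem freeEnergyIn_zero {Λ : Finset (Site d)} (hΛ : Λ.Nonempty) (h : ℝ) :
    freeEnergyIn d Λ 0 h = Real.log (Real.exp h + Real.exp (-h)) := by
  have hcard : (#Λ : ℝ) ≠ 0 := Nat.cast_ne_zero.2 (Finset.card_pos.2 hΛ).ne'
  rw [freeEnergyIn, partitionFunction_zero_ofReal_re, Real.log_pow, mul_div_cancel_left₀ _ hcard]

/-- Clause (0) for `β = 0` (a constant sequence). [cite: JiangNewman2023, §1 eq. (1.5)] -/
theorem tendsto_freeEnergyIn_zero (h : ℝ) :
    Tendsto (fun n : ℕ => freeEnergyIn d (box d n) 0 h) atTop (𝓝 (freeEnergy d 0 h)) := by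
  have hc : (fun n : ℕ => freeEnergyIn d (box d n) 0 h) =
      fun _ => Real.log (Real.exp h + Real.exp (-h)) :=
    funext fun n => freeEnergyIn_zero d (box_nonempty d n) h
  have ht : Tendsto (fun n : ℕ => freeEnergyIn d (box d n) 0 h) atTop
      (𝓝 (Real.log (Real.exp h + Real.exp (-h)))) := by
    rw [hc]; exact tendsto_const_nhds
  have hlim : freeEnergy d 0 h = Real.log (Real.exp h + Real.exp (-h)) := ht.limUnder_eq
  rw [hlim]
  exact ht

/-- **Clause (0) of `FirstZeroLimit` (JN eq. (1.5); Friedli–Velenik 2017, Thm. 3.6)**: for all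
real `β` and `h`, `f_{B_n,β}(h) → f_β(h)` as `n → ∞`. [cite: JiangNewman2023, §1 eq. (1.5)] -/
theorem tendsto_freeEnergyIn (β h : ℝ) :
    Tendsto (fun n : ℕ => freeEnergyIn d (box d n) β h) atTop (𝓝 (freeEnergy d β h)) := by
  rcases eq_or_ne β 0 with rfl | hβ
  · exact tendsto_freeEnergyIn_zero d h
  · exact tendsto_freeEnergyIn_of_ne_zero d hβ h

/-- **Evenness in finite volume**: `f_{Λ,β}(-h) = f_{Λ,β}(h)` (spin flip,
`isingPartitionFunction_flip`). [cite: JiangNewman2023, §2 (u_{2k-1}(M_Λ) = 0)] -/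
theorem freeEnergyIn_neg {β : ℝ} (hβ : β ≠ 0) (Λ : Finset (Site d)) (h : ℝ) :
    freeEnergyIn d Λ β (-h) = freeEnergyIn d Λ β h := by
  rw [freeEnergyIn_eq_pressureIn d hβ, freeEnergyIn_eq_pressureIn d hβ, pressureIn, pressureIn,
    neg_div, ← BoundaryCondition.flip_free, isingPartitionFunction_flip, BoundaryCondition.flip_free]

/-- **Evenness of the free energy**: `f_β(-h) = f_β(h)` for `β ≠ 0`. [cite: JiangNewman2023, §2 (b_k = 0 for odd k)] -/
theorem freeEnergy_neg {β : ℝ} (hβ : β ≠ 0) (h : ℝ) : freeEnergy d β (-h) = freeEnergy d β h := by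
  unfold freeEnergy
  congr 1
  funext n
  exact freeEnergyIn_neg d hβ _ _

/-! ### JN eq. (2.10)/(2.18): the box susceptibilities diverge for `β ≥ β_c` -/

/-- **JN (2.10)/(2.18)**: for `d ≥ 2` and `β ≥ β_c(d)`, the finite-volume susceptibilities
`∑_{v ∈ B_n} ⟨σ₀σ_v⟩^∅_{B_n,β,0}` tend to `+∞` (the tree's `χ(β) = ∞`,
`susceptibility_eq_top_of_criticalBeta_le`, and `S₀^{B_n} ↑ χ`,
`eventually_lt_volumeSusceptibility_box`). [cite: JiangNewman2023, §2 eq. (2.10)] -/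
theorem tendsto_volumeSusceptibility_box_atTop (hd : 2 ≤ d) {β : ℝ} (hβc : criticalBeta d ≤ β) :
    Tendsto (fun n : ℕ => volumeSusceptibility (zdGraph d) (box d n) β 0) atTop atTop := by
  have hβ : 0 ≤ β := (criticalBeta_nonneg d).trans hβc
  have htop : susceptibility d β = ⊤ := susceptibility_eq_top_of_criticalBeta_le hd hβc
  refine tendsto_atTop.2 fun r => ?_
  have hr : ENNReal.ofReal r < susceptibility d β := by rw [htop]; exact ENNReal.ofReal_lt_top
  filter_upwards [eventually_lt_volumeSusceptibility_box hβ hr] with n hn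
  exact (ENNReal.ofReal_lt_ofReal_iff'.1 hn).1.le

/-! ### Finite-volume inputs: `d/dh ln Z = β⟨M⟩`, the increment bound, volume comparison -/

section FiniteVolume

variable {V : Type*} [DecidableEq V] (G : SimpleGraph V) [G.LocallyFinite]

/-- **`d/dh ln Z^{bc}_{Λ;β,h} = β ⟨M_Λ⟩^{bc}_{Λ;β,h}`**, `M_Λ = ∑_{x ∈ Λ} σ_x` (the magnetisation
is the field derivative of the finite-volume pressure; Friedli–Velenik 2017, §3.7, proof of
Prop. 3.29; the factor `β` is the tree's parametrisation of the field). [cite: FriedliVelenik2017, §3.7, proof of Prop. 3.29 (m_Λ = ∂ψ_Λ/∂h)] -/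
theorem hasDerivAt_log_isingPartitionFunction (Λ : Finset V) (β h : ℝ) (bc : BoundaryCondition V) :
    HasDerivAt (fun h => Real.log (isingPartitionFunction G Λ β h bc))
      (β * isingExpect G Λ β h bc (fun σ => ∑ x ∈ Λ, spinAt x σ)) h := by
  have hM : Measurable fun σ : SpinConfig V => ∑ x ∈ Λ, spinAt x σ :=
    Finset.measurable_sum _ fun x _ => measurable_spinAt x
  set Mτ : (Λ → ℤˣ) → ℝ := fun τ => ∑ x ∈ Λ, spinAt x (glue Λ τ bc) with hMτ
  set Sτ : (Λ → ℤˣ) → ℝ := fun τ => ∑ e ∈ interactionEdges G Λ bc, bondSpin (glue Λ τ bc) e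
    with hSτ
  have hw : ∀ τ : Λ → ℤˣ, HasDerivAt (fun h => isingWeight G Λ β h bc τ)
      (β * Mτ τ * isingWeight G Λ β h bc τ) h := by
    intro τ
    have heq : (fun h => isingWeight G Λ β h bc τ) = fun h => Real.exp (β * Sτ τ + β * Mτ τ * h) := by
      funext h'
      rw [isingWeight, isingHamiltonian]
      congr 1
      simp only [hSτ, hMτ]
      ring
    rw [heq, isingWeight, isingHamiltonian]
    have h1 : HasDerivAt (fun h' : ℝ => β * Sτ τ + β * Mτ τ * h') (β * Mτ τ) h := by
      simpa using ((hasDerivAt_id h).const_mul (β * Mτ τ)).const_add (β * Sτ τ)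
    convert h1.exp using 1
    rw [mul_comm]
    congr 1
    congr 1
    simp only [hSτ, hMτ]
    ring
  have hZ : HasDerivAt (fun h => isingPartitionFunction G Λ β h bc)
      (∑ τ : Λ → ℤˣ, β * Mτ τ * isingWeight G Λ β h bc τ) h := by
    unfold isingPartitionFunction
    exact HasDerivAt.fun_sum fun τ _ => hw τ
  have hpos := isingPartitionFunction_pos G Λ β h bc
  refine (hZ.log hpos.ne').congr_deriv ?_
  rw [isingExpect, integral_isingMeasure G Λ β h bc hM, mul_div_assoc']
  congr 1
  rw [Finset.mul_sum]
  exact Finset.sum_congr rfl fun τ _ => by simp only [hMτ]; ring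

/-- `⟨M_Λ⟩ = ∑_{x ∈ Λ} ⟨σ_x⟩` with the one-point functions written as `isingCorr … {x}`. [folklore] -/
theorem isingExpect_sum_spinAt (Λ : Finset V) (β h : ℝ) (bc : BoundaryCondition V) :
    isingExpect G Λ β h bc (fun σ => ∑ x ∈ Λ, spinAt x σ) = ∑ x ∈ Λ, isingCorr G Λ β h bc {x} := by
  rw [isingExpect_finset_sum' G Λ h bc β Λ (fun x σ => spinAt x σ) fun x => measurable_spinAt x]
  refine Finset.sum_congr rfl fun x _ => ?_
  rw [isingCorr]
  congr 1
  funext σ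
  simp [spinProduct]

/-- **Increment bound** (convexity of `ln Z` in the field: mean value theorem and the GKS
monotonicity of `h ↦ ⟨σ_x⟩^∅_{Λ;β,h}` on `h ≥ 0`): for `β ≥ 0` and `0 ≤ h₁ ≤ h₂`,
`β (h₂ - h₁) ∑_x ⟨σ_x⟩^∅_{Λ;β,h₁} ≤ ln Z^∅_{Λ;β,h₂} - ln Z^∅_{Λ;β,h₁}`.
[cite: FriedliVelenik2017, §3.7, Prop. 3.29 and its proof] -/
theorem mul_sum_isingCorr_le_log_sub (Λ : Finset V) {β h₁ h₂ : ℝ} (hβ : 0 ≤ β) (hh₁ : 0 ≤ h₁)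
    (hh : h₁ ≤ h₂) :
    β * (h₂ - h₁) * ∑ x ∈ Λ, isingCorr G Λ β h₁ .free {x} ≤
      Real.log (isingPartitionFunction G Λ β h₂ .free) -
        Real.log (isingPartitionFunction G Λ β h₁ .free) := by
  rcases hh.eq_or_lt with rfl | hlt
  · simp
  set F : ℝ → ℝ := fun h => Real.log (isingPartitionFunction G Λ β h .free) with hF
  have hder : ∀ h, HasDerivAt F (β * ∑ x ∈ Λ, isingCorr G Λ β h .free {x}) h := fun h => by
    have := hasDerivAt_log_isingPartitionFunction G Λ β h .free
    rwa [isingExpect_sum_spinAt] at this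
  obtain ⟨ξ, hξ, hξeq⟩ := exists_hasDerivAt_eq_slope F
    (fun h => β * ∑ x ∈ Λ, isingCorr G Λ β h .free {x}) hlt
    (fun h _ => (hder h).continuousAt.continuousWithinAt) (fun h _ => hder h)
  have hpos : 0 < h₂ - h₁ := by linarith
  have hslope : F h₂ - F h₁ = (h₂ - h₁) * (β * ∑ x ∈ Λ, isingCorr G Λ β ξ .free {x}) := by
    rw [hξeq]; field_simp
  have hmono : ∑ x ∈ Λ, isingCorr G Λ β h₁ .free {x} ≤ ∑ x ∈ Λ, isingCorr G Λ β ξ .free {x} :=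
    Finset.sum_le_sum fun x hx => isingCorr_mono_params G hβ le_rfl hh₁ hξ.1.le (Or.inl rfl)
      (Finset.singleton_subset_iff.2 hx)
  simp only [hF] at hslope
  rw [hslope]
  have := mul_le_mul_of_nonneg_left hmono (mul_nonneg hβ hpos.le)
  nlinarith

end FiniteVolume

/-- A translate of `B_m` by a point of `B_k` lies in `B_{k+m}`. [folklore] -/
theorem map_shift_box_subset_box {k m : ℕ} {u : Site d} (hu : u ∈ box d k) :
    (box d m).map (Site.shift u).toEmbedding ⊆ box d (k + m) := by
  refine (map_shift_box_subset m u).trans (box_mono d ?_)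
  have : Site.supNorm u ≤ k := mem_box_iff_supNorm_le.1 hu
  omega

/-- **Volume comparison of the one-point function** (GKS II volume monotonicity, Friedli–Velenik
Exercise 3.12, and translation covariance, Exercise 3.14 / proof of Thm. 3.17): for `β, h ≥ 0` and
`u ∈ B_k`, `⟨σ₀⟩^∅_{B_m;β,h} ≤ ⟨σ_u⟩^∅_{B_{k+m};β,h}` (since `u + B_m ⊆ B_{k+m}`).
[cite: FriedliVelenik2017, Exercise 3.12, p. 112] -/
theorem isingCorr_box_zero_le {β h : ℝ} (hβ : 0 ≤ β) (hh : 0 ≤ h) {k m : ℕ} {u : Site d}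
    (hu : u ∈ box d k) :
    isingCorr (zdGraph d) (box d m) β h .free {0} ≤
      isingCorr (zdGraph d) (box d (k + m)) β h .free {u} := by
  have htr := isingCorr_free_map (G := zdGraph d) (G' := zdGraph d) (Site.shift u).toEmbedding
    (Λ := box d m) (fun a _ b _ => zdGraph_adj_shift_iff u a b) β h {0}
  have h0 : ({0} : Finset (Site d)).map (Site.shift u).toEmbedding = {u} := by
    rw [Finset.map_singleton]
    simp
  rw [h0] at htr
  rw [← htr]
  refine isingCorr_free_le_of_subset (zdGraph d) hβ hh ?_ (map_shift_box_subset_box d hu)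
  rw [← h0]
  exact Finset.map_subset_map.2 (Finset.singleton_subset_iff.2 (zero_mem_box d m))

/-- **Sum over the volume**: for `β, h ≥ 0`,
`|B_k| ⟨σ₀⟩^∅_{B_m;β,h} ≤ ∑_{x ∈ B_{k+m}} ⟨σ_x⟩^∅_{B_{k+m};β,h}` (the terms off `B_k` are
nonnegative by GKS I). [cite: FriedliVelenik2017, Exercise 3.12, p. 112] -/
theorem card_mul_isingCorr_box_zero_le {β h : ℝ} (hβ : 0 ≤ β) (hh : 0 ≤ h) (k m : ℕ) :
    (#(box d k) : ℝ) * isingCorr (zdGraph d) (box d m) β h .free {0} ≤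
      ∑ x ∈ box d (k + m), isingCorr (zdGraph d) (box d (k + m)) β h .free {x} := by
  have hgks : ∀ {Λ A : Finset (Site d)} {β h : ℝ} {bc : BoundaryCondition (Site d)},
      gks_one (zdGraph d) (Λ := Λ) (A := A) (β := β) (h := h) (bc := bc) :=
    Literature.Probability.LatticeModels.GKSInequalities.gks_one_holds (zdGraph d)
  calc (#(box d k) : ℝ) * isingCorr (zdGraph d) (box d m) β h .free {0}
      = #(box d k) • isingCorr (zdGraph d) (box d m) β h .free {0} := by rw [nsmul_eq_mul]
    _ ≤ ∑ x ∈ box d k, isingCorr (zdGraph d) (box d (k + m)) β h .free {x} :=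
        Finset.card_nsmul_le_sum _ _ _ fun u hu => isingCorr_box_zero_le d hβ hh hu
    _ ≤ ∑ x ∈ box d (k + m), isingCorr (zdGraph d) (box d (k + m)) β h .free {x} :=
        Finset.sum_le_sum_of_subset_of_nonneg (box_mono d (Nat.le_add_right k m))
          fun x hx _ => hgks hβ hh (Or.inl rfl) (Finset.singleton_subset_iff.2 hx)

/-- `|B_k| / |B_{k+m}| → 1` as `k → ∞`. [folklore] -/
theorem tendsto_card_box_div (m : ℕ) :
    Tendsto (fun k : ℕ => (#(box d k) : ℝ) / #(box d (k + m))) atTop (𝓝 1) := by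
  have h2 : Tendsto (fun k : ℕ => 2 * k + 1) atTop atTop :=
    tendsto_atTop_atTop.2 fun b => ⟨b, fun a ha => by omega⟩
  have hbase := (tendsto_natCast_div_add_atTop (2 * m : ℝ)).comp h2
  have hpow := hbase.pow d
  rw [one_pow] at hpow
  refine hpow.congr fun k => ?_
  simp only [Function.comp_apply, card_box, Nat.cast_pow, div_pow]
  congr 2
  push_cast
  ring

/-- **Step 1 (JN (2.25)–(2.26) on the free energy)**: for `β > 0`, `0 ≤ h₁ < h₂` and every `m`,
`(h₂ - h₁) ⟨σ₀⟩^∅_{B_m;β,h₁/β} ≤ f_β(h₂) - f_β(h₁)` (Jiang–Newman's field `h` is the tree's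
`h/β`). [cite: JiangNewman2023, Lemma 1, proof (displays (2.25)–(2.26))] -/
theorem mul_isingCorr_le_freeEnergy_sub {β : ℝ} (hβ : 0 < β) {h₁ h₂ : ℝ} (hh₁ : 0 ≤ h₁)
    (hh : h₁ < h₂) (m : ℕ) :
    (h₂ - h₁) * isingCorr (zdGraph d) (box d m) β (h₁ / β) .free {0} ≤
      freeEnergy d β h₂ - freeEnergy d β h₁ := by
  set c : ℝ := isingCorr (zdGraph d) (box d m) β (h₁ / β) .free {0} with hc
  have hβ0 : β ≠ 0 := hβ.ne'
  -- the finite-volume inequality in `B_{k+m}`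
  have hfin : ∀ k : ℕ, (h₂ - h₁) * ((#(box d k) : ℝ) / #(box d (k + m))) * c ≤
      freeEnergyIn d (box d (k + m)) β h₂ - freeEnergyIn d (box d (k + m)) β h₁ := by
    intro k
    have hN : (0 : ℝ) < #(box d (k + m)) := Nat.cast_pos.2 (Finset.card_pos.2 (box_nonempty d _))
    have h1 := mul_sum_isingCorr_le_log_sub (zdGraph d) (box d (k + m)) hβ.le
      (div_nonneg hh₁ hβ.le) (div_le_div_of_nonneg_right hh.le hβ.le) (h₁ := h₁ / β) (h₂ := h₂ / β)
    have h2 := card_mul_isingCorr_box_zero_le d hβ.le (div_nonneg hh₁ hβ.le) k m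
    rw [freeEnergyIn_eq_pressureIn d hβ0, freeEnergyIn_eq_pressureIn d hβ0, pressureIn, pressureIn,
      ← sub_div, le_div_iff₀ hN]
    have hββ : β * (h₂ / β - h₁ / β) = h₂ - h₁ := by field_simp
    rw [hββ] at h1
    have hpos : 0 ≤ h₂ - h₁ := by linarith
    calc (h₂ - h₁) * ((#(box d k) : ℝ) / #(box d (k + m))) * c * #(box d (k + m))
        = (h₂ - h₁) * ((#(box d k) : ℝ) * c) := by field_simp
      _ ≤ (h₂ - h₁) * ∑ x ∈ box d (k + m),
            isingCorr (zdGraph d) (box d (k + m)) β (h₁ / β) .free {x} :=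
          mul_le_mul_of_nonneg_left h2 hpos
      _ ≤ _ := h1
  -- pass to the limit `k → ∞`
  have hL : Tendsto (fun k : ℕ => (h₂ - h₁) * ((#(box d k) : ℝ) / #(box d (k + m))) * c) atTop
      (𝓝 ((h₂ - h₁) * 1 * c)) :=
    ((tendsto_card_box_div d m).const_mul (h₂ - h₁)).mul_const c
  rw [mul_one] at hL
  have hR : Tendsto (fun k : ℕ => freeEnergyIn d (box d (k + m)) β h₂ -
      freeEnergyIn d (box d (k + m)) β h₁) atTop (𝓝 (freeEnergy d β h₂ - freeEnergy d β h₁)) :=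
    ((tendsto_freeEnergyIn d β h₂).comp (tendsto_add_atTop_nat m)).sub
      ((tendsto_freeEnergyIn d β h₁).comp (tendsto_add_atTop_nat m))
  exact le_of_tendsto_of_tendsto' hL hR hfin

/-- The one-point function at zero field vanishes (spin flip): `⟨σ_x⟩^∅_{Λ;β,0} = 0` for `x ∈ Λ`.
This is the tree's `isingCorr_free_singleton_zero_field` (`MeanFieldBoundGHS.lean`); the name is
kept inside the `JiangNewman` namespace for the two uses below. [cite: FriedliVelenik2017, §3.7.1 eq. (3.33)] -/
theorem isingCorr_singleton_zero_field {V : Type*} [DecidableEq V] (G : SimpleGraph V)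
    [G.LocallyFinite] (Λ : Finset V) (β : ℝ) {x : V} (hx : x ∈ Λ) :
    isingCorr G Λ β 0 .free {x} = 0 :=
  isingCorr_free_singleton_zero_field G Λ β hx

/-- **The field derivative of `⟨σ₀⟩^∅_{B_m;β,h/β}` at `h = 0` is the box susceptibility**
`∑_{v ∈ B_m} ⟨σ₀σ_v⟩^∅_{B_m;β,0}` (JN display (2.26): `d⟨σ₀⟩_{B_n,h}/dh = ∑_v ⟨σ₀;σ_v⟩_{B_n,h}`,
at `h = 0` where `⟨σ_v⟩ = 0`). [cite: JiangNewman2023, Lemma 1, proof (display (2.26))] -/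
theorem hasDerivAt_isingCorr_box_zero {β : ℝ} (hβ : β ≠ 0) (m : ℕ) :
    HasDerivAt (fun h : ℝ => isingCorr (zdGraph d) (box d m) β (h / β) .free {0})
      (volumeSusceptibility (zdGraph d) (box d m) β 0) 0 := by
  have hφ := hasDerivAt_isingExpect_spinAt_field (zdGraph d) (box d m) β (0 / β) .free 0
  have hdiv : HasDerivAt (fun h : ℝ => h / β) (1 / β) 0 := by
    simpa using (hasDerivAt_id (0 : ℝ)).div_const β
  have hcomp := hφ.comp 0 hdiv
  have hfun : (fun h : ℝ => isingCorr (zdGraph d) (box d m) β (h / β) .free {0}) =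
      (fun h => isingExpect (zdGraph d) (box d m) β h .free (spinAt 0)) ∘ fun h : ℝ => h / β := by
    funext h
    simp only [Function.comp_apply, isingCorr]
    congr 1
    funext σ
    simp [spinProduct]
  have h0 : ∀ y ∈ box d m, isingExpect (zdGraph d) (box d m) β 0 .free (spinAt y) = 0 := by
    intro y hy
    have := isingCorr_singleton_zero_field (zdGraph d) (box d m) β hy
    rw [isingCorr] at this
    convert this using 2
    funext σ
    simp [spinProduct]
  rw [hfun]
  refine hcomp.congr_deriv ?_
  rw [zero_div, Finset.sum_congr rfl fun y hy => by rw [h0 y hy, mul_zero, sub_zero],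
    mul_comm β, mul_assoc, mul_one_div_cancel hβ, mul_one]
  rfl

/-- **JN Lemma 1 (for all `β ≥ β_c`)**, in the language of the fact: for `d ≥ 2`, `β ≥ β_c(d)` and
`ρ > 0`, the free energy `f_β` does NOT extend holomorphically to the disc `|h| < ρ`
(`¬ AnalyticOnDisc d β ρ`): otherwise `f''_β(0)` would dominate every box susceptibility
`∑_{v ∈ B_m} ⟨σ₀σ_v⟩_{B_m,β,0}`, which diverge for `β ≥ β_c` (JN (2.10), (2.24)–(2.28); see the
module docstring for the deviation from the printed route through `⟨σ₀⟩_{ℤ^d,β,h}`).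
[cite: JiangNewman2023, Lemma 1] -/
theorem not_analyticOnDisc_of_criticalBeta_le (hd : 2 ≤ d) {β : ℝ} (hβc : criticalBeta d ≤ β)
    {ρ : ℝ} (hρ : 0 < ρ) : ¬ AnalyticOnDisc d β ρ := by
  rintro ⟨F, hF, hFf⟩
  have hβ : 0 < β := (criticalBeta_pos_holds hd).trans_le hβc
  have hβ0 : β ≠ 0 := hβ.ne'
  set f : ℝ → ℝ := freeEnergy d β with hf
  -- the real trace of `F` and its derivatives
  set g' : ℝ → ℝ := fun t => (deriv F (t : ℂ)).re with hg'
  have hball : ∀ t : ℝ, |t| < ρ → ((t : ℂ)) ∈ Metric.ball (0 : ℂ) ρ := fun t ht => by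
    simpa [Metric.mem_ball, dist_zero_right, Complex.norm_real] using ht
  have hopen : IsOpen (Metric.ball (0 : ℂ) ρ) := Metric.isOpen_ball
  have hFan : AnalyticOnNhd ℂ F (Metric.ball 0 ρ) := hF.analyticOnNhd hopen
  -- `f` has derivative `g' t` at every `|t| < ρ`
  have hderf : ∀ t : ℝ, |t| < ρ → HasDerivAt f (g' t) t := by
    intro t ht
    have hFt : HasDerivAt F (deriv F (t : ℂ)) (t : ℂ) :=
      ((hF.differentiableAt (hopen.mem_nhds (hball t ht)))).hasDerivAt
    have hg : HasDerivAt (fun x : ℝ => (F x).re) (g' t) t := hFt.real_of_complex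
    refine hg.congr_of_eventuallyEq ?_
    have hnhds : {s : ℝ | |s| < ρ} ∈ 𝓝 t :=
      (isOpen_lt continuous_abs continuous_const).mem_nhds ht
    filter_upwards [hnhds] with s hs
    rw [hFf s hs, Complex.ofReal_re]
  -- `g'` is differentiable at `0`
  set D : ℝ := (deriv (deriv F) ((0 : ℝ) : ℂ)).re with hD
  have hderg' : HasDerivAt g' D 0 := by
    have h2 : HasDerivAt (deriv F) (deriv (deriv F) ((0 : ℝ) : ℂ)) ((0 : ℝ) : ℂ) :=
      (hFan.deriv.differentiableOn.differentiableAt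
        (hopen.mem_nhds (hball 0 (by simpa using hρ)))).hasDerivAt
    exact h2.real_of_complex
  -- `f'(0) = 0` by evenness
  have hg'0 : g' 0 = 0 := by
    have h0 := hderf 0 (by simpa using hρ)
    have hneg : HasDerivAt (fun t : ℝ => f (-t)) (g' 0 * -1) 0 := by
      have h0' : HasDerivAt f (g' 0) (-0 : ℝ) := by rwa [neg_zero]
      exact h0'.comp (0 : ℝ) (hasDerivAt_neg (0 : ℝ))
    have heven : (fun t : ℝ => f (-t)) = f := funext fun t => freeEnergy_neg d hβ0 t
    rw [heven] at hneg
    have := h0.unique hneg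
    linarith
  -- Step 2: `⟨σ₀⟩_{B_m,h/β} ≤ f'(h)` for `0 < h < ρ`
  have hstep2 : ∀ m : ℕ, ∀ h : ℝ, 0 < h → h < ρ →
      isingCorr (zdGraph d) (box d m) β (h / β) .free {0} ≤ g' h := by
    intro m h hh hhρ
    have hd' := hderf h (by rwa [abs_of_pos hh])
    rw [hasDerivAt_iff_tendsto_slope_zero] at hd'
    have hlim : Tendsto (fun t => t⁻¹ • (f (h + t) - f h)) (𝓝[>] 0) (𝓝 (g' h)) :=
      hd'.mono_left (nhdsGT_le_nhdsNE 0)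
    refine ge_of_tendsto hlim ?_
    filter_upwards [self_mem_nhdsWithin] with t (ht : 0 < t)
    have hle := mul_isingCorr_le_freeEnergy_sub d hβ hh.le (by linarith : h < h + t) m
    rw [add_sub_cancel_left] at hle
    rw [smul_eq_mul, ← div_eq_inv_mul, le_div_iff₀ ht, mul_comm]
    exact hle
  -- Step 3: `S₀^{B_m} ≤ D` for every `m`
  have hstep3 : ∀ m : ℕ, volumeSusceptibility (zdGraph d) (box d m) β 0 ≤ D := by
    intro m
    have hφ := hasDerivAt_isingCorr_box_zero d hβ0 m
    rw [hasDerivAt_iff_tendsto_slope_zero] at hφ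
    have hφ0 : isingCorr (zdGraph d) (box d m) β (0 / β) .free {0} = 0 := by
      rw [zero_div]; exact isingCorr_singleton_zero_field (zdGraph d) (box d m) β (zero_mem_box d m)
    have hL : Tendsto (fun t : ℝ => isingCorr (zdGraph d) (box d m) β (t / β) .free {0} / t)
        (𝓝[>] 0) (𝓝 (volumeSusceptibility (zdGraph d) (box d m) β 0)) := by
      refine (hφ.mono_left (nhdsGT_le_nhdsNE 0)).congr fun t => ?_
      rw [zero_add, hφ0, sub_zero, smul_eq_mul, inv_mul_eq_div]
    have hg'' := hderg'
    rw [hasDerivAt_iff_tendsto_slope_zero] at hg''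
    have hR : Tendsto (fun t : ℝ => g' t / t) (𝓝[>] 0) (𝓝 D) := by
      refine (hg''.mono_left (nhdsGT_le_nhdsNE 0)).congr fun t => ?_
      rw [zero_add, hg'0, sub_zero, smul_eq_mul, inv_mul_eq_div]
    refine le_of_tendsto_of_tendsto hL hR ?_
    filter_upwards [Ioo_mem_nhdsGT hρ] with t ht
    exact div_le_div_of_nonneg_right (hstep2 m t ht.1 ht.2) ht.1.le
  -- Step 4: contradiction with the divergence of the box susceptibilities
  have hdiv := tendsto_volumeSusceptibility_box_atTop d hd hβc
  obtain ⟨m, hm⟩ := (hdiv.eventually_gt_atTop D).exists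
  exact absurd hm (not_lt.2 (hstep3 m))

/-! ### Symmetries of the complex-field partition function -/

section Symmetries

variable {d}

/-- The bond energy is even under the global spin flip: `∑_{e ∈ ℰ_Λ} σ_e(-τ) = ∑_{e ∈ ℰ_Λ} σ_e(τ)`
(free boundary condition). [folklore] -/
theorem sum_bondSpin_glue_neg (Λ : Finset (Site d)) (τ : Λ → ℤˣ) :
    ∑ e ∈ edgesIn (zdGraph d) Λ, bondSpin (glue Λ (-τ) .free) e =
      ∑ e ∈ edgesIn (zdGraph d) Λ, bondSpin (glue Λ τ .free) e := by
  have h := isingHamiltonian_glue_neg_flip (zdGraph d) Λ 0 .free τ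
  simp only [isingHamiltonian, neg_zero, BoundaryCondition.flip_free, interactionEdges_free,
    zero_mul, sub_zero, neg_inj] at h
  exact h

/-- The magnetisation is odd under the global spin flip. [folklore] -/
theorem sum_spinAt_glue_neg (Λ : Finset (Site d)) (τ : Λ → ℤˣ) :
    ∑ x ∈ Λ, spinAt x (glue Λ (-τ) .free) = -∑ x ∈ Λ, spinAt x (glue Λ τ .free) := by
  rw [← Finset.sum_neg_distrib]
  refine Finset.sum_congr rfl fun x hx => ?_
  have := spinAt_glue_neg_flip_of_mem Λ τ .free hx
  rwa [BoundaryCondition.flip_free] at this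

/-- **Evenness** `Z_{Λ,β,-h} = Z_{Λ,β,h}` for complex `h` (global spin flip), whence the zeros come
in pairs `± iα_j`. [cite: JiangNewman2023, §1 eq. (1.3)] -/
theorem partitionFunction_neg (Λ : Finset (Site d)) (β : ℝ) (h : ℂ) :
    partitionFunction d Λ β (-h) = partitionFunction d Λ β h := by
  unfold partitionFunction
  refine Fintype.sum_equiv (Equiv.neg _) _ _ fun τ => ?_
  rw [Equiv.neg_apply, sum_bondSpin_glue_neg, sum_spinAt_glue_neg]
  congr 1
  push_cast
  ring

/-- **Reality**: `Z_{Λ,β,h̄} = conj Z_{Λ,β,h}` (real Boltzmann weights). [folklore] -/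
theorem partitionFunction_conj (Λ : Finset (Site d)) (β : ℝ) (h : ℂ) :
    partitionFunction d Λ β (starRingEnd ℂ h) = starRingEnd ℂ (partitionFunction d Λ β h) := by
  unfold partitionFunction
  rw [map_sum]
  refine Finset.sum_congr rfl fun τ _ => ?_
  rw [← Complex.exp_conj, map_add, map_mul, Complex.conj_ofReal, Complex.conj_ofReal]

/-- `Z_{Λ,β,it}` is real for real `t` (`conj Z(it) = Z(-it) = Z(it)`). [cite: JiangNewman2023, §2 (Z_{Λ,β,ih} as a function of real h)] -/
theorem partitionFunction_mul_I_im (Λ : Finset (Site d)) (β t : ℝ) :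
    (partitionFunction d Λ β (t * I)).im = 0 := by
  have h1 : starRingEnd ℂ (partitionFunction d Λ β (t * I)) = partitionFunction d Λ β (t * I) := by
    rw [← partitionFunction_conj, map_mul, Complex.conj_ofReal, Complex.conj_I, mul_neg,
      partitionFunction_neg]
  exact Complex.conj_eq_iff_im.1 h1

/-- `Z_{Λ,β,0} > 0` (as the real part of the value at `h = 0`). [folklore] -/
theorem partitionFunction_zero_re_pos (Λ : Finset (Site d)) (β : ℝ) :
    0 < (partitionFunction d Λ β 0).re := by
  have := partitionFunction_ofReal_re_pos d Λ β 0
  rwa [Complex.ofReal_zero] at this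

/-- `Z_{Λ,β,0} ≠ 0`. [folklore] -/
theorem partitionFunction_zero_ne_zero (Λ : Finset (Site d)) (β : ℝ) :
    partitionFunction d Λ β 0 ≠ 0 := fun h => by
  have := partitionFunction_zero_re_pos Λ β
  rw [h, Complex.zero_re] at this
  exact lt_irrefl _ this

end Symmetries

/-! ### The Lee–Yang theorem for `Z_{Λ,β,h}` (transport of `lee_yang_circle_theorem_finite`) -/

section LeeYang

variable {d}

/-- An ordered representative `(a, b)` of an edge `e ∈ ℰ_Λ`: `e = {a, b}` with `a, b ∈ Λ` and
`σ_e = σ_a σ_b`. [folklore] -/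
theorem out_spec {Λ : Finset (Site d)} {e : Sym2 (Site d)} (he : e ∈ edgesIn (zdGraph d) Λ) :
    (Quot.out e : Site d × Site d).1 ∈ Λ ∧ (Quot.out e : Site d × Site d).2 ∈ Λ ∧
      ∀ σ : SpinConfig (Site d), bondSpin σ e =
        spinAt (Quot.out e : Site d × Site d).1 σ * spinAt (Quot.out e : Site d × Site d).2 σ := by
  have hmk : s((Quot.out e : Site d × Site d).1, (Quot.out e : Site d × Site d).2) = e :=
    Quot.out_eq e
  rw [mem_edgesIn_iff] at he
  have h1 : (Quot.out e : Site d × Site d).1 ∈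
      s((Quot.out e : Site d × Site d).1, (Quot.out e : Site d × Site d).2) := Sym2.mem_mk_left _ _
  have h2 : (Quot.out e : Site d × Site d).2 ∈
      s((Quot.out e : Site d × Site d).1, (Quot.out e : Site d × Site d).2) := Sym2.mem_mk_right _ _
  rw [hmk] at h1 h2
  refine ⟨he.2 _ h1, he.2 _ h2, fun σ => ?_⟩
  conv_lhs => rw [← hmk]
  rfl

/-- Evaluation of the double sum defining the transported couplings: with `x = e.symm`, for an edge
`e' = {a, b}` of `Λ`, `∑ᵢ∑ⱼ [a = xᵢ ∧ b = xⱼ] s(xᵢ)s(xⱼ) = s(a) s(b)`. [folklore] -/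
theorem sum_sum_ite_out {Λ : Finset (Site d)} {n : ℕ} (e : Λ ≃ Fin n) (s : Site d → ℂ)
    {e' : Sym2 (Site d)} (he' : e' ∈ edgesIn (zdGraph d) Λ) :
    ∑ i, ∑ j, (if (Quot.out e' : Site d × Site d).1 = (e.symm i : Site d) ∧
        (Quot.out e' : Site d × Site d).2 = (e.symm j : Site d) then (1 : ℂ) else 0) *
        (s (e.symm i) * s (e.symm j)) =
      s (Quot.out e' : Site d × Site d).1 * s (Quot.out e' : Site d × Site d).2 := by
  obtain ⟨ha, hb, -⟩ := out_spec he'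
  set a := (Quot.out e' : Site d × Site d).1 with hadef
  set b := (Quot.out e' : Site d × Site d).2 with hbdef
  set i₀ : Fin n := e ⟨a, ha⟩ with hi₀
  set j₀ : Fin n := e ⟨b, hb⟩ with hj₀
  have hxi₀ : (e.symm i₀ : Site d) = a := by rw [hi₀, Equiv.symm_apply_apply]
  have hxj₀ : (e.symm j₀ : Site d) = b := by rw [hj₀, Equiv.symm_apply_apply]
  have huniq_i : ∀ i, a = (e.symm i : Site d) → i = i₀ := fun i hi => by
    rw [hi₀]; apply e.symm.injective; rw [Equiv.symm_apply_apply]; exact Subtype.ext hi.symm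
  have huniq_j : ∀ j, b = (e.symm j : Site d) → j = j₀ := fun j hj => by
    rw [hj₀]; apply e.symm.injective; rw [Equiv.symm_apply_apply]; exact Subtype.ext hj.symm
  rw [Finset.sum_eq_single i₀, Finset.sum_eq_single j₀]
  · rw [if_pos ⟨hxi₀.symm, hxj₀.symm⟩, one_mul, hxi₀, hxj₀]
  · intro j _ hj
    rw [if_neg, zero_mul]
    exact fun h => hj (huniq_j j h.2)
  · intro h; exact absurd (Finset.mem_univ _) h
  · intro i _ hi
    refine Finset.sum_eq_zero fun j _ => ?_
    rw [if_neg, zero_mul]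
    exact fun h => hi (huniq_i i h.1)
  · intro h; exact absurd (Finset.mem_univ _) h

/-- **Lee–Yang for `Z_{Λ,β,h}`, right half plane**: for `β ≥ 0` and `Re h > 0`,
`Z_{Λ,β,h} ≠ 0` — the tree's `lee_yang_circle_theorem_finite_holds` (Lee–Yang 1952, App. II;
Asano contractions) transported from `Fin n → Bool` to the configurations `Λ → ℤˣ`, with the
couplings `J i j = β · #{e ∈ ℰ_Λ : out e = (xᵢ, xⱼ)}` (one ordered representative per edge).
[cite: LeeYang1952, Appendix II] -/
theorem partitionFunction_ne_zero_of_re_pos {β : ℝ} (hβ : 0 ≤ β) (Λ : Finset (Site d)) {h : ℂ}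
    (hh : 0 < h.re) : partitionFunction d Λ β h ≠ 0 := by
  classical
  set n := Fintype.card Λ with hn
  set e : Λ ≃ Fin n := Fintype.equivFin Λ with he
  set E := edgesIn (zdGraph d) Λ with hE
  -- transported couplings
  set J : Fin n → Fin n → ℝ := fun i j => β * ∑ e' ∈ E,
    (if (Quot.out e' : Site d × Site d).1 = (e.symm i : Site d) ∧
      (Quot.out e' : Site d × Site d).2 = (e.symm j : Site d) then (1 : ℝ) else 0) with hJ
  have hJ0 : ∀ i j, 0 ≤ J i j := fun i j =>
    mul_nonneg hβ (Finset.sum_nonneg fun _ _ => by split_ifs <;> norm_num)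
  -- configurations coded by Booleans
  set Φ : (Λ → ℤˣ) ≃ (Fin n → Bool) :=
    { toFun := fun τ i => decide (τ (e.symm i) = 1)
      invFun := fun σ z => if σ (e z) then 1 else -1
      left_inv := fun τ => funext fun z => by
        simp only [Equiv.symm_apply_apply]
        rcases Int.units_eq_one_or (τ z) with h1 | h1 <;> simp [h1]
      right_inv := fun σ => funext fun i => by
        simp only [Equiv.apply_symm_apply]
        cases σ i <;> simp } with hΦ
  have hΦapp : ∀ τ i, Φ τ i = decide (τ (e.symm i) = 1) := fun τ i => rfl
  have hLY := lee_yang_circle_theorem_finite_holds n J (fun _ => h) hJ0 (fun _ => hh)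
  -- the per-configuration identity
  have key : partitionFunction d Λ β h = ∑ σ : Fin n → Bool,
      Complex.exp ((∑ i, ∑ j, ((J i j : ℂ) * (if σ i = σ j then 1 else -1))) +
        ∑ i, h * (if σ i then 1 else -1)) := by
    unfold partitionFunction
    refine Fintype.sum_equiv Φ _ _ fun τ => ?_
    set s : Site d → ℂ := fun v => (spinAt v (glue Λ τ .free) : ℂ) with hs
    have hsx : ∀ i, s (e.symm i) = ((τ (e.symm i) : ℤ) : ℂ) := fun i => by
      rw [hs]
      dsimp only
      rw [spinAt_glue_coe, spinAt]
      push_cast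
      rfl
    have hQ : ∀ i, (if Φ τ i then (1 : ℂ) else -1) = s (e.symm i) := fun i => by
      rw [hΦapp, hsx]
      rcases Int.units_eq_one_or (τ (e.symm i)) with h1 | h1 <;> simp [h1]
    have hP : ∀ i j, (if Φ τ i = Φ τ j then (1 : ℂ) else -1) = s (e.symm i) * s (e.symm j) := by
      intro i j
      rw [hΦapp, hΦapp, hsx, hsx]
      rcases Int.units_eq_one_or (τ (e.symm i)) with h1 | h1 <;>
        rcases Int.units_eq_one_or (τ (e.symm j)) with h2 | h2 <;> simp [h1, h2]
    simp_rw [hP, hQ]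
    congr 1
    congr 1
    · -- bond part
      have hbond : ∀ e' ∈ E, (bondSpin (glue Λ τ .free) e' : ℂ) =
          s (Quot.out e' : Site d × Site d).1 * s (Quot.out e' : Site d × Site d).2 := by
        intro e' he'
        rw [(out_spec he').2.2]
        push_cast
        rfl
      calc ((β * ∑ e' ∈ E, bondSpin (glue Λ τ .free) e' : ℝ) : ℂ)
          = (β : ℂ) * ∑ e' ∈ E, s (Quot.out e' : Site d × Site d).1 *
              s (Quot.out e' : Site d × Site d).2 := by
            push_cast
            rw [Finset.sum_congr rfl hbond]
        _ = (β : ℂ) * ∑ e' ∈ E, ∑ i, ∑ j,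
              (if (Quot.out e' : Site d × Site d).1 = (e.symm i : Site d) ∧
                (Quot.out e' : Site d × Site d).2 = (e.symm j : Site d) then (1 : ℂ) else 0) *
              (s (e.symm i) * s (e.symm j)) := by
            rw [Finset.sum_congr rfl fun e' he' => (sum_sum_ite_out e s he').symm]
        _ = ∑ i, ∑ j, (J i j : ℂ) * (s (e.symm i) * s (e.symm j)) := by
            have hJc : ∀ i j, (J i j : ℂ) = (β : ℂ) * ∑ e' ∈ E,
                (if (Quot.out e' : Site d × Site d).1 = (e.symm i : Site d) ∧
                  (Quot.out e' : Site d × Site d).2 = (e.symm j : Site d) then (1 : ℂ) else 0) := by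
              intro i j
              simp only [hJ, Complex.ofReal_mul, Complex.ofReal_sum]
              congr 1
              refine Finset.sum_congr rfl fun e' _ => ?_
              split_ifs <;> simp
            simp_rw [hJc]
            simp only [Finset.mul_sum, Finset.sum_mul, mul_assoc]
            rw [Finset.sum_comm]
            refine Finset.sum_congr rfl fun i _ => ?_
            rw [Finset.sum_comm]
    · -- field part
      rw [sum_spinAt_glue, ← Finset.mul_sum]
      congr 1
      push_cast
      rw [← Equiv.sum_comp e.symm]
      exact Finset.sum_congr rfl fun i _ => (hsx i).symm
  rw [key]
  exact hLY

/-- **Lee–Yang for `Z_{Λ,β,h}`** (Lee–Yang 1952, Appendix II; JN §1: "all zeros of `Z_{Λ,β,h}`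
… are purely imaginary"): for `β ≥ 0`, `Z_{Λ,β,h} = 0` forces `Re h = 0`.
[cite: LeeYang1952, Appendix II] -/
theorem partitionFunction_ne_zero_of_re_ne_zero {β : ℝ} (hβ : 0 ≤ β) (Λ : Finset (Site d))
    {h : ℂ} (hh : h.re ≠ 0) : partitionFunction d Λ β h ≠ 0 := by
  rcases lt_or_gt_of_ne hh with hlt | hgt
  · rw [← partitionFunction_neg]
    exact partitionFunction_ne_zero_of_re_pos hβ Λ (by rw [Complex.neg_re]; linarith)
  · exact partitionFunction_ne_zero_of_re_pos hβ Λ hgt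

end LeeYang

/-! ### Continuity, the trigonometric product over the zeros, the first zero -/

section FirstZero

variable {d}

/-- `h ↦ Z_{Λ,β,h}` is an entire function (a finite sum of exponentials of affine functions).
[cite: JiangNewman2023, §2 (Z_{Λ,β,h} is entire of exponential order 1)] -/
theorem differentiable_partitionFunction (Λ : Finset (Site d)) (β : ℝ) :
    Differentiable ℂ fun h : ℂ => partitionFunction d Λ β h := by
  unfold partitionFunction
  refine Differentiable.fun_sum fun τ _ => ?_   -- sum of differentiable
  exact ((differentiable_const _).add ((differentiable_id).mul (differentiable_const _))).cexp

/-- `h ↦ Z_{Λ,β,h}` is continuous. [folklore] -/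
theorem continuous_partitionFunction (Λ : Finset (Site d)) (β : ℝ) :
    Continuous fun h : ℂ => partitionFunction d Λ β h :=
  (differentiable_partitionFunction Λ β).continuous

/-- `t ↦ Z_{Λ,β,it}` is continuous on `ℝ`. [folklore] -/
theorem continuous_partitionFunction_mul_I (Λ : Finset (Site d)) (β : ℝ) :
    Continuous fun t : ℝ => partitionFunction d Λ β (t * I) :=
  (continuous_partitionFunction Λ β).comp (Complex.continuous_ofReal.mul continuous_const)

/-- The magnetisation of `τ` is `2 #{up spins} - |Λ|`. [folklore] -/
theorem sum_spinAt_glue_eq_card (Λ : Finset (Site d)) (τ : Λ → ℤˣ) :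
    ∑ x ∈ Λ, spinAt x (glue Λ τ .free) =
      2 * (#(univ.filter fun z : Λ => τ z = 1) : ℝ) - #Λ := by
  classical
  rw [sum_spinAt_glue]
  have hτ : ∀ z : Λ, ((τ z : ℤ) : ℝ) = if τ z = 1 then 1 else -1 := fun z => by
    rcases Int.units_eq_one_or (τ z) with h | h <;> simp [h]
  simp_rw [hτ]
  rw [Finset.sum_ite, Finset.sum_const, Finset.sum_const, nsmul_eq_mul, nsmul_eq_mul, mul_one,
    mul_neg, mul_one]
  have hcard := Finset.card_filter_add_card_filter_not (s := (univ : Finset Λ))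
    (fun z : Λ => τ z = 1)
  rw [Finset.card_univ, Fintype.card_coe] at hcard
  have : (#(univ.filter fun z : Λ => ¬ τ z = 1) : ℝ) = #Λ - #(univ.filter fun z : Λ => τ z = 1) := by
    rw [eq_sub_iff_add_eq, ← Nat.cast_add, add_comm, hcard]
  rw [this]
  ring

/-- **The trigonometric product over the Lee–Yang zeros** (JN §2, proof of Prop. 2: Hadamard
factorisation `Z_{Λ,β,h} = Z_{Λ,β,0} ∏_j (1 + h²/α_j²)`, [HouJiangNewman2023, Lemma 1]; here in the
FINITE, Hadamard-free form of the tree's `LeeYangTrig.exists_trig_prod` for the lattice law of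
`M_Λ`, Lee–Yang 1952 App. II / Newman 1975 Prop. 2): for `β ≥ 0` and finite `Λ` there are
`a ∈ ℕ` and angles `θ ∈ (0, π)` (a multiset `S`, `a + 2|S| = |Λ|`) with
`Z_{Λ,β,it} = Z_{Λ,β,0} · cos(t)^a ∏_{θ ∈ S} (1 - sin²t / sin²(θ/2))` for all real `t`; the zeros
of `t ↦ Z_{Λ,β,it}` in `(0, π)` are `π/2` (if `a ≥ 1`) and the `θ/2`, `π - θ/2`.
[cite: JiangNewman2023, §2 eq. (2.13) and the 2|Λ|-zeros-per-period count before (2.16)] -/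
theorem exists_trig_prod_partitionFunction {β : ℝ} (hβ : 0 ≤ β) (Λ : Finset (Site d)) :
    ∃ (a : ℕ) (S : Multiset ℝ), (∀ θ ∈ S, 0 < θ ∧ θ < Real.pi) ∧ a + 2 * Multiset.card S = #Λ ∧
      ∀ t : ℝ, partitionFunction d Λ β (t * I) = partitionFunction d Λ β 0 *
        ((Real.cos t ^ a * (S.map fun θ => 1 - Real.sin t ^ 2 / Real.sin (θ / 2) ^ 2).prod : ℝ) :
          ℂ) := by
  classical
  -- zero-field weights, partition function and Gibbs probabilities
  set w : (Λ → ℤˣ) → ℝ := fun τ =>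
    Real.exp (β * ∑ e ∈ edgesIn (zdGraph d) Λ, bondSpin (glue Λ τ .free) e) with hw
  set Z0 : ℝ := ∑ τ, w τ with hZ0
  have hwpos : ∀ τ, 0 < w τ := fun τ => Real.exp_pos _
  have hZ0pos : 0 < Z0 := Finset.sum_pos (fun τ _ => hwpos τ) Finset.univ_nonempty
  have hZ0eq : partitionFunction d Λ β 0 = (Z0 : ℂ) := by
    rw [← Complex.ofReal_zero, partitionFunction_ofReal]
    simp [hZ0, hw]
  set c : (Λ → ℤˣ) → ℝ := fun τ => w τ / Z0 with hc
  set deg : (Λ → ℤˣ) → ℕ := fun τ => #(univ.filter fun z : Λ => τ z = 1) with hdeg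
  have hcpos : ∀ τ, 0 < c τ := fun τ => div_pos (hwpos τ) hZ0pos
  have hdegle : ∀ τ, deg τ ≤ #Λ := fun τ => by
    rw [hdeg]
    exact (Finset.card_filter_le _ _).trans (by rw [Finset.card_univ, Fintype.card_coe])
  have hi₀ : deg (fun _ => -1) = 0 := by simp [hdeg]
  have hi₁ : deg (fun _ => 1) = #Λ := by simp [hdeg]
  have hc1 : ∑ τ, c τ = 1 := by
    rw [hc]
    simp only [← Finset.sum_div]
    exact div_self hZ0pos.ne'
  -- the Laplace transform of the law of `M_Λ` is `Z_{Λ,β,z}/Z_{Λ,β,0}`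
  have hexp : ∀ z : ℂ, LeeYangTrig.expPoly c deg (#Λ) 1 z = (Z0 : ℂ)⁻¹ * partitionFunction d Λ β z := by
    intro z
    rw [LeeYangTrig.expPoly, partitionFunction, Finset.mul_sum]
    refine Finset.sum_congr rfl fun τ _ => ?_
    rw [sum_spinAt_glue_eq_card, Complex.exp_add, hc]
    simp only [hdeg, hw]
    push_cast
    rw [one_mul]
    ring
  have hLY : ∀ z : ℂ, LeeYangTrig.expPoly c deg (#Λ) 1 z = 0 → z.re = 0 := by
    intro z hz
    rw [hexp, mul_eq_zero] at hz
    rcases hz with hz | hz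
    · exact absurd hz (inv_ne_zero (Complex.ofReal_ne_zero.2 hZ0pos.ne'))
    · by_contra hre
      exact partitionFunction_ne_zero_of_re_ne_zero hβ Λ hre hz
  obtain ⟨a, S, hS, hcard, hprod⟩ := LeeYangTrig.exists_trig_prod (c := c) (deg := deg) (n := #Λ)
    (ω := 1) hcpos hdegle (i₀ := fun _ => -1) (i₁ := fun _ => 1) hi₀ hi₁ hc1 one_ne_zero hLY
  refine ⟨a, S, hS, hcard, fun t => ?_⟩
  have h := hprod t
  rw [hexp] at h
  simp only [mul_one] at h
  rw [hZ0eq, ← h, ← mul_assoc, mul_inv_cancel₀ (Complex.ofReal_ne_zero.2 hZ0pos.ne'), one_mul]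

/-- **Existence of a Lee–Yang zero in `(0, π/2]`**: for `β ≥ 0` and nonempty `Λ`, `Z_{Λ,β,it}`
vanishes for some `0 < t ≤ π/2` (`t = π/2` if the factor `cos t` is present, else `t = θ/2`).
[cite: JiangNewman2023, §2 (exactly 2|Λ| zeros of Z_{Λ,β,ih} per period)] -/
theorem exists_zero_partitionFunction {β : ℝ} (hβ : 0 ≤ β) {Λ : Finset (Site d)}
    (hΛ : Λ.Nonempty) :
    ∃ t : ℝ, 0 < t ∧ t ≤ Real.pi / 2 ∧ partitionFunction d Λ β (t * I) = 0 := by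
  obtain ⟨a, S, hS, hcard, hprod⟩ := exists_trig_prod_partitionFunction hβ Λ
  by_cases hS0 : S = 0
  · -- no angles: `a = |Λ| ≥ 1`, zero at `π/2`
    subst hS0
    have ha : a ≠ 0 := by
      simp only [Multiset.card_zero, mul_zero, add_zero] at hcard
      rw [hcard]
      exact (Finset.card_pos.2 hΛ).ne'
    refine ⟨Real.pi / 2, by positivity, le_rfl, ?_⟩
    rw [hprod, Real.cos_pi_div_two, zero_pow ha, zero_mul, Complex.ofReal_zero, mul_zero]
  · obtain ⟨θ, hθ⟩ := Multiset.exists_mem_of_ne_zero hS0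
    obtain ⟨hθ0, hθπ⟩ := hS θ hθ
    have hsin : Real.sin (θ / 2) ≠ 0 :=
      (Real.sin_pos_of_pos_of_lt_pi (by linarith) (by linarith)).ne'
    refine ⟨θ / 2, by linarith, by linarith, ?_⟩
    rw [hprod]
    have h0 : (S.map fun θ' => 1 - Real.sin (θ / 2) ^ 2 / Real.sin (θ' / 2) ^ 2).prod = 0 := by
      apply Multiset.prod_eq_zero
      exact Multiset.mem_map.2 ⟨θ, hθ, by rw [div_self (pow_ne_zero 2 hsin), sub_self]⟩
    rw [h0, mul_zero, Complex.ofReal_zero, mul_zero]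

/-- No zeros near `t = 0`: there is `ε > 0` with `Z_{Λ,β,it} ≠ 0` for `|t| < ε` (`Z_{Λ,β,0} > 0`
and continuity). [folklore] -/
theorem exists_pos_forall_ne_zero (Λ : Finset (Site d)) (β : ℝ) :
    ∃ ε : ℝ, 0 < ε ∧ ∀ t : ℝ, |t| < ε → partitionFunction d Λ β (t * I) ≠ 0 := by
  have h0 : partitionFunction d Λ β ((0 : ℝ) * I) ≠ 0 := by
    rw [Complex.ofReal_zero, zero_mul]; exact partitionFunction_zero_ne_zero Λ β
  have hev := ((continuous_partitionFunction_mul_I Λ β).continuousAt (x := 0)).eventually_ne h0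
  obtain ⟨ε, hε, hball⟩ := Metric.eventually_nhds_iff.1 hev
  exact ⟨ε, hε, fun t ht => hball (by simpa [Real.dist_eq] using ht)⟩

/-- **The first zero** `α₁(Λ, β)` for `β ≥ 0` and nonempty `Λ`: `0 < α₁ ≤ π/2` and
`Z_{Λ,β,iα₁} = 0` (the infimum in `firstZero` is attained). [cite: JiangNewman2023, §1 eq. (1.3)] -/
theorem firstZero_spec {β : ℝ} (hβ : 0 ≤ β) {Λ : Finset (Site d)} (hΛ : Λ.Nonempty) :
    0 < firstZero d Λ β ∧ firstZero d Λ β ≤ Real.pi / 2 ∧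
      partitionFunction d Λ β (firstZero d Λ β * I) = 0 := by
  set T : Set ℝ := {t : ℝ | 0 < t ∧ partitionFunction d Λ β (t * I) = 0} with hT
  have hfz : firstZero d Λ β = sInf T := rfl
  obtain ⟨t₁, ht₁0, ht₁le, ht₁Z⟩ := exists_zero_partitionFunction hβ hΛ
  have hne : T.Nonempty := ⟨t₁, ht₁0, ht₁Z⟩
  have hbdd : BddBelow T := ⟨0, fun t ht => ht.1.le⟩
  obtain ⟨ε, hε, hεZ⟩ := exists_pos_forall_ne_zero Λ β
  have hTε : ∀ t ∈ T, ε ≤ t := fun t ht => by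
    by_contra hlt
    exact hεZ t (by rw [abs_of_pos ht.1]; linarith) ht.2
  -- `T` is closed: it coincides with `{t | ε ≤ t ∧ Z(it) = 0}`
  have hTeq : T = {t : ℝ | ε ≤ t ∧ partitionFunction d Λ β (t * I) = 0} := by
    ext t
    exact ⟨fun ht => ⟨hTε t ht, ht.2⟩, fun ht => ⟨hε.trans_le ht.1, ht.2⟩⟩
  have hclosed : IsClosed T := by
    rw [hTeq, Set.setOf_and]
    exact (isClosed_le continuous_const continuous_id).inter
      (isClosed_eq (continuous_partitionFunction_mul_I Λ β) continuous_const)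
  have hmem : sInf T ∈ T := hclosed.csInf_mem hne hbdd
  refine ⟨?_, ?_, ?_⟩
  · rw [hfz]; exact hmem.1
  · rw [hfz]; exact (csInf_le hbdd ⟨ht₁0, ht₁Z⟩).trans ht₁le
  · rw [hfz]; exact hmem.2

/-- `α₁(Λ,β)` is a lower bound for the positive zeros: if `Z_{Λ,β,it} = 0` with `t > 0` then
`α₁ ≤ t`. [cite: JiangNewman2023, §1 eq. (1.3)] -/
theorem firstZero_le_of_zero (Λ : Finset (Site d)) (β : ℝ) {t : ℝ} (ht : 0 < t)
    (hZ : partitionFunction d Λ β (t * I) = 0) : firstZero d Λ β ≤ t :=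
  csInf_le ⟨0, fun _ hs => hs.1.le⟩ ⟨ht, hZ⟩

/-- **No zero on the imaginary axis below the first zero**: `Z_{Λ,β,it} ≠ 0` for `|t| < α₁(Λ,β)`.
[cite: JiangNewman2023, §2 (ln Z analytic in |h| < α₁)] -/
theorem partitionFunction_mul_I_ne_zero_of_abs_lt (Λ : Finset (Site d)) (β : ℝ) {t : ℝ}
    (ht : |t| < firstZero d Λ β) : partitionFunction d Λ β (t * I) ≠ 0 := by
  intro hZ
  rcases lt_trichotomy t 0 with hlt | rfl | hgt
  · have hZ' : partitionFunction d Λ β ((-t : ℝ) * I) = 0 := by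
      rw [Complex.ofReal_neg, neg_mul, partitionFunction_neg]; exact hZ
    have := firstZero_le_of_zero Λ β (by linarith) hZ'
    rw [abs_of_neg hlt] at ht
    linarith
  · rw [Complex.ofReal_zero, zero_mul] at hZ
    exact partitionFunction_zero_ne_zero Λ β hZ
  · have := firstZero_le_of_zero Λ β hgt hZ
    rw [abs_of_pos hgt] at ht
    linarith

/-- **The zero-free disc** (JN eq. (2.4): `ln Z_{Λ,β,h}` is analytic in `|h| < α₁(Λ,β)`): for
`β ≥ 0`, `Z_{Λ,β,h} ≠ 0` whenever `|h| < α₁(Λ, β)` (Lee–Yang off the axis, the definition of `α₁`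
on it). [cite: JiangNewman2023, §2 eq. (2.4)] -/
theorem partitionFunction_ne_zero_of_norm_lt {β : ℝ} (hβ : 0 ≤ β) (Λ : Finset (Site d)) {h : ℂ}
    (hh : ‖h‖ < firstZero d Λ β) : partitionFunction d Λ β h ≠ 0 := by
  by_cases hre : h.re = 0
  · have heq : h = (h.im : ℂ) * I := by
      apply Complex.ext <;> simp [hre]
    rw [heq]
    refine partitionFunction_mul_I_ne_zero_of_abs_lt Λ β (lt_of_le_of_lt ?_ hh)
    exact Complex.abs_im_le_norm h
  · exact partitionFunction_ne_zero_of_re_ne_zero hβ Λ hre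

end FirstZero

/-! ### JN (2.15)–(2.17) for `k = 1`: the second moment of `M_Λ` against the first zero -/

section SecondMoment

variable {d}

/-- `1 - x₀ ∏ m ≤ (1 - x₀) + ∑ (1 - x)` for factors in `[0, 1]`. [folklore] -/
theorem one_sub_mul_prod_le (m : Multiset ℝ) (hm : ∀ x ∈ m, 0 ≤ x ∧ x ≤ 1) {x₀ : ℝ}
    (h0 : 0 ≤ x₀) (h1 : x₀ ≤ 1) :
    1 - x₀ * m.prod ≤ (1 - x₀) + (m.map fun x => 1 - x).sum := by
  induction m using Multiset.induction_on generalizing x₀ with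
  | empty => simp
  | cons x m ih =>
    have hx := hm x (Multiset.mem_cons_self x m)
    have hm' : ∀ y ∈ m, 0 ≤ y ∧ y ≤ 1 := fun y hy => hm y (Multiset.mem_cons_of_mem hy)
    have h := ih hm' (mul_nonneg h0 hx.1) (mul_le_one₀ h1 hx.1 hx.2)
    rw [Multiset.prod_cons, Multiset.map_cons, Multiset.sum_cons, ← mul_assoc]
    nlinarith [mul_nonneg (sub_nonneg.2 h1) (sub_nonneg.2 hx.2)]

/-- `x²/2 - (5/96)|x|⁴ ≤ 1 - cos x` for `|x| ≤ 1` (Taylor, `Real.cos_bound`). [folklore] -/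
theorem sq_div_two_sub_le_one_sub_cos {x : ℝ} (hx : |x| ≤ 1) :
    x ^ 2 / 2 - 5 / 96 * |x| ^ 4 ≤ 1 - Real.cos x := by
  have h := (abs_le.1 (Real.cos_bound hx)).2
  linarith

/-- The total magnetisation is at most `|Λ|` in absolute value. [folklore] -/
theorem abs_sum_spinAt_le (Λ : Finset (Site d)) (σ : SpinConfig (Site d)) :
    |∑ x ∈ Λ, spinAt x σ| ≤ #Λ := by
  refine (Finset.abs_sum_le_sum_abs _ _).trans ?_
  simp

/-- The real part of `Z_{Λ,β,it}`: `Re Z_{Λ,β,it} = ∑_τ w(τ) cos(t M(τ))` with the zero-field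
weights `w(τ) = exp(β ∑_e σ_e(τ))`. [folklore] -/
theorem partitionFunction_mul_I_re (Λ : Finset (Site d)) (β t : ℝ) :
    (partitionFunction d Λ β (t * I)).re = ∑ τ : Λ → ℤˣ,
      Real.exp (β * ∑ e ∈ edgesIn (zdGraph d) Λ, bondSpin (glue Λ τ .free) e) *
        Real.cos (t * ∑ x ∈ Λ, spinAt x (glue Λ τ .free)) := by
  rw [partitionFunction, Complex.re_sum]
  refine Finset.sum_congr rfl fun τ _ => ?_
  rw [Complex.exp_re]
  congr 1
  · congr 1
    simp [Complex.add_re]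
  · congr 1
    simp [Complex.add_im]

/-- Zero-field Gibbs averages as weighted sums:
`⟨f⟩^∅_{Λ;β,0} = (∑_τ w(τ) f(τ·∅)) / ∑_τ w(τ)`, `w(τ) = exp(β ∑_e σ_e(τ))`. [folklore] -/
theorem isingExpect_zero_field_eq (Λ : Finset (Site d)) (β : ℝ) {f : SpinConfig (Site d) → ℝ}
    (hf : Measurable f) :
    isingExpect (zdGraph d) Λ β 0 .free f =
      (∑ τ : Λ → ℤˣ, Real.exp (β * ∑ e ∈ edgesIn (zdGraph d) Λ, bondSpin (glue Λ τ .free) e) *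
        f (glue Λ τ .free)) /
      ∑ τ : Λ → ℤˣ, Real.exp (β * ∑ e ∈ edgesIn (zdGraph d) Λ, bondSpin (glue Λ τ .free) e) := by
  have hw : ∀ τ : Λ → ℤˣ, isingWeight (zdGraph d) Λ β 0 .free τ =
      Real.exp (β * ∑ e ∈ edgesIn (zdGraph d) Λ, bondSpin (glue Λ τ .free) e) := by
    intro τ
    rw [isingWeight, isingHamiltonian, interactionEdges_free]
    congr 1
    ring
  rw [isingExpect, integral_isingMeasure (zdGraph d) Λ β 0 .free hf, isingPartitionFunction]
  simp_rw [hw]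

/-- **JN (2.17) for `k = 1` (second moment of the magnetisation against the first zero)**:
for `β ≥ 0` and nonempty `Λ`,
`⟨M_Λ²⟩^∅_{Λ;β,0} ≤ (π²/4) |Λ| / α₁(Λ,β)²`. Jiang–Newman derive `u₂(M_Λ) = 2∑_j α_j^{-2} ≤ 8|Λ|α₁^{-2}`
from the Hadamard product and the `2|Λ|` zeros per period; here the same count is read off the
finite trigonometric product `⟨cos(tM_Λ)⟩ = cos(t)^a ∏_θ (1 - sin²t/sin²(θ/2))`
(`exists_trig_prod_partitionFunction`): comparing the two sides to second order at `t = 0` gives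
`⟨M_Λ²⟩ ≤ a + 2∑_θ sin(θ/2)^{-2}`, and every zero `θ/2`, `π/2` is `≥ α₁` with
`sin(θ/2) ≥ (2/π)(θ/2)` (Jordan). [cite: JiangNewman2023, §2 eqs. (2.15)–(2.17)] -/
theorem isingExpect_sq_magnetization_le {β : ℝ} (hβ : 0 ≤ β) {Λ : Finset (Site d)}
    (hΛ : Λ.Nonempty) :
    isingExpect (zdGraph d) Λ β 0 .free (fun σ => (∑ x ∈ Λ, spinAt x σ) ^ 2) ≤
      Real.pi ^ 2 / 4 * #Λ / firstZero d Λ β ^ 2 := by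
  classical
  obtain ⟨a, S, hS, hcard, hprod⟩ := exists_trig_prod_partitionFunction hβ Λ
  obtain ⟨hα0, hαle, -⟩ := firstZero_spec hβ hΛ
  set α := firstZero d Λ β with hα
  have hnpos : (0 : ℝ) < #Λ := Nat.cast_pos.2 (Finset.card_pos.2 hΛ)
  -- weights, probabilities, magnetisation
  set w : (Λ → ℤˣ) → ℝ := fun τ =>
    Real.exp (β * ∑ e ∈ edgesIn (zdGraph d) Λ, bondSpin (glue Λ τ .free) e) with hw
  set Z0 : ℝ := ∑ τ, w τ with hZ0
  set M : (Λ → ℤˣ) → ℝ := fun τ => ∑ x ∈ Λ, spinAt x (glue Λ τ .free) with hM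
  have hwpos : ∀ τ, 0 < w τ := fun τ => Real.exp_pos _
  have hZ0pos : 0 < Z0 := Finset.sum_pos (fun τ _ => hwpos τ) Finset.univ_nonempty
  set p : (Λ → ℤˣ) → ℝ := fun τ => w τ / Z0 with hp
  have hp0 : ∀ τ, 0 ≤ p τ := fun τ => (div_pos (hwpos τ) hZ0pos).le
  have hp1 : ∑ τ, p τ = 1 := by
    simp only [hp, ← Finset.sum_div]; exact div_self hZ0pos.ne'
  have hMle : ∀ τ, |M τ| ≤ #Λ := fun τ => abs_sum_spinAt_le Λ _
  set μ₂ : ℝ := ∑ τ, p τ * M τ ^ 2 with hμ₂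
  -- the expectation is `μ₂`
  have hexp : isingExpect (zdGraph d) Λ β 0 .free (fun σ => (∑ x ∈ Λ, spinAt x σ) ^ 2) = μ₂ := by
    rw [isingExpect_zero_field_eq Λ β ((Finset.measurable_sum _ fun x _ => measurable_spinAt x).pow_const 2)]
    rw [hμ₂, Finset.sum_div]
    refine Finset.sum_congr rfl fun τ _ => ?_
    simp only [hp, hM, hw]
    ring
  rw [hexp]
  -- the product side
  set P : ℝ → ℝ := fun t =>
    Real.cos t ^ a * (S.map fun θ => 1 - Real.sin t ^ 2 / Real.sin (θ / 2) ^ 2).prod with hP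
  have hZ0eq : partitionFunction d Λ β 0 = (Z0 : ℂ) := by
    rw [← Complex.ofReal_zero, partitionFunction_ofReal]
    simp [hZ0, hw]
  -- `∑ p cos(tM) = P(t)`
  have hR : ∀ t : ℝ, ∑ τ, p τ * Real.cos (t * M τ) = P t := by
    intro t
    have h := congrArg Complex.re (hprod t)
    rw [partitionFunction_mul_I_re, hZ0eq, ← Complex.ofReal_mul, Complex.ofReal_re] at h
    have h' : ∑ τ, w τ * Real.cos (t * M τ) = Z0 * P t := h
    have hsum : ∑ τ, p τ * Real.cos (t * M τ) = (∑ τ, w τ * Real.cos (t * M τ)) / Z0 := by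
      rw [Finset.sum_div]
      refine Finset.sum_congr rfl fun τ _ => ?_
      simp only [hp]
      ring
    rw [hsum, h', mul_div_cancel_left₀ _ hZ0pos.ne']
  -- zeros: `θ/2` for `θ ∈ S`, and `π/2` if `a ≠ 0`; all are `≥ α`
  have hθzero : ∀ θ ∈ S, α ≤ θ / 2 := by
    intro θ hθ
    obtain ⟨hθ0, hθπ⟩ := hS θ hθ
    have hsin : Real.sin (θ / 2) ≠ 0 :=
      (Real.sin_pos_of_pos_of_lt_pi (by linarith) (by linarith)).ne'
    refine firstZero_le_of_zero Λ β (by linarith) ?_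
    rw [hprod]
    have h0 : (S.map fun θ' => 1 - Real.sin (θ / 2) ^ 2 / Real.sin (θ' / 2) ^ 2).prod = 0 :=
      Multiset.prod_eq_zero (Multiset.mem_map.2 ⟨θ, hθ, by rw [div_self (pow_ne_zero 2 hsin), sub_self]⟩)
    rw [h0, mul_zero, Complex.ofReal_zero, mul_zero]
  have hazero : a ≠ 0 → α ≤ Real.pi / 2 := fun ha => by
    refine firstZero_le_of_zero Λ β (by positivity) ?_
    rw [hprod, Real.cos_pi_div_two, zero_pow ha, zero_mul, Complex.ofReal_zero, mul_zero]
  -- Step A: the upper bound `1 - P(t) ≤ a t²/2 + t² K` for `0 ≤ t ≤ α`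
  set K : ℝ := (S.map fun θ => 1 / Real.sin (θ / 2) ^ 2).sum with hK
  have hupper : ∀ t : ℝ, 0 ≤ t → t ≤ α → 1 - P t ≤ a * t ^ 2 / 2 + t ^ 2 * K := by
    intro t ht0 htα
    have htπ : t ≤ Real.pi / 2 := htα.trans hαle
    have hcos0 : 0 ≤ Real.cos t := Real.cos_nonneg_of_mem_Icc ⟨by linarith [Real.pi_pos], htπ⟩
    have hcos1 : Real.cos t ≤ 1 := Real.cos_le_one t
    have hsint : 0 ≤ Real.sin t := Real.sin_nonneg_of_nonneg_of_le_pi ht0 (by linarith [Real.pi_pos])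
    -- factors in `[0,1]`
    have hfac : ∀ x ∈ S.map (fun θ => 1 - Real.sin t ^ 2 / Real.sin (θ / 2) ^ 2), 0 ≤ x ∧ x ≤ 1 := by
      intro x hx
      obtain ⟨θ, hθ, rfl⟩ := Multiset.mem_map.1 hx
      obtain ⟨hθ0, hθπ⟩ := hS θ hθ
      have hspos : 0 < Real.sin (θ / 2) := Real.sin_pos_of_pos_of_lt_pi (by linarith) (by linarith)
      have hle : Real.sin t ≤ Real.sin (θ / 2) :=
        Real.sin_le_sin_of_le_of_le_pi_div_two (by linarith [Real.pi_pos]) (by linarith)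
          (htα.trans (hθzero θ hθ))
      have hsq : Real.sin t ^ 2 ≤ Real.sin (θ / 2) ^ 2 := pow_le_pow_left₀ hsint hle 2
      constructor
      · rw [sub_nonneg, div_le_one (pow_pos hspos 2)]; exact hsq
      · rw [sub_le_self_iff]; positivity
    have h1 := one_sub_mul_prod_le _ hfac (pow_nonneg hcos0 a) (pow_le_one₀ hcos0 hcos1)
    have h2 : 1 - Real.cos t ^ a ≤ a * (1 - Real.cos t) := by
      -- Bernoulli: `1 + a (cos t - 1) ≤ (1 + (cos t - 1))^a`
      have hB := one_add_mul_le_pow (show (-2 : ℝ) ≤ Real.cos t - 1 by linarith) a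
      rw [add_sub_cancel] at hB
      linarith
    have h3 : 1 - Real.cos t ≤ t ^ 2 / 2 := by linarith [Real.one_sub_sq_div_two_le_cos (x := t)]
    have h4 : (Multiset.map (fun x => 1 - x)
        (S.map fun θ => 1 - Real.sin t ^ 2 / Real.sin (θ / 2) ^ 2)).sum ≤ t ^ 2 * K := by
      rw [Multiset.map_map, hK, Multiset.sum_map_mul_left.symm] -- t^2 * sum = sum (t^2 * ·)
      refine Multiset.sum_map_le_sum_map _ _ fun θ _ => ?_
      simp only [Function.comp_apply, sub_sub_cancel]
      rw [div_eq_mul_one_div]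
      exact mul_le_mul_of_nonneg_right (Real.sin_sq_le_sq (x := t))
        (by positivity : (0 : ℝ) ≤ 1 / Real.sin (θ / 2) ^ 2)
    have ha0 : (0 : ℝ) ≤ a := Nat.cast_nonneg a
    calc 1 - P t ≤ (1 - Real.cos t ^ a) + (Multiset.map (fun x => 1 - x)
          (S.map fun θ => 1 - Real.sin t ^ 2 / Real.sin (θ / 2) ^ 2)).sum := h1
      _ ≤ a * (t ^ 2 / 2) + t ^ 2 * K := add_le_add (h2.trans (mul_le_mul_of_nonneg_left h3 ha0)) h4
      _ = a * t ^ 2 / 2 + t ^ 2 * K := by ring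
  -- Step B: the lower bound `t² μ₂/2 - (5/96) t⁴ n⁴ ≤ 1 - ∑ p cos(tM)` for `0 ≤ t ≤ 1/n`
  have hlower : ∀ t : ℝ, 0 ≤ t → t ≤ 1 / #Λ →
      t ^ 2 * μ₂ / 2 - 5 / 96 * t ^ 4 * (#Λ : ℝ) ^ 4 ≤ 1 - ∑ τ, p τ * Real.cos (t * M τ) := by
    intro t ht0 htn
    have htn' : t * #Λ ≤ 1 := by rwa [le_div_iff₀ hnpos] at htn
    have hterm : ∀ τ, p τ * (t ^ 2 * M τ ^ 2 / 2 - 5 / 96 * t ^ 4 * (#Λ : ℝ) ^ 4) ≤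
        p τ * (1 - Real.cos (t * M τ)) := by
      intro τ
      refine mul_le_mul_of_nonneg_left ?_ (hp0 τ)
      have habs : |t * M τ| ≤ t * #Λ := by
        rw [abs_mul, abs_of_nonneg ht0]; exact mul_le_mul_of_nonneg_left (hMle τ) ht0
      have h := sq_div_two_sub_le_one_sub_cos (habs.trans htn')
      have h4 : |t * M τ| ^ 4 ≤ (t * #Λ) ^ 4 := pow_le_pow_left₀ (abs_nonneg _) habs 4
      calc t ^ 2 * M τ ^ 2 / 2 - 5 / 96 * t ^ 4 * (#Λ : ℝ) ^ 4
          = (t * M τ) ^ 2 / 2 - 5 / 96 * (t * #Λ) ^ 4 := by ring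
        _ ≤ (t * M τ) ^ 2 / 2 - 5 / 96 * |t * M τ| ^ 4 := by linarith
        _ ≤ 1 - Real.cos (t * M τ) := h
    have hsum := Finset.sum_le_sum fun τ (_ : τ ∈ Finset.univ) => hterm τ
    have hL : ∑ τ, p τ * (t ^ 2 * M τ ^ 2 / 2 - 5 / 96 * t ^ 4 * (#Λ : ℝ) ^ 4) =
        t ^ 2 * μ₂ / 2 - 5 / 96 * t ^ 4 * (#Λ : ℝ) ^ 4 := by
      simp only [mul_sub, Finset.sum_sub_distrib, hμ₂, Finset.mul_sum, Finset.sum_div,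
        ← Finset.sum_mul, hp1, one_mul]
      congr 1
      refine Finset.sum_congr rfl fun τ _ => ?_
      ring
    have hRsum : ∑ τ, p τ * (1 - Real.cos (t * M τ)) = 1 - ∑ τ, p τ * Real.cos (t * M τ) := by
      simp only [mul_sub, mul_one, Finset.sum_sub_distrib, hp1]
    rw [← hL, ← hRsum]
    exact hsum
  -- Step C: `μ₂ ≤ a + 2K`, letting `t ↓ 0`
  have hμK : μ₂ ≤ a + 2 * K := by
    set t₀ : ℝ := min α (1 / #Λ) with ht₀
    have ht₀pos : 0 < t₀ := lt_min hα0 (by positivity)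
    have hineq : ∀ t : ℝ, 0 < t → t < t₀ →
        μ₂ / 2 ≤ a / 2 + K + 5 / 96 * t ^ 2 * (#Λ : ℝ) ^ 4 := by
      intro t ht htt
      have htα : t ≤ α := (htt.le.trans (min_le_left _ _))
      have htn : t ≤ 1 / #Λ := (htt.le.trans (min_le_right _ _))
      have h1 := hlower t ht.le htn
      have h2 := hupper t ht.le htα
      rw [hR t] at h1
      have h3 : t ^ 2 * μ₂ / 2 - 5 / 96 * t ^ 4 * (#Λ : ℝ) ^ 4 ≤ a * t ^ 2 / 2 + t ^ 2 * K :=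
        h1.trans h2
      have ht2 : 0 < t ^ 2 := pow_pos ht 2
      have h4 : t ^ 2 * (μ₂ / 2) ≤ t ^ 2 * (a / 2 + K + 5 / 96 * t ^ 2 * (#Λ : ℝ) ^ 4) := by
        nlinarith
      exact le_of_mul_le_mul_left h4 ht2
    have hg : Tendsto (fun t : ℝ => (a : ℝ) / 2 + K + 5 / 96 * t ^ 2 * (#Λ : ℝ) ^ 4) (𝓝[>] 0)
        (𝓝 ((a : ℝ) / 2 + K + 5 / 96 * 0 ^ 2 * (#Λ : ℝ) ^ 4)) :=
      ((continuous_const.add ((continuous_const.mul (continuous_pow 2)).mul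
        continuous_const)).tendsto 0).mono_left nhdsWithin_le_nhds
    simp only [zero_pow two_ne_zero, mul_zero, zero_mul, add_zero] at hg
    have hle : μ₂ / 2 ≤ (a : ℝ) / 2 + K := by
      refine ge_of_tendsto hg ?_
      filter_upwards [Ioo_mem_nhdsGT ht₀pos] with t ht
      exact hineq t ht.1 ht.2
    linarith
  -- Step D: `a + 2K ≤ (π²/4) n / α²`
  have hB : Real.pi ^ 2 / 4 / α ^ 2 = 1 / (2 / Real.pi * α) ^ 2 := by
    field_simp
    ring
  have hKle : K ≤ Multiset.card S * (Real.pi ^ 2 / 4 / α ^ 2) := by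
    have h := Multiset.sum_le_card_nsmul (S.map fun θ => 1 / Real.sin (θ / 2) ^ 2)
      (Real.pi ^ 2 / 4 / α ^ 2) ?_
    · rwa [Multiset.card_map, nsmul_eq_mul] at h
    intro x hx
    obtain ⟨θ, hθ, rfl⟩ := Multiset.mem_map.1 hx
    obtain ⟨hθ0, hθπ⟩ := hS θ hθ
    have hθ2 := hθzero θ hθ
    have hj : 2 / Real.pi * (θ / 2) ≤ Real.sin (θ / 2) :=
      Real.mul_le_sin (by linarith) (by linarith)
    have hlow : 2 / Real.pi * α ≤ Real.sin (θ / 2) :=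
      (mul_le_mul_of_nonneg_left hθ2 (by positivity)).trans hj
    have hpos : 0 < 2 / Real.pi * α := by positivity
    rw [hB]
    exact one_div_le_one_div_of_le (pow_pos hpos 2) (pow_le_pow_left₀ hpos.le hlow 2)
  have hale : (a : ℝ) ≤ a * (Real.pi ^ 2 / 4 / α ^ 2) := by
    rcases Nat.eq_zero_or_pos a with ha | ha
    · simp [ha]
    · have hαπ := hazero (Nat.pos_iff_ne_zero.1 ha)
      have h1 : 1 ≤ Real.pi ^ 2 / 4 / α ^ 2 := by
        rw [le_div_iff₀ (pow_pos hα0 2), one_mul]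
        nlinarith [Real.pi_pos]
      nlinarith [(Nat.cast_pos (α := ℝ)).2 ha]
  have hcardR : (a : ℝ) + 2 * (Multiset.card S : ℝ) = (#Λ : ℝ) := by exact_mod_cast hcard
  calc μ₂ ≤ a + 2 * K := hμK
    _ ≤ a * (Real.pi ^ 2 / 4 / α ^ 2) + 2 * (Multiset.card S * (Real.pi ^ 2 / 4 / α ^ 2)) :=
        add_le_add hale (mul_le_mul_of_nonneg_left hKle zero_le_two)
    _ = Real.pi ^ 2 / 4 * ((a : ℝ) + 2 * (Multiset.card S : ℝ)) / α ^ 2 := by ring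
    _ = Real.pi ^ 2 / 4 * #Λ / α ^ 2 := by rw [hcardR]

end SecondMoment

/-! ### JN (2.18)–(2.19): `α₁(B_n, β) → 0` for `β ≥ β_c` -/

section FirstZeroToZero

variable {d}

/-- `⟨M_Λ²⟩ = ∑_{u,v ∈ Λ} ⟨σ_uσ_v⟩` (JN eq. (2.7) for `k = 2` at zero field, where `u₂(M_Λ) = ⟨M_Λ²⟩`).
[cite: JiangNewman2023, §2 eq. (2.7)] -/
theorem isingExpect_sq_eq_sum_sum {V : Type*} [DecidableEq V] (G : SimpleGraph V) [G.LocallyFinite]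
    (Λ : Finset V) (β h : ℝ) (bc : BoundaryCondition V) :
    isingExpect G Λ β h bc (fun σ => (∑ x ∈ Λ, spinAt x σ) ^ 2) =
      ∑ u ∈ Λ, ∑ v ∈ Λ, isingTwoPoint G Λ β h bc u v := by
  have hsq : (fun σ : SpinConfig V => (∑ x ∈ Λ, spinAt x σ) ^ 2) =
      fun σ => ∑ u ∈ Λ, ∑ v ∈ Λ, spinAt u σ * spinAt v σ := by
    funext σ; rw [sq, Finset.sum_mul_sum]
  rw [hsq, isingExpect_finset_sum' G Λ h bc β Λ (fun u σ => ∑ v ∈ Λ, spinAt u σ * spinAt v σ)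
    fun u => Finset.measurable_sum _ fun v _ => (measurable_spinAt u).mul (measurable_spinAt v)]
  refine Finset.sum_congr rfl fun u _ => ?_
  rw [isingExpect_finset_sum' G Λ h bc β Λ (fun v σ => spinAt u σ * spinAt v σ)
    fun v => (measurable_spinAt u).mul (measurable_spinAt v)]
  rfl

/-- A translate of `B_m` by `u ∈ B_k` lies in `B_{k+m}` (image form). [folklore] -/
theorem image_add_box_subset_box {k m : ℕ} {u : Site d} (hu : u ∈ box d k) :
    (box d m).image (· + u) ⊆ box d (k + m) := by
  have h := map_shift_box_subset_box d (m := m) hu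
  rwa [Finset.map_eq_image] at h

/-- **Volume comparison for `⟨M²⟩`** (the argument of JN (2.8)/(2.10) for `k = 2`: GKS volume
monotonicity and translation covariance): for `β ≥ 0`,
`|B_k| ∑_{v ∈ B_m} ⟨σ₀σ_v⟩^∅_{B_m} ≤ ∑_{u,v ∈ B_{k+m}} ⟨σ_uσ_v⟩^∅_{B_{k+m}}`.
[cite: JiangNewman2023, §2 eqs. (2.8)–(2.10)] -/
theorem card_mul_volumeSusceptibility_le {β : ℝ} (hβ : 0 ≤ β) (k m : ℕ) :
    (#(box d k) : ℝ) * volumeSusceptibility (zdGraph d) (box d m) β 0 ≤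
      ∑ u ∈ box d (k + m), ∑ v ∈ box d (k + m),
        isingTwoPoint (zdGraph d) (box d (k + m)) β 0 .free u v := by
  have hone : ∀ u ∈ box d k, volumeSusceptibility (zdGraph d) (box d m) β 0 ≤
      ∑ v ∈ box d (k + m), isingTwoPoint (zdGraph d) (box d (k + m)) β 0 .free u v := by
    intro u hu
    have hsub := image_add_box_subset_box (d := d) (m := m) hu
    have hukm : u ∈ box d (k + m) := box_mono d (Nat.le_add_right k m) hu
    calc volumeSusceptibility (zdGraph d) (box d m) β 0
        = ∑ b ∈ box d m, isingTwoPoint (zdGraph d) (box d m) β 0 .free 0 b := rfl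
      _ ≤ ∑ b ∈ box d m, isingTwoPoint (zdGraph d) (box d (k + m)) β 0 .free u (u + b) :=
          Finset.sum_le_sum fun b hb => isingTwoPoint_free_le_translate
            isingCorr_free_mono_volume_holds isingTwoPoint_free_translate_holds hβ hsub
            (zero_mem_box d m) hb
      _ = ∑ v ∈ (box d m).image (u + ·), isingTwoPoint (zdGraph d) (box d (k + m)) β 0 .free u v := by
          rw [Finset.sum_image fun b _ b' _ h => add_left_cancel h]
      _ ≤ ∑ v ∈ box d (k + m), isingTwoPoint (zdGraph d) (box d (k + m)) β 0 .free u v := by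
          refine Finset.sum_le_sum_of_subset_of_nonneg ?_ fun v hv _ =>
            isingTwoPoint_free_nonneg' hβ hukm hv
          intro v hv
          obtain ⟨b, hb, rfl⟩ := Finset.mem_image.1 hv
          rw [add_comm u b]
          exact hsub (Finset.mem_image.2 ⟨b, hb, rfl⟩)
  calc (#(box d k) : ℝ) * volumeSusceptibility (zdGraph d) (box d m) β 0
      = #(box d k) • volumeSusceptibility (zdGraph d) (box d m) β 0 := by rw [nsmul_eq_mul]
    _ ≤ ∑ u ∈ box d k, ∑ v ∈ box d (k + m), isingTwoPoint (zdGraph d) (box d (k + m)) β 0 .free u v :=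
        Finset.card_nsmul_le_sum _ _ _ hone
    _ ≤ _ := Finset.sum_le_sum_of_subset_of_nonneg (box_mono d (Nat.le_add_right k m))
        fun u hu _ => Finset.sum_nonneg fun v hv => isingTwoPoint_free_nonneg' hβ hu hv

/-- **JN (2.10)/(2.18) for the total magnetisation**: for `d ≥ 2` and `β ≥ β_c(d)`,
`⟨M_{B_n}²⟩^∅_{B_n;β,0} / |B_n| → ∞`. [cite: JiangNewman2023, §2 eqs. (2.10), (2.18)] -/
theorem tendsto_isingExpect_sq_div_card_atTop (hd : 2 ≤ d) {β : ℝ} (hβc : criticalBeta d ≤ β) :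
    Tendsto (fun n : ℕ => isingExpect (zdGraph d) (box d n) β 0 .free
      (fun σ => (∑ x ∈ box d n, spinAt x σ) ^ 2) / #(box d n)) atTop atTop := by
  have hβ : 0 ≤ β := (criticalBeta_nonneg d).trans hβc
  have hS := tendsto_volumeSusceptibility_box_atTop d hd hβc
  refine tendsto_atTop.2 fun r => ?_
  obtain ⟨m, hm⟩ := (hS.eventually_ge_atTop (2 * max r 0)).exists
  have hratio := (tendsto_card_box_div d m).eventually_const_le (show (1 : ℝ) / 2 < 1 by norm_num)
  obtain ⟨K, hK⟩ := eventually_atTop.1 hratio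
  refine eventually_atTop.2 ⟨K + m, fun n hn => ?_⟩
  obtain ⟨k, rfl⟩ : ∃ k, n = k + m := ⟨n - m, by omega⟩
  have hk : K ≤ k := by omega
  have hpos : (0 : ℝ) < #(box d (k + m)) := Nat.cast_pos.2 (Finset.card_pos.2 (box_nonempty d _))
  have h1 := card_mul_volumeSusceptibility_le (d := d) hβ k m
  rw [← isingExpect_sq_eq_sum_sum] at h1
  rw [le_div_iff₀ hpos]
  have hr : r ≤ max r 0 := le_max_left _ _
  have h0 : 0 ≤ max r 0 := le_max_right _ _
  have hKk := hK k hk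
  have hvol : 0 ≤ volumeSusceptibility (zdGraph d) (box d m) β 0 :=
    zero_le_one.trans (one_le_volumeSusceptibility hβ (zero_mem_box d m))
  calc r * #(box d (k + m)) ≤ max r 0 * #(box d (k + m)) :=
        mul_le_mul_of_nonneg_right hr hpos.le
    _ ≤ (1 / 2 * (2 * max r 0)) * #(box d (k + m)) := by ring_nf; exact le_rfl
    _ ≤ ((#(box d k) : ℝ) / #(box d (k + m)) * volumeSusceptibility (zdGraph d) (box d m) β 0) *
          #(box d (k + m)) := by
        refine mul_le_mul_of_nonneg_right ?_ hpos.le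
        exact mul_le_mul hKk hm (by positivity) (by positivity)
    _ = (#(box d k) : ℝ) * volumeSusceptibility (zdGraph d) (box d m) β 0 := by
        field_simp
    _ ≤ _ := h1

/-- **JN Proposition 2 for `β ≥ β_c` (eq. (2.19))**: for `d ≥ 2` and `β ≥ β_c(d)`,
`α₁(B_n, β) → 0` as `n → ∞` — the box second moments `⟨M_{B_n}²⟩/|B_n|` diverge (JN (2.18)) while
`⟨M_Λ²⟩ ≤ (π²/4)|Λ| α₁(Λ,β)^{-2}` (JN (2.17), `isingExpect_sq_magnetization_le`).
[cite: JiangNewman2023, Prop. 2, eq. (2.19)] -/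
theorem tendsto_firstZero_zero_of_criticalBeta_le (hd : 2 ≤ d) {β : ℝ} (hβc : criticalBeta d ≤ β) :
    Tendsto (fun n : ℕ => firstZero d (box d n) β) atTop (𝓝 0) := by
  have hβ : 0 ≤ β := (criticalBeta_nonneg d).trans hβc
  have hQ := tendsto_isingExpect_sq_div_card_atTop hd hβc
  refine tendsto_order.2 ⟨fun a ha => Eventually.of_forall fun n =>
    ha.trans (firstZero_spec hβ (box_nonempty d n)).1, fun ε hε => ?_⟩
  filter_upwards [hQ.eventually_gt_atTop (Real.pi ^ 2 / 4 / ε ^ 2)] with n hn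
  set α := firstZero d (box d n) β with hα
  set Q := isingExpect (zdGraph d) (box d n) β 0 .free
    (fun σ => (∑ x ∈ box d n, spinAt x σ) ^ 2) / #(box d n) with hQdef
  have hα0 : 0 < α := (firstZero_spec hβ (box_nonempty d n)).1
  have hcard : (0 : ℝ) < #(box d n) := Nat.cast_pos.2 (Finset.card_pos.2 (box_nonempty d n))
  have hQle : Q ≤ Real.pi ^ 2 / 4 / α ^ 2 := by
    rw [hQdef, div_le_iff₀ hcard]
    have := isingExpect_sq_magnetization_le hβ (box_nonempty d n)
    calc _ ≤ Real.pi ^ 2 / 4 * #(box d n) / α ^ 2 := this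
      _ = Real.pi ^ 2 / 4 / α ^ 2 * #(box d n) := by ring
  have hQpos : 0 < Q := lt_trans (by positivity) hn
  have hsq : α ^ 2 < ε ^ 2 := by
    have h1 : α ^ 2 * Q ≤ Real.pi ^ 2 / 4 := by
      rw [le_div_iff₀ (pow_pos hα0 2)] at hQle
      linarith [hQle]
    have h2 : Real.pi ^ 2 / 4 < ε ^ 2 * Q := by
      rwa [div_lt_iff₀ (pow_pos hε 2), mul_comm] at hn
    nlinarith
  exact (pow_lt_pow_iff_left₀ hα0.le hε.le two_ne_zero).1 hsq

end FirstZeroToZero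

/-! ### Assembly: the statement of `FirstZeroLimit` at and above `β_c`, except monotonicity -/

/-- **`FirstZeroLimit` in the regime `β ≥ β_c(d)`, all clauses except the monotonicity of
`n ↦ α₁(B_n, β)`** (which is Camia–Jiang–Newman 2022, Cor. 1, not in the tree): for `d ≥ 2` and
`β ≥ β_c(d)`, clause (0) holds, and with `a = α₁(ℤ^d, β) = 0`: `α₁(B_n, β) → 0` (JN Prop. 2,
eq. (2.19)), `f_β` is analytic on no disc about `0` (JN Lemma 1), `0 < a ↔ β < β_c` (both sides
false) and the clause for `β < β_c` is vacuous. This is exactly the conjunction in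
`JiangNewman.FirstZeroLimit` for such `β`, minus `Antitone (fun n => firstZero d (box d n) β)`.
[cite: JiangNewman2023, Thm. 1 (β ≥ β_c), Prop. 2 eq. (2.19), Lemma 1] -/
theorem firstZeroLimit_clauses_of_criticalBeta_le (hd : 2 ≤ d) {β : ℝ} (hβc : criticalBeta d ≤ β) :
    (∀ h : ℝ, Tendsto (fun n : ℕ => freeEnergyIn d (box d n) β h) atTop (𝓝 (freeEnergy d β h))) ∧
    ∃ a : ℝ, 0 ≤ a ∧ Tendsto (fun n : ℕ => firstZero d (box d n) β) atTop (𝓝 a) ∧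
      (∀ ρ : ℝ, 0 < ρ → ρ ≤ a → AnalyticOnDisc d β ρ) ∧
      (∀ ρ : ℝ, a < ρ → ¬ AnalyticOnDisc d β ρ) ∧
      (0 < a ↔ β < criticalBeta d) ∧
      (β < criticalBeta d →
        (∀ k : ℕ, Tendsto (fun n : ℕ => magnetizationCumulant d (box d n) β k / (#(box d n) : ℝ))
          atTop (𝓝 (iteratedDeriv k (freeEnergy d β) 0))) ∧
        a⁻¹ = limsup (fun k : ℕ =>
          (|iteratedDeriv (2 * k) (freeEnergy d β) 0| / ((2 * k).factorial : ℝ)) ^ ((1 : ℝ) / (2 * k)))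
          atTop) := by
  refine ⟨fun h => tendsto_freeEnergyIn d β h, 0, le_rfl,
    tendsto_firstZero_zero_of_criticalBeta_le hd hβc, fun ρ hρ hρ0 => absurd hρ0 (not_le.2 hρ),
    fun ρ hρ => not_analyticOnDisc_of_criticalBeta_le d hd hβc hρ,
    ⟨fun h => absurd h (lt_irrefl 0), fun h => absurd hβc (not_le.2 h)⟩,
    fun h => absurd hβc (not_le.2 h)⟩

/-- **Reduction of the named fact at and above `β_c` to monotonicity**: for `d ≥ 2` and
`β ≥ β_c(d)`, the full conjunction of `JiangNewman.FirstZeroLimit` at `(d, β)` follows from the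
antitonicity of `n ↦ α₁(B_n, β)` alone (Camia–Jiang–Newman 2022, Cor. 1).
[cite: JiangNewman2023, Thm. 1 (β ≥ β_c)] -/
theorem firstZeroLimit_at_of_criticalBeta_le_of_antitone (hd : 2 ≤ d) {β : ℝ}
    (hβc : criticalBeta d ≤ β) (hanti : Antitone fun n : ℕ => firstZero d (box d n) β) :
    (∀ h : ℝ, Tendsto (fun n : ℕ => freeEnergyIn d (box d n) β h) atTop (𝓝 (freeEnergy d β h))) ∧
    Antitone (fun n : ℕ => firstZero d (box d n) β) ∧
    ∃ a : ℝ, 0 ≤ a ∧ Tendsto (fun n : ℕ => firstZero d (box d n) β) atTop (𝓝 a) ∧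
      (∀ ρ : ℝ, 0 < ρ → ρ ≤ a → AnalyticOnDisc d β ρ) ∧
      (∀ ρ : ℝ, a < ρ → ¬ AnalyticOnDisc d β ρ) ∧
      (0 < a ↔ β < criticalBeta d) ∧
      (β < criticalBeta d →
        (∀ k : ℕ, Tendsto (fun n : ℕ => magnetizationCumulant d (box d n) β k / (#(box d n) : ℝ))
          atTop (𝓝 (iteratedDeriv k (freeEnergy d β) 0))) ∧
        a⁻¹ = limsup (fun k : ℕ =>
          (|iteratedDeriv (2 * k) (freeEnergy d β) 0| / ((2 * k).factorial : ℝ)) ^ ((1 : ℝ) / (2 * k)))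
          atTop) :=
  ⟨(firstZeroLimit_clauses_of_criticalBeta_le d hd hβc).1, hanti,
    (firstZeroLimit_clauses_of_criticalBeta_le d hd hβc).2⟩

/-! ### JN (2.3), (2.15) for `k ≤ 2`: the first two cumulants of `M_Λ` -/

section Cumulants

variable {d}

/-- `Z_{Λ,β,h}` at real `h` as a real function: `∑_τ exp(β S(τ) + h M(τ))`. [folklore] -/
theorem re_partitionFunction_ofReal (Λ : Finset (Site d)) (β h : ℝ) :
    (partitionFunction d Λ β (h : ℂ)).re = ∑ τ : Λ → ℤˣ,
      Real.exp (β * ∑ e ∈ edgesIn (zdGraph d) Λ, bondSpin (glue Λ τ .free) e +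
        h * ∑ x ∈ Λ, spinAt x (glue Λ τ .free)) := by
  rw [partitionFunction_ofReal, Complex.ofReal_re]

/-- `d/dh Z_{Λ,β,h} = ∑_τ M(τ) exp(β S(τ) + h M(τ))` (real `h`). [cite: JiangNewman2023, §2 eq. (2.3)] -/
theorem hasDerivAt_re_partitionFunction (Λ : Finset (Site d)) (β h : ℝ) :
    HasDerivAt (fun h : ℝ => (partitionFunction d Λ β (h : ℂ)).re)
      (∑ τ : Λ → ℤˣ, (∑ x ∈ Λ, spinAt x (glue Λ τ .free)) *
        Real.exp (β * ∑ e ∈ edgesIn (zdGraph d) Λ, bondSpin (glue Λ τ .free) e +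
          h * ∑ x ∈ Λ, spinAt x (glue Λ τ .free))) h := by
  have hfun : (fun h : ℝ => (partitionFunction d Λ β (h : ℂ)).re) = fun h => ∑ τ : Λ → ℤˣ,
      Real.exp (β * ∑ e ∈ edgesIn (zdGraph d) Λ, bondSpin (glue Λ τ .free) e +
        h * ∑ x ∈ Λ, spinAt x (glue Λ τ .free)) := funext fun h => re_partitionFunction_ofReal Λ β h
  rw [hfun]
  refine HasDerivAt.fun_sum fun τ _ => ?_
  have h1 : HasDerivAt (fun h' : ℝ => β * ∑ e ∈ edgesIn (zdGraph d) Λ, bondSpin (glue Λ τ .free) e +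
      h' * ∑ x ∈ Λ, spinAt x (glue Λ τ .free)) (∑ x ∈ Λ, spinAt x (glue Λ τ .free)) h := by
    simpa using ((hasDerivAt_id h).mul_const (∑ x ∈ Λ, spinAt x (glue Λ τ .free))).const_add
      (β * ∑ e ∈ edgesIn (zdGraph d) Λ, bondSpin (glue Λ τ .free) e)
  exact h1.exp.congr_deriv (by ring)

/-- `d/dh (M-weighted sum) = ∑_τ M(τ)² exp(β S(τ) + h M(τ))` (real `h`). [cite: JiangNewman2023, §2 eq. (2.3)] -/
theorem hasDerivAt_sum_mul_exp (Λ : Finset (Site d)) (β h : ℝ) :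
    HasDerivAt (fun h : ℝ => ∑ τ : Λ → ℤˣ, (∑ x ∈ Λ, spinAt x (glue Λ τ .free)) *
        Real.exp (β * ∑ e ∈ edgesIn (zdGraph d) Λ, bondSpin (glue Λ τ .free) e +
          h * ∑ x ∈ Λ, spinAt x (glue Λ τ .free)))
      (∑ τ : Λ → ℤˣ, (∑ x ∈ Λ, spinAt x (glue Λ τ .free)) ^ 2 *
        Real.exp (β * ∑ e ∈ edgesIn (zdGraph d) Λ, bondSpin (glue Λ τ .free) e +
          h * ∑ x ∈ Λ, spinAt x (glue Λ τ .free))) h := by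
  refine HasDerivAt.fun_sum fun τ _ => ?_
  have h1 : HasDerivAt (fun h' : ℝ => β * ∑ e ∈ edgesIn (zdGraph d) Λ, bondSpin (glue Λ τ .free) e +
      h' * ∑ x ∈ Λ, spinAt x (glue Λ τ .free)) (∑ x ∈ Λ, spinAt x (glue Λ τ .free)) h := by
    simpa using ((hasDerivAt_id h).mul_const (∑ x ∈ Λ, spinAt x (glue Λ τ .free))).const_add
      (β * ∑ e ∈ edgesIn (zdGraph d) Λ, bondSpin (glue Λ τ .free) e)
  exact (h1.exp.const_mul (∑ x ∈ Λ, spinAt x (glue Λ τ .free))).congr_deriv (by ring)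

/-- The `M`-weighted zero-field sum vanishes (spin flip): `∑_τ M(τ) e^{β S(τ)} = 0`, i.e.
`⟨M_Λ⟩_{Λ,β,0} = 0`. [cite: JiangNewman2023, §2 eq. (2.15) (u_{2k-1}(M_Λ) = 0)] -/
theorem sum_mul_exp_zero_field (Λ : Finset (Site d)) (β : ℝ) :
    ∑ τ : Λ → ℤˣ, (∑ x ∈ Λ, spinAt x (glue Λ τ .free)) *
      Real.exp (β * ∑ e ∈ edgesIn (zdGraph d) Λ, bondSpin (glue Λ τ .free) e +
        0 * ∑ x ∈ Λ, spinAt x (glue Λ τ .free)) = 0 := by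
  set g : (Λ → ℤˣ) → ℝ := fun τ => (∑ x ∈ Λ, spinAt x (glue Λ τ .free)) *
    Real.exp (β * ∑ e ∈ edgesIn (zdGraph d) Λ, bondSpin (glue Λ τ .free) e +
      0 * ∑ x ∈ Λ, spinAt x (glue Λ τ .free)) with hg
  have hodd : ∀ τ, g (-τ) = -g τ := fun τ => by
    simp only [hg, sum_spinAt_glue_neg, sum_bondSpin_glue_neg, zero_mul, add_zero, neg_mul]
  have hsum : ∑ τ, g τ = ∑ τ, g (-τ) := (Fintype.sum_equiv (Equiv.neg _) _ _ fun τ => rfl).symm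
  have : ∑ τ, g τ = -∑ τ, g τ := by
    conv_lhs => rw [hsum]
    rw [← Finset.sum_neg_distrib]
    exact Finset.sum_congr rfl fun τ _ => hodd τ
  show ∑ τ, g τ = 0
  linarith

/-- **`u₁(M_Λ) = 0`** (JN (2.15), `k = 1`): the first field-derivative of `ln Z_{Λ,β,h}` at `h = 0`
vanishes, `magnetizationCumulant d Λ β 1 = 0`. [cite: JiangNewman2023, §2 eq. (2.15)] -/
theorem magnetizationCumulant_one (Λ : Finset (Site d)) (β : ℝ) : magnetizationCumulant d Λ β 1 = 0 := by
  rw [magnetizationCumulant, iteratedDeriv_one]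
  have hZ := hasDerivAt_re_partitionFunction Λ β 0
  have hpos : (partitionFunction d Λ β ((0 : ℝ) : ℂ)).re ≠ 0 := (partitionFunction_ofReal_re_pos d Λ β 0).ne'
  rw [(hZ.log hpos).deriv, sum_mul_exp_zero_field, zero_div]

/-- **`u₂(M_Λ) = ⟨M_Λ²⟩_{Λ,β,0}`** (JN (2.2)–(2.3) with `u₁ = 0`: the second cumulant of the total
magnetisation at zero field is its second moment):
`magnetizationCumulant d Λ β 2 = ⟨M_Λ²⟩^∅_{Λ;β,0}` (the tree's zero-field state `isingExpect … β 0 .free`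
coincides with Jiang–Newman's at `h = 0`). [cite: JiangNewman2023, §2 eqs. (2.2)–(2.3)] -/
theorem magnetizationCumulant_two (Λ : Finset (Site d)) (β : ℝ) :
    magnetizationCumulant d Λ β 2 =
      isingExpect (zdGraph d) Λ β 0 .free (fun σ => (∑ x ∈ Λ, spinAt x σ) ^ 2) := by
  -- names for the three sums
  set G : ℝ → ℝ := fun h => (partitionFunction d Λ β (h : ℂ)).re with hG
  set G₁ : ℝ → ℝ := fun h => ∑ τ : Λ → ℤˣ, (∑ x ∈ Λ, spinAt x (glue Λ τ .free)) *
    Real.exp (β * ∑ e ∈ edgesIn (zdGraph d) Λ, bondSpin (glue Λ τ .free) e +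
      h * ∑ x ∈ Λ, spinAt x (glue Λ τ .free)) with hG₁
  set G₂ : ℝ → ℝ := fun h => ∑ τ : Λ → ℤˣ, (∑ x ∈ Λ, spinAt x (glue Λ τ .free)) ^ 2 *
    Real.exp (β * ∑ e ∈ edgesIn (zdGraph d) Λ, bondSpin (glue Λ τ .free) e +
      h * ∑ x ∈ Λ, spinAt x (glue Λ τ .free)) with hG₂
  have hGpos : ∀ h, G h ≠ 0 := fun h => (partitionFunction_ofReal_re_pos d Λ β h).ne'
  have hdG : ∀ h, HasDerivAt G (G₁ h) h := fun h => hasDerivAt_re_partitionFunction Λ β h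
  have hdG₁ : ∀ h, HasDerivAt G₁ (G₂ h) h := fun h => hasDerivAt_sum_mul_exp Λ β h
  -- `deriv (log ∘ G) = G₁ / G`
  have hderiv : deriv (fun h => Real.log (G h)) = fun h => G₁ h / G h :=
    funext fun h => ((hdG h).log (hGpos h)).deriv
  have h2 : HasDerivAt (fun h => G₁ h / G h) ((G₂ 0 * G 0 - G₁ 0 * G₁ 0) / G 0 ^ 2) 0 :=
    (hdG₁ 0).div (hdG 0) (hGpos 0)
  have hG₁0 : G₁ 0 = 0 := sum_mul_exp_zero_field Λ β
  rw [magnetizationCumulant]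
  change iteratedDeriv 2 (fun h => Real.log (G h)) 0 = _
  rw [iteratedDeriv_succ, iteratedDeriv_one, hderiv, h2.deriv, hG₁0, zero_mul, sub_zero, sq,
    mul_div_mul_right _ _ (hGpos 0), isingExpect_zero_field_eq Λ β
      ((Finset.measurable_sum _ fun x _ => measurable_spinAt x).pow_const 2)]
  simp only [hG₂, hG, re_partitionFunction_ofReal, zero_mul, add_zero]
  congr 1
  refine Finset.sum_congr rfl fun τ _ => ?_
  ring

/-- **JN (2.17) for `k = 1`, in the fact's terms**: for `β ≥ 0` and nonempty `Λ`,
`u₂(M_{Λ,β,0}) ≤ (π²/4) |Λ| α₁(Λ,β)^{-2}` (print: `|u₂(M_Λ)| ≤ 8|Λ|α₁^{-2}`).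
[cite: JiangNewman2023, §2 eq. (2.17)] -/
theorem magnetizationCumulant_two_le {β : ℝ} (hβ : 0 ≤ β) {Λ : Finset (Site d)} (hΛ : Λ.Nonempty) :
    magnetizationCumulant d Λ β 2 ≤ Real.pi ^ 2 / 4 * #Λ / firstZero d Λ β ^ 2 := by
  rw [magnetizationCumulant_two]
  exact isingExpect_sq_magnetization_le hβ hΛ

/-- `u₂(M_{Λ,β,0}) ≥ 0` (a variance). [cite: JiangNewman2023, §2 eq. (2.15) (sign (-1)^{k-1} for k = 1)] -/
theorem magnetizationCumulant_two_nonneg (Λ : Finset (Site d)) (β : ℝ) :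
    0 ≤ magnetizationCumulant d Λ β 2 := by
  rw [magnetizationCumulant_two, isingExpect_zero_field_eq Λ β
    ((Finset.measurable_sum _ fun x _ => measurable_spinAt x).pow_const 2)]
  exact div_nonneg (Finset.sum_nonneg fun τ _ => mul_nonneg (Real.exp_pos _).le (sq_nonneg _))
    (Finset.sum_nonneg fun τ _ => (Real.exp_pos _).le)

/-- **JN (2.18) in the fact's terms**: for `d ≥ 2` and `β ≥ β_c(d)`, the cumulant densities
`u₂(M_{B_n,β,0})/|B_n|` diverge. [cite: JiangNewman2023, §2 eq. (2.18)] -/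
theorem tendsto_magnetizationCumulant_two_div_card_atTop (hd : 2 ≤ d) {β : ℝ}
    (hβc : criticalBeta d ≤ β) :
    Tendsto (fun n : ℕ => magnetizationCumulant d (box d n) β 2 / (#(box d n) : ℝ)) atTop atTop := by
  refine (tendsto_isingExpect_sq_div_card_atTop hd hβc).congr fun n => ?_
  rw [magnetizationCumulant_two]

end Cumulants

/-! ### Odd cumulants vanish; the residual obligations for the full fact -/

section Residual

variable {d}

/-- **`u_{2k-1}(M_Λ) = 0`** (JN (2.15), first identity; spin-flip symmetry): every odd
field-derivative of `ln Z_{Λ,β,h}` at `h = 0` vanishes. [cite: JiangNewman2023, §2 eq. (2.15)] -/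
theorem magnetizationCumulant_odd (Λ : Finset (Site d)) (β : ℝ) (k : ℕ) :
    magnetizationCumulant d Λ β (2 * k + 1) = 0 := by
  set g : ℝ → ℝ := fun h => Real.log (partitionFunction d Λ β h).re with hg
  have heven : (fun x : ℝ => g (-x)) = g := by
    funext x
    simp only [hg, Complex.ofReal_neg, partitionFunction_neg]
  have h := iteratedDeriv_comp_neg (2 * k + 1) g 0
  rw [heven, neg_zero, pow_succ, pow_mul, neg_one_sq, one_pow, one_mul, neg_one_smul] at h
  have h2 : iteratedDeriv (2 * k + 1) g 0 = 0 := by linarith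
  simpa [magnetizationCumulant, hg] using h2

/-- At and above `β_c` any limit of `α₁(B_n, β)` is `0` (`tendsto_firstZero_zero_of_criticalBeta_le`
and uniqueness of limits); equivalently, a positive limit forces `β < β_c(d)` — the direction
"`α₁(ℤ^d,β) > 0 ⟹ β < β_c(d)`" of JN Theorem 1. [cite: JiangNewman2023, Thm. 1 ("Moreover")] -/
theorem lt_criticalBeta_of_tendsto_firstZero_pos (hd : 2 ≤ d) {β a : ℝ}
    (ha : Tendsto (fun n : ℕ => firstZero d (box d n) β) atTop (𝓝 a)) (hpos : 0 < a) :
    β < criticalBeta d := by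
  by_contra hβc
  have h0 := tendsto_firstZero_zero_of_criticalBeta_le hd (not_lt.1 hβc)
  have := tendsto_nhds_unique ha h0
  exact hpos.ne' this

/-- **What remains of `FirstZeroLimit`** (assembly of the residual obligations): the named fact
follows from (i) the antitonicity of `n ↦ α₁(B_n, β)` for all `d ≥ 2`, `β ≥ 0`
(Camia–Jiang–Newman 2022, Cor. 1 — monotonicity of Ursell functions) and (ii) the subcritical
package for `0 ≤ β < β_c(d)`: a positive limit `a = r(β)` of `α₁(B_n, β)` which is the
analyticity radius of `f_β` about `0`, the convergence of the cumulant densities to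
`f_β^{(k)}(0)`, and `1/a = limsup_k [|f_β^{(2k)}(0)|/(2k)!]^{1/(2k)}` (JN Props. 1–3, which use
(i), Lebowitz 1972 and Ott 2020, Cor. 1.4). Everything else — clause (0) for all `β`, and all
clauses at `β ≥ β_c` — is proved in this file. [cite: JiangNewman2023, Thm. 1, Props. 1–3, Lemma 1] -/
theorem firstZeroLimit_of_antitone_of_subcritical
    (hanti : ∀ d : ℕ, 2 ≤ d → ∀ β : ℝ, 0 ≤ β → Antitone fun n : ℕ => firstZero d (box d n) β)
    (hsub : ∀ d : ℕ, 2 ≤ d → ∀ β : ℝ, 0 ≤ β → β < criticalBeta d →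
      ∃ a : ℝ, 0 < a ∧ Tendsto (fun n : ℕ => firstZero d (box d n) β) atTop (𝓝 a) ∧
        (∀ ρ : ℝ, 0 < ρ → ρ ≤ a → AnalyticOnDisc d β ρ) ∧
        (∀ ρ : ℝ, a < ρ → ¬ AnalyticOnDisc d β ρ) ∧
        (∀ k : ℕ, Tendsto (fun n : ℕ => magnetizationCumulant d (box d n) β k / (#(box d n) : ℝ))
          atTop (𝓝 (iteratedDeriv k (freeEnergy d β) 0))) ∧
        a⁻¹ = limsup (fun k : ℕ =>
          (|iteratedDeriv (2 * k) (freeEnergy d β) 0| / ((2 * k).factorial : ℝ)) ^ ((1 : ℝ) / (2 * k)))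
          atTop) :
    FirstZeroLimit := by
  intro d hd β hβ
  by_cases hβc : β < criticalBeta d
  · obtain ⟨a, ha, hlim, hana, hnot, hcum, hrad⟩ := hsub d hd β hβ hβc
    exact ⟨fun h => tendsto_freeEnergyIn d β h, hanti d hd β hβ, a, ha.le, hlim, hana, hnot,
      ⟨fun _ => hβc, fun _ => ha⟩, fun _ => ⟨hcum, hrad⟩⟩
  · exact firstZeroLimit_at_of_criticalBeta_le_of_antitone d hd (not_lt.1 hβc) (hanti d hd β hβ)

end Residual

/-! ### JN (2.4): the analytic logarithm of `Z_{Λ,β,h}` on the zero-free disc `|h| < α₁` -/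

section AnalyticLog

variable {d}

/-- `Z_{Λ,β,h}` is real at real `h`: `Z(h) = Re Z(h)`. [folklore] -/
theorem partitionFunction_ofReal_eq_re (Λ : Finset (Site d)) (β h : ℝ) :
    partitionFunction d Λ β (h : ℂ) = ((partitionFunction d Λ β (h : ℂ)).re : ℂ) := by
  rw [re_partitionFunction_ofReal, partitionFunction_ofReal]

/-- The complex derivative of `Z` at a real point is the real derivative of `h ↦ Z_{Λ,β,h}`:
`Z'(h) = ∑_τ M(τ) exp(β S(τ) + h M(τ))`. [cite: JiangNewman2023, §2 eq. (2.3)] -/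
theorem deriv_partitionFunction_ofReal (Λ : Finset (Site d)) (β h : ℝ) :
    deriv (fun z : ℂ => partitionFunction d Λ β z) (h : ℂ) =
      ((∑ τ : Λ → ℤˣ, (∑ x ∈ Λ, spinAt x (glue Λ τ .free)) *
        Real.exp (β * ∑ e ∈ edgesIn (zdGraph d) Λ, bondSpin (glue Λ τ .free) e +
          h * ∑ x ∈ Λ, spinAt x (glue Λ τ .free)) : ℝ) : ℂ) := by
  have h1 : HasDerivAt (fun t : ℝ => partitionFunction d Λ β (t : ℂ))
      (deriv (fun z : ℂ => partitionFunction d Λ β z) (h : ℂ)) h :=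
    ((differentiable_partitionFunction Λ β) _).hasDerivAt.comp_ofReal
  have h2 : HasDerivAt (fun t : ℝ => partitionFunction d Λ β (t : ℂ))
      ((∑ τ : Λ → ℤˣ, (∑ x ∈ Λ, spinAt x (glue Λ τ .free)) *
        Real.exp (β * ∑ e ∈ edgesIn (zdGraph d) Λ, bondSpin (glue Λ τ .free) e +
          h * ∑ x ∈ Λ, spinAt x (glue Λ τ .free)) : ℝ) : ℂ) h := by
    have h3 := (hasDerivAt_re_partitionFunction Λ β h).ofReal_comp
    refine h3.congr_of_eventuallyEq (Eventually.of_forall fun t => ?_)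
    exact partitionFunction_ofReal_eq_re Λ β t
  exact h1.unique h2

/-- **The analytic logarithm of `Z_{Λ,β,h}` on `|h| < α₁(Λ,β)`** (JN (2.4): "`ln Z_{Λ,β,h}` is
analytic in `{|h| < α₁(Λ,β)}`"): for `β ≥ 0` and nonempty `Λ` there is `L` holomorphic on the disc
with `exp L = Z` there and `L(h) = ln Z_{Λ,β,h}` for real `|h| < α₁` (a primitive of `Z'/Z` on the
zero-free disc, Mathlib's `DifferentiableOn.isExactOn_ball`). [cite: JiangNewman2023, §2 eq. (2.4)] -/
theorem exists_log_partitionFunction {β : ℝ} (hβ : 0 ≤ β) {Λ : Finset (Site d)} (hΛ : Λ.Nonempty) :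
    ∃ L : ℂ → ℂ, DifferentiableOn ℂ L (Metric.ball 0 (firstZero d Λ β)) ∧
      (∀ z ∈ Metric.ball (0 : ℂ) (firstZero d Λ β), Complex.exp (L z) = partitionFunction d Λ β z) ∧
      ∀ h : ℝ, |h| < firstZero d Λ β → L h = Real.log (partitionFunction d Λ β h).re := by
  set α := firstZero d Λ β with hα
  set Z : ℂ → ℂ := fun z => partitionFunction d Λ β z with hZ
  have hα0 : 0 < α := (firstZero_spec hβ hΛ).1
  set U : Set ℂ := Metric.ball 0 α with hU
  have hUo : IsOpen U := Metric.isOpen_ball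
  have hUc : IsPreconnected U := (convex_ball (0 : ℂ) α).isPreconnected
  have hZdiff : Differentiable ℂ Z := differentiable_partitionFunction Λ β
  have hZne : ∀ z ∈ U, Z z ≠ 0 := fun z hz =>
    partitionFunction_ne_zero_of_norm_lt hβ Λ (by simpa [hU] using hz)
  -- the logarithmic derivative and its primitive
  set q : ℂ → ℂ := fun z => deriv Z z / Z z with hq
  have hZ'diff : Differentiable ℂ (deriv Z) := by
    have hZan : AnalyticOnNhd ℂ Z Set.univ := hZdiff.differentiableOn.analyticOnNhd isOpen_univ
    exact fun z => (hZan.deriv z (Set.mem_univ z)).differentiableAt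
  have hqdiff : DifferentiableOn ℂ q U := fun z hz =>
    ((hZ'diff z).differentiableWithinAt).div (hZdiff z).differentiableWithinAt (hZne z hz)
  have hZ0re : 0 < (Z 0).re := by simpa [hZ] using partitionFunction_zero_re_pos (d := d) Λ β
  set r : ℝ := (Z 0).re with hr
  have hZ0 : Z 0 = (r : ℂ) := by
    simpa [hZ, hr] using partitionFunction_ofReal_eq_re (d := d) Λ β 0
  obtain ⟨L, hL0, hL⟩ := (hqdiff.isExactOn_ball).with_val_at 0 (Real.log r : ℂ)
  have hLdiff : DifferentiableOn ℂ L U := fun z hz => (hL z hz).differentiableAt.differentiableWithinAt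
  -- `exp (-L) * Z` is constant `= 1` on the disc
  set φ : ℂ → ℂ := fun z => Complex.exp (-L z) * Z z with hφ
  have hφderiv : ∀ z ∈ U, HasDerivAt φ 0 z := by
    intro z hz
    have h1 : HasDerivAt (fun w => Complex.exp (-L w)) (Complex.exp (-L z) * -q z) z :=
      (hL z hz).neg.cexp
    have h2 := h1.mul (hZdiff z).hasDerivAt
    refine h2.congr_deriv ?_
    simp only [hq]
    field_simp [hZne z hz]
    ring
  have hφdiff : DifferentiableOn ℂ φ U := fun z hz => (hφderiv z hz).differentiableAt.differentiableWithinAt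
  have hφ' : U.EqOn (deriv φ) 0 := fun z hz => (hφderiv z hz).deriv
  have hφ0 : φ 0 = 1 := by
    simp only [hφ]
    rw [hL0, hZ0, ← Complex.ofReal_neg, ← Complex.ofReal_exp, ← Complex.ofReal_mul, Real.exp_neg,
      Real.exp_log hZ0re, inv_mul_cancel₀ hZ0re.ne', Complex.ofReal_one]
  have hφ1 : ∀ z ∈ U, φ z = 1 := fun z hz =>
    (hUo.is_const_of_deriv_eq_zero hUc hφdiff hφ' hz (Metric.mem_ball_self hα0)).trans hφ0
  have hexp : ∀ z ∈ U, Complex.exp (L z) = Z z := by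
    intro z hz
    have h := hφ1 z hz
    simp only [hφ, Complex.exp_neg] at h
    rw [inv_mul_eq_one₀ (Complex.exp_ne_zero _)] at h
    exact h
  refine ⟨L, hLdiff, hexp, ?_⟩
  -- on the real diameter `L` is the real logarithm
  set g : ℝ → ℝ := fun h => Real.log (partitionFunction d Λ β h).re with hg
  set S : Set ℝ := {t : ℝ | |t| < α} with hS
  have hSo : IsOpen S := isOpen_lt continuous_abs continuous_const
  have hSc : IsPreconnected S := by
    have : S = Set.Ioo (-α) α := by ext t; simp [hS, abs_lt]
    rw [this]; exact isPreconnected_Ioo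
  have hmemU : ∀ t ∈ S, ((t : ℂ)) ∈ U := fun t ht => by
    have ht' : |t| < α := ht
    simpa [hU, Metric.mem_ball, Complex.norm_real] using ht'
  set D : ℝ → ℂ := fun t => L t - (g t : ℂ) with hD
  have hDderiv : ∀ t ∈ S, HasDerivAt D 0 t := by
    intro t ht
    have h1 : HasDerivAt (fun s : ℝ => L s) (q t) t := (hL _ (hmemU t ht)).comp_ofReal
    have hpos : (partitionFunction d Λ β t).re ≠ 0 := (partitionFunction_ofReal_re_pos d Λ β t).ne'
    have h2 := ((hasDerivAt_re_partitionFunction Λ β t).log hpos).ofReal_comp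
    refine (h1.sub h2).congr_deriv ?_
    rw [sub_eq_zero, hq]
    simp only [hZ]
    rw [deriv_partitionFunction_ofReal, Complex.ofReal_div, ← partitionFunction_ofReal_eq_re]
  have hDdiff : DifferentiableOn ℝ D S := fun t ht => (hDderiv t ht).differentiableAt.differentiableWithinAt
  have hD' : S.EqOn (deriv D) 0 := fun t ht => (hDderiv t ht).deriv
  have hD0 : D 0 = 0 := by
    simp only [hD, hg, Complex.ofReal_zero]
    rw [hL0, sub_eq_zero]
  intro h hh
  have hmem : h ∈ S := hh
  have h0mem : (0 : ℝ) ∈ S := by simp [hS, hα0]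
  have := (hSo.is_const_of_deriv_eq_zero hSc hDdiff hD' hmem h0mem).trans hD0
  simpa [hD, sub_eq_zero] using this

end AnalyticLog

/-! ### JN (2.4): the cumulant series `∑_k u_k(M_Λ) hᵏ/k!` converges to `ln Z` for `|h| < α₁` -/

section CumulantSeries

variable {d}

/-- `h ↦ ln Z_{Λ,β,h}` is smooth on `ℝ` (`Z > 0` is a finite sum of exponentials). [folklore] -/
theorem contDiff_log_re_partitionFunction (Λ : Finset (Site d)) (β : ℝ) (n : ℕ) :
    ContDiff ℝ n (fun h : ℝ => Real.log (partitionFunction d Λ β h).re) := by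
  have hG : ContDiff ℝ n (fun h : ℝ => (partitionFunction d Λ β h).re) := by
    have hfun : (fun h : ℝ => (partitionFunction d Λ β h).re) = fun h => ∑ τ : Λ → ℤˣ,
        Real.exp (β * ∑ e ∈ edgesIn (zdGraph d) Λ, bondSpin (glue Λ τ .free) e +
          h * ∑ x ∈ Λ, spinAt x (glue Λ τ .free)) := funext fun h => re_partitionFunction_ofReal Λ β h
    rw [hfun]
    exact ContDiff.sum fun τ _ => (contDiff_const.add (contDiff_id.mul contDiff_const)).exp
  exact hG.log fun h => (partitionFunction_ofReal_re_pos d Λ β h).ne'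

/-- **The complex and the real iterated derivatives of `ln Z` agree on the real diameter**: with `L`
the analytic logarithm of `exists_log_partitionFunction`, `L^{(k)}(t) = (d/dh)ᵏ ln Z_{Λ,β,h}|_{h=t}`
for real `|t| < α₁`. [folklore] -/
theorem iteratedDeriv_log_eq {β : ℝ} {Λ : Finset (Site d)} {L : ℂ → ℂ}
    (hL : DifferentiableOn ℂ L (Metric.ball 0 (firstZero d Λ β)))
    (hLre : ∀ h : ℝ, |h| < firstZero d Λ β → L h = Real.log (partitionFunction d Λ β h).re)
    (k : ℕ) {t : ℝ} (ht : |t| < firstZero d Λ β) :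
    iteratedDeriv k L (t : ℂ) =
      ((iteratedDeriv k (fun h : ℝ => Real.log (partitionFunction d Λ β h).re) t : ℝ) : ℂ) := by
  set α := firstZero d Λ β with hα
  set g : ℝ → ℝ := fun h => Real.log (partitionFunction d Λ β h).re with hg
  set U : Set ℂ := Metric.ball 0 α with hU
  have hUo : IsOpen U := Metric.isOpen_ball
  set S : Set ℝ := {t : ℝ | |t| < α} with hS
  have hSo : IsOpen S := isOpen_lt continuous_abs continuous_const
  have hmemU : ∀ s ∈ S, ((s : ℂ)) ∈ U := fun s hs => by
    have hs' : |s| < α := hs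
    simpa [hU, Metric.mem_ball, Complex.norm_real] using hs'
  have hLan : AnalyticOnNhd ℂ L U := hL.analyticOnNhd hUo
  -- all iterated derivatives of `L` are analytic on `U`
  have hiter : ∀ k : ℕ, AnalyticOnNhd ℂ (iteratedDeriv k L) U := by
    intro k
    induction k with
    | zero => simpa using hLan
    | succ k ih => rw [iteratedDeriv_succ]; exact ih.deriv
  -- induction on `k`, for all points of `S` simultaneously
  suffices H : ∀ k : ℕ, ∀ s ∈ S, iteratedDeriv k L (s : ℂ) = ((iteratedDeriv k g s : ℝ) : ℂ) from
    H k t ht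
  intro k
  induction k with
  | zero =>
    intro s hs
    simp only [iteratedDeriv_zero]
    exact hLre s hs
  | succ k ih =>
    intro s hs
    have hdiffg : Differentiable ℝ (iteratedDeriv k g) :=
      (contDiff_log_re_partitionFunction Λ β (k + 1)).differentiable_iteratedDeriv' k
    -- the complex side, restricted to the real line
    have h1 : HasDerivAt (fun r : ℝ => iteratedDeriv k L (r : ℂ))
        (deriv (iteratedDeriv k L) (s : ℂ)) s :=
      ((hiter k _ (hmemU s hs)).differentiableAt.hasDerivAt).comp_ofReal
    -- the real side
    have h2 : HasDerivAt (fun r : ℝ => ((iteratedDeriv k g r : ℝ) : ℂ))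
        ((deriv (iteratedDeriv k g) s : ℝ) : ℂ) s := (hdiffg s).hasDerivAt.ofReal_comp
    have heq : (fun r : ℝ => iteratedDeriv k L (r : ℂ)) =ᶠ[𝓝 s]
        fun r : ℝ => ((iteratedDeriv k g r : ℝ) : ℂ) := by
      filter_upwards [hSo.mem_nhds hs] with r hr
      exact ih r hr
    have h3 := h2.congr_of_eventuallyEq heq
    rw [iteratedDeriv_succ, iteratedDeriv_succ, h1.unique h3]

/-- **JN (2.4): the cumulant expansion of `ln Z_{Λ,β,h}`** on the real segment of the zero-free
disc: for `β ≥ 0`, nonempty `Λ` and `|h| < α₁(Λ, β)`,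
`ln Z_{Λ,β,h} = ∑_{k ≥ 0} u_k(M_{Λ,β,0}) hᵏ/k!` (`u_0 = ln Z_{Λ,β,0}`), i.e.
`f_{Λ,β}(h) = f_{Λ,β}(0) + ∑_{k ≥ 1} (u_k/|Λ|) hᵏ/k!`. [cite: JiangNewman2023, §2 eq. (2.4)] -/
theorem hasSum_magnetizationCumulant {β : ℝ} (hβ : 0 ≤ β) {Λ : Finset (Site d)} (hΛ : Λ.Nonempty)
    {h : ℝ} (hh : |h| < firstZero d Λ β) :
    HasSum (fun n : ℕ => magnetizationCumulant d Λ β n / (n.factorial : ℝ) * h ^ n)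
      (Real.log (partitionFunction d Λ β h).re) := by
  obtain ⟨L, hL, -, hLre⟩ := exists_log_partitionFunction hβ hΛ
  have hmem : (h : ℂ) ∈ Metric.ball (0 : ℂ) (firstZero d Λ β) := by
    simpa [Metric.mem_ball, Complex.norm_real] using hh
  have H := Complex.hasSum_taylorSeries_on_ball hL hmem
  have h0 : |(0 : ℝ)| < firstZero d Λ β := by simpa using (firstZero_spec hβ hΛ).1
  have hcoef : ∀ n : ℕ, iteratedDeriv n L 0 = ((magnetizationCumulant d Λ β n : ℝ) : ℂ) := by
    intro n
    have := iteratedDeriv_log_eq hL hLre n h0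
    rw [Complex.ofReal_zero] at this
    rw [this, magnetizationCumulant]
  rw [hLre h hh] at H
  have hfun : (fun n : ℕ => ((n.factorial : ℕ) : ℂ)⁻¹ • ((h : ℂ) - 0) ^ n • iteratedDeriv n L 0) =
      fun n : ℕ => ((magnetizationCumulant d Λ β n / (n.factorial : ℝ) * h ^ n : ℝ) : ℂ) := by
    funext n
    rw [hcoef n, sub_zero]
    push_cast
    simp only [smul_eq_mul]
    ring
  rw [hfun] at H
  exact Complex.hasSum_ofReal.1 H

/-- Eventual form of the Cauchy–Hadamard bound: for `0 < t < α₁(Λ,β)`, eventually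
`[|u_{2k}(M_Λ)|/(2k)!]^{1/(2k)} ≤ 1/t` (the terms of the convergent series (2.4) at `h = t` are
eventually at most `1`). [cite: JiangNewman2023, §2 eq. (2.22)] -/
theorem eventually_cumulantRoot_le {β : ℝ} (hβ : 0 ≤ β) {Λ : Finset (Site d)} (hΛ : Λ.Nonempty)
    {t : ℝ} (ht : 0 < t) (htα : t < firstZero d Λ β) :
    ∀ᶠ k : ℕ in atTop, (|magnetizationCumulant d Λ β (2 * k)| / ((2 * k).factorial : ℝ)) ^
      ((1 : ℝ) / (2 * k)) ≤ t⁻¹ := by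
  set u : ℕ → ℝ := fun n => magnetizationCumulant d Λ β n with hu
  have hsum := hasSum_magnetizationCumulant hβ hΛ (h := t) (by rwa [abs_of_pos ht])
  have hlim := hsum.summable.tendsto_atTop_zero
  have hev : ∀ᶠ n : ℕ in atTop, |u n| / (n.factorial : ℝ) * t ^ n ≤ 1 := by
    have := (Metric.tendsto_nhds.1 hlim) 1 one_pos
    filter_upwards [this] with n hn
    rw [Real.dist_0_eq_abs, abs_mul, abs_div, abs_pow, abs_of_pos ht, Nat.abs_cast] at hn
    exact hn.le
  obtain ⟨N, hN⟩ := eventually_atTop.1 hev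
  refine eventually_atTop.2 ⟨N + 1, fun k hk => ?_⟩
  have h2k : N ≤ 2 * k := by omega
  have hk0 : (2 * k : ℕ) ≠ 0 := by omega
  have hb := hN (2 * k) h2k
  have htk : 0 < t ^ (2 * k) := pow_pos ht _
  have hle : |u (2 * k)| / ((2 * k).factorial : ℝ) ≤ t⁻¹ ^ (2 * k) := by
    rw [inv_pow, ← one_div, le_div_iff₀ htk]
    exact hb
  calc (|u (2 * k)| / ((2 * k).factorial : ℝ)) ^ ((1 : ℝ) / (2 * k))
      ≤ (t⁻¹ ^ (2 * k)) ^ ((1 : ℝ) / (2 * k)) :=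
        Real.rpow_le_rpow (by positivity) hle (by positivity)
    _ = t⁻¹ := by
        rw [show ((1 : ℝ) / (2 * k)) = ((2 * k : ℕ) : ℝ)⁻¹ by push_cast; ring]
        exact Real.pow_rpow_inv_natCast (inv_nonneg.2 ht.le) hk0

/-- **JN (2.22), the inequality `limsup_k [|u_{2k}(M_Λ)|/(2k)!]^{1/(2k)} ≤ 1/α₁(Λ,β)`** (the
radius of convergence of the cumulant series (2.4) is at least `α₁`; Cauchy–Hadamard, the
elementary direction). [cite: JiangNewman2023, §2 eq. (2.22)] -/
theorem limsup_cumulantRoot_le {β : ℝ} (hβ : 0 ≤ β) {Λ : Finset (Site d)} (hΛ : Λ.Nonempty) :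
    limsup (fun k : ℕ => (|magnetizationCumulant d Λ β (2 * k)| / ((2 * k).factorial : ℝ)) ^
      ((1 : ℝ) / (2 * k))) atTop ≤ (firstZero d Λ β)⁻¹ := by
  set α := firstZero d Λ β with hα
  have hα0 : 0 < α := (firstZero_spec hβ hΛ).1
  set v : ℕ → ℝ := fun k => (|magnetizationCumulant d Λ β (2 * k)| / ((2 * k).factorial : ℝ)) ^
    ((1 : ℝ) / (2 * k)) with hv
  have hv0 : ∀ k, 0 ≤ v k := fun k => Real.rpow_nonneg (by positivity) _
  have hbound : ∀ t : ℝ, 0 < t → t < α → limsup v atTop ≤ t⁻¹ := fun t ht htα =>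
    limsup_le_of_le (isCoboundedUnder_le_of_le atTop hv0) (eventually_cumulantRoot_le hβ hΛ ht htα)
  refine le_of_forall_gt_imp_ge_of_dense fun c hc => ?_
  have hc0 : 0 < c := (inv_pos.2 hα0).trans hc
  have hcα : c⁻¹ < α := by rwa [inv_lt_comm₀ hc0 hα0]
  obtain ⟨t, ht1, ht2⟩ := exists_between hcα
  have ht0 : 0 < t := (inv_pos.2 hc0).trans ht1
  calc limsup v atTop ≤ t⁻¹ := hbound t ht0 ht2
    _ ≤ c := by rw [inv_le_comm₀ ht0 hc0]; exact ht1.le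

/-- **JN (2.22): `1/α₁(Λ,β) = limsup_k [|u_{2k}(M_{Λ,β,0})|/(2k)!]^{1/(2k)}`** — the radius of
convergence of the cumulant series (2.4) is EXACTLY the first zero: it is `≥ α₁`
(`limsup_cumulantRoot_le`), and were it larger, the series would define an analytic `P` on a disc
of radius `r > α₁` with `exp P = Z_{Λ,β,·}` near `0`, hence on the whole disc (identity theorem),
contradicting `Z_{Λ,β,iα₁} = 0`. [cite: JiangNewman2023, §2 eq. (2.22)] -/
theorem inv_firstZero_eq_limsup {β : ℝ} (hβ : 0 ≤ β) {Λ : Finset (Site d)} (hΛ : Λ.Nonempty) :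
    (firstZero d Λ β)⁻¹ = limsup (fun k : ℕ => (|magnetizationCumulant d Λ β (2 * k)| /
      ((2 * k).factorial : ℝ)) ^ ((1 : ℝ) / (2 * k))) atTop := by
  set α := firstZero d Λ β with hα
  obtain ⟨hα0, -, hαzero⟩ := firstZero_spec hβ hΛ
  set u : ℕ → ℝ := fun n => magnetizationCumulant d Λ β n with hu
  set v : ℕ → ℝ := fun k => (|u (2 * k)| / ((2 * k).factorial : ℝ)) ^ ((1 : ℝ) / (2 * k)) with hv
  have hv0 : ∀ k, 0 ≤ v k := fun k => Real.rpow_nonneg (by positivity) _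
  refine le_antisymm ?_ (limsup_cumulantRoot_le hβ hΛ)
  by_contra hlt
  rw [not_le] at hlt
  -- a level `c` with `limsup v < c < 1/α`, `c > 0`
  set c : ℝ := (max (limsup v atTop) 0 + α⁻¹) / 2 with hc
  have hαinv : 0 < α⁻¹ := inv_pos.2 hα0
  have hmax : max (limsup v atTop) 0 < α⁻¹ := max_lt hlt hαinv
  have hc0 : 0 < c := by rw [hc]; linarith [le_max_right (limsup v atTop) 0]
  have hcl : limsup v atTop < c := by rw [hc]; linarith [le_max_left (limsup v atTop) 0]
  have hcα : c < α⁻¹ := by rw [hc]; linarith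
  -- boundedness of `v` (from the lower bound on the radius) and `v k < c` eventually
  obtain ⟨t, ht0, htα⟩ : ∃ t, 0 < t ∧ t < α := ⟨α / 2, by positivity, by linarith⟩
  have hbdd : IsBoundedUnder (· ≤ ·) atTop v :=
    isBoundedUnder_of_eventually_le (eventually_cumulantRoot_le hβ hΛ ht0 htα)
  have hev : ∀ᶠ k in atTop, v k < c := eventually_lt_of_limsup_lt hcl hbdd
  -- coefficients of the cumulant series and their eventual bound `‖a n‖ rⁿ ≤ 1` for `α < r < 1/c`
  set a : ℕ → ℂ := fun n => ((u n / (n.factorial : ℝ) : ℝ) : ℂ) with ha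
  have hαr : α < c⁻¹ := by rwa [lt_inv_comm₀ hα0 hc0]
  obtain ⟨r, hαr', hrc⟩ := exists_between hαr
  have hr0 : 0 < r := hα0.trans hαr'
  have hrc1 : c * r < 1 := by rwa [← lt_div_iff₀' hc0, one_div]
  have hodd : ∀ k, u (2 * k + 1) = 0 := fun k => magnetizationCumulant_odd Λ β k
  obtain ⟨K, hK⟩ := eventually_atTop.1 hev
  have hcoef_bound : ∀ᶠ n : ℕ in atTop, ‖a n‖ * r ^ n ≤ 1 := by
    refine eventually_atTop.2 ⟨2 * K + 2, fun n hn => ?_⟩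
    obtain ⟨k, rfl | rfl⟩ := Nat.even_or_odd' n
    · -- even index `n = 2k`, `k ≥ K + 1`
      have hk : K ≤ k := by omega
      have h2k0 : (2 * k : ℕ) ≠ 0 := by omega
      have hvk := hK k hk
      have hy0 : 0 ≤ |u (2 * k)| / ((2 * k).factorial : ℝ) := by positivity
      have hlt' : |u (2 * k)| / ((2 * k).factorial : ℝ) < c ^ (2 * k) := by
        have h1 := pow_lt_pow_left₀ hvk (hv0 k) h2k0
        have h2 : v k ^ (2 * k) = |u (2 * k)| / ((2 * k).factorial : ℝ) := by
          simp only [hv]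
          rw [show ((1 : ℝ) / (2 * k)) = ((2 * k : ℕ) : ℝ)⁻¹ by push_cast; ring]
          exact Real.rpow_inv_natCast_pow hy0 h2k0
        rwa [h2] at h1
      have hnorm : ‖a (2 * k)‖ = |u (2 * k)| / ((2 * k).factorial : ℝ) := by
        rw [ha]
        dsimp only
        rw [Complex.norm_real, Real.norm_eq_abs, abs_div, Nat.abs_cast]
      rw [hnorm]
      calc |u (2 * k)| / ((2 * k).factorial : ℝ) * r ^ (2 * k)
          ≤ c ^ (2 * k) * r ^ (2 * k) := mul_le_mul_of_nonneg_right hlt'.le (by positivity)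
        _ = (c * r) ^ (2 * k) := by rw [mul_pow]
        _ ≤ 1 := pow_le_one₀ (by positivity) hrc1.le
    · -- odd index: the coefficient vanishes
      have : a (2 * k + 1) = 0 := by
        rw [ha]
        dsimp only
        rw [hodd k, zero_div, Complex.ofReal_zero]
      rw [this, norm_zero, zero_mul]
      exact zero_le_one
  -- the power series `P(z) = ∑ aₙ zⁿ` converges on `|z| < r`
  set r' : NNReal := ⟨r, hr0.le⟩ with hr'
  set p : FormalMultilinearSeries ℂ ℂ ℂ := FormalMultilinearSeries.ofScalars ℂ a with hp
  have hr_le : (r' : ENNReal) ≤ p.radius := by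
    refine p.le_radius_of_eventually_le 1 ?_
    filter_upwards [hcoef_bound] with n hn
    rw [hp, FormalMultilinearSeries.ofScalars_norm]
    exact hn
  have hr'0 : (0 : NNReal) < r' := by rw [← NNReal.coe_pos]; exact hr0
  have hrad : 0 < p.radius := lt_of_lt_of_le (ENNReal.coe_pos.2 hr'0) hr_le
  have hps := p.hasFPowerSeriesOnBall hrad
  set P : ℂ → ℂ := p.sum with hP
  have hball : ∀ z : ℂ, z ∈ Metric.ball (0 : ℂ) r → z ∈ Metric.eball (0 : ℂ) p.radius := by
    intro z hz
    refine Metric.eball_subset_eball hr_le ?_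
    rw [Metric.eball_coe]
    exact hz
  have hPan : AnalyticOnNhd ℂ P (Metric.ball 0 r) := fun z hz => hps.analyticAt_of_mem (hball z hz)
  -- `P = L` (the analytic logarithm) on `|z| < α`
  obtain ⟨L, hL, hexpL, hLre⟩ := exists_log_partitionFunction hβ hΛ
  have h0 : |(0 : ℝ)| < α := by simpa using hα0
  have hcoefL : ∀ n : ℕ, iteratedDeriv n L 0 = ((u n : ℝ) : ℂ) := by
    intro n
    have := iteratedDeriv_log_eq hL hLre n h0
    rwa [Complex.ofReal_zero] at this
  have hPL : ∀ z ∈ Metric.ball (0 : ℂ) α, P z = L z := by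
    intro z hz
    have hT := Complex.taylorSeries_eq_on_ball' hz hL
    have hPz : P z = ∑' n : ℕ, a n • z ^ n := by
      rw [hP, hp]
      exact FormalMultilinearSeries.ofScalars_sum_eq a z
    rw [hPz, ← hT]
    refine tsum_congr fun n => ?_
    rw [hcoefL n, sub_zero, smul_eq_mul, ha]
    push_cast
    ring
  -- `exp ∘ P = Z` near `0`, hence on `|z| < r` (identity theorem)
  have hZan : AnalyticOnNhd ℂ (fun z => partitionFunction d Λ β z) (Metric.ball 0 r) :=
    (differentiable_partitionFunction Λ β).differentiableOn.analyticOnNhd Metric.isOpen_ball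
  have hexpP : AnalyticOnNhd ℂ (fun z => Complex.exp (P z)) (Metric.ball 0 r) :=
    fun z hz => (hPan z hz).cexp
  have hev0 : (fun z => Complex.exp (P z)) =ᶠ[𝓝 (0 : ℂ)] fun z => partitionFunction d Λ β z := by
    filter_upwards [Metric.isOpen_ball.mem_nhds (Metric.mem_ball_self hα0)] with z hz
    rw [hPL z hz, hexpL z hz]
  have heq := hexpP.eqOn_of_preconnected_of_eventuallyEq hZan
    (convex_ball (0 : ℂ) r).isPreconnected (Metric.mem_ball_self hr0) hev0
  -- evaluate at the first zero `iα`
  have hmem : (α : ℂ) * I ∈ Metric.ball (0 : ℂ) r := by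
    rw [Metric.mem_ball, dist_zero_right, norm_mul, Complex.norm_real, Complex.norm_I, mul_one,
      Real.norm_eq_abs, abs_of_pos hα0]
    exact hαr'
  have hval := heq hmem
  simp only at hval
  rw [hαzero] at hval
  exact Complex.exp_ne_zero _ hval

end CumulantSeries

/-! ### Uniform bounds on the cumulant densities (Borel–Carathéodory and Cauchy's estimate) -/

section UniformBound

variable {d}

/-- `|Z_{Λ,β,z}| ≤ e^{|Re z| |Λ|} Z_{Λ,β,0}`. [folklore] -/
theorem norm_partitionFunction_le (Λ : Finset (Site d)) (β : ℝ) (z : ℂ) :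
    ‖partitionFunction d Λ β z‖ ≤ Real.exp (|z.re| * #Λ) * (partitionFunction d Λ β 0).re := by
  rw [show (partitionFunction d Λ β 0).re = (partitionFunction d Λ β ((0 : ℝ) : ℂ)).re by
    rw [Complex.ofReal_zero], re_partitionFunction_ofReal, partitionFunction, Finset.mul_sum]
  refine (norm_sum_le _ _).trans (Finset.sum_le_sum fun τ _ => ?_)
  rw [Complex.norm_exp, zero_mul, add_zero, ← Real.exp_add]
  refine Real.exp_le_exp.2 ?_
  have hre : ((((β * ∑ e ∈ edgesIn (zdGraph d) Λ, bondSpin (glue Λ τ .free) e : ℝ) : ℂ) +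
      z * ((∑ x ∈ Λ, spinAt x (glue Λ τ .free) : ℝ) : ℂ))).re =
      β * ∑ e ∈ edgesIn (zdGraph d) Λ, bondSpin (glue Λ τ .free) e +
        z.re * ∑ x ∈ Λ, spinAt x (glue Λ τ .free) := by
    simp [Complex.add_re, Complex.mul_re]
  rw [hre, add_comm]
  have h := abs_sum_spinAt_le Λ (glue Λ τ .free)
  nlinarith [abs_mul_abs_self (z.re), abs_nonneg z.re,
    neg_abs_le (z.re * ∑ x ∈ Λ, spinAt x (glue Λ τ .free)),
    le_abs_self (z.re * ∑ x ∈ Λ, spinAt x (glue Λ τ .free)),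
    abs_mul z.re (∑ x ∈ Λ, spinAt x (glue Λ τ .free)),
    mul_le_mul_of_nonneg_left h (abs_nonneg z.re)]

/-- **Uniform bound on the cumulant densities** (replacing JN (2.17) for general `k`): for
`β ≥ 0`, nonempty `Λ`, `0 < r < R < α₁(Λ, β)` and `n ≥ 1`,
`|u_n(M_{Λ,β,0})|/|Λ| ≤ n! · (2Rr/(R-r)) · r^{-n}`. Proof: `φ = (ln Z_{Λ,β,h} - ln Z_{Λ,β,0})/|Λ|`
is analytic on `|h| < α₁` with `Re φ ≤ |Re h| ≤ R` (`|Z_{Λ,β,h}| ≤ e^{|Re h||Λ|} Z_{Λ,β,0}`), so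
Borel–Carathéodory gives `|φ| ≤ 2Rr/(R-r)` on `|h| ≤ r`, and Cauchy's estimate bounds
`|φ^{(n)}(0)| = |u_n|/|Λ|`. The constants do not depend on `Λ`. [cite: JiangNewman2023, §2 eqs. (2.17), (2.24)] -/
theorem abs_magnetizationCumulant_div_card_le {β : ℝ} (hβ : 0 ≤ β) {Λ : Finset (Site d)}
    (hΛ : Λ.Nonempty) {r R : ℝ} (hr : 0 < r) (hrR : r < R) (hR : R < firstZero d Λ β)
    {n : ℕ} (hn : 1 ≤ n) :
    |magnetizationCumulant d Λ β n| / #Λ ≤ n.factorial * (2 * R * r / (R - r)) / r ^ n := by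
  set α := firstZero d Λ β with hα
  have hα0 : 0 < α := (firstZero_spec hβ hΛ).1
  have hR0 : 0 < R := hr.trans hrR
  set N : ℝ := (#Λ : ℝ) with hN
  have hNpos : 0 < N := Nat.cast_pos.2 (Finset.card_pos.2 hΛ)
  obtain ⟨L, hL, hexpL, hLre⟩ := exists_log_partitionFunction hβ hΛ
  set U : Set ℂ := Metric.ball (0 : ℂ) α with hU
  have hUo : IsOpen U := Metric.isOpen_ball
  -- the normalised logarithm
  set φ : ℂ → ℂ := fun z => (L z - L 0) / (N : ℂ) with hφ
  have hφdiff : DifferentiableOn ℂ φ U :=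
    (hL.sub (differentiableOn_const _)).div_const _
  have hφ0 : φ 0 = 0 := by simp [hφ]
  -- `Re φ ≤ R` on `|z| < R`
  have hZ0pos : 0 < (partitionFunction d Λ β 0).re := partitionFunction_zero_re_pos Λ β
  have hL0 : L 0 = ((Real.log (partitionFunction d Λ β 0).re : ℝ) : ℂ) := by
    have := hLre 0 (by simpa using hα0)
    simpa using this
  have hreL : ∀ z ∈ U, (L z).re = Real.log ‖partitionFunction d Λ β z‖ := by
    intro z hz
    have h := congrArg (fun w => ‖w‖) (hexpL z hz)
    simp only [Complex.norm_exp] at h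
    rw [← h, Real.log_exp]
  have hmaps : Set.MapsTo φ (Metric.ball (0 : ℂ) R) {w : ℂ | w.re ≤ R} := by
    intro z hz
    have hzU : z ∈ U := Metric.ball_subset_ball hR.le hz
    have hzR : ‖z‖ < R := by simpa using hz
    simp only [Set.mem_setOf_eq, hφ, Complex.div_ofReal_re, Complex.sub_re]
    rw [hreL z hzU, hL0, Complex.ofReal_re, div_le_iff₀ hNpos]
    have hZne : ‖partitionFunction d Λ β z‖ ≠ 0 :=
      norm_ne_zero_iff.2 (partitionFunction_ne_zero_of_norm_lt hβ Λ (by simpa [hU] using hzU))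
    have hZpos : 0 < ‖partitionFunction d Λ β z‖ := (norm_nonneg _).lt_of_ne' hZne
    have hle := norm_partitionFunction_le Λ β z
    have hlog := Real.log_le_log hZpos hle
    rw [Real.log_mul (Real.exp_pos _).ne' hZ0pos.ne', Real.log_exp] at hlog
    have hrez : |z.re| ≤ ‖z‖ := Complex.abs_re_le_norm z
    nlinarith [mul_le_mul_of_nonneg_right hrez hNpos.le]
  -- Borel–Carathéodory on `|z| < R`, evaluated on the circle `|z| = r`
  have hφR : DifferentiableOn ℂ φ (Metric.ball 0 R) := hφdiff.mono (Metric.ball_subset_ball hR.le)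
  have hbound : ∀ z ∈ Metric.sphere (0 : ℂ) r, ‖φ z‖ ≤ 2 * R * r / (R - r) := by
    intro z hz
    have hzr : ‖z‖ = r := by simpa using hz
    have hzR : z ∈ Metric.ball (0 : ℂ) R := by
      rw [Metric.mem_ball, dist_zero_right, hzr]; exact hrR
    have h := Complex.borelCaratheodory_zero hR0 hφR hmaps hR0 hzR hφ0
    rwa [hzr] at h
  -- Cauchy's estimate on `|z| ≤ r`
  have hdc : DiffContOnCl ℂ φ (Metric.ball 0 r) :=
    hφdiff.diffContOnCl_ball (Metric.closedBall_subset_ball (hrR.trans hR))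
  have hC := Complex.norm_iteratedDeriv_le_of_forall_mem_sphere_norm_le n hr hdc hbound
  -- `φ^{(n)}(0) = u_n / |Λ|` for `n ≥ 1`
  have hLan : AnalyticOnNhd ℂ L U := hL.analyticOnNhd hUo
  have hiterL : ∀ k : ℕ, AnalyticOnNhd ℂ (iteratedDeriv k L) U := by
    intro k
    induction k with
    | zero => simpa using hLan
    | succ k ih => rw [iteratedDeriv_succ]; exact ih.deriv
  have hiter : ∀ k : ℕ, 1 ≤ k → ∀ z ∈ U, iteratedDeriv k φ z = iteratedDeriv k L z / (N : ℂ) := by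
    intro k hk
    induction k with
    | zero => exact absurd hk (by norm_num)
    | succ k ih =>
      intro z hz
      rcases Nat.eq_zero_or_pos k with rfl | hkpos
      · -- first derivative
        simp only [zero_add, iteratedDeriv_one]
        have h1 : HasDerivAt φ (deriv L z / (N : ℂ)) z := by
          have := ((hL.differentiableAt (hUo.mem_nhds hz)).hasDerivAt.sub_const (L 0)).div_const (N : ℂ)
          simpa [hφ] using this
        exact h1.deriv
      · have ihk := ih hkpos
        rw [iteratedDeriv_succ, iteratedDeriv_succ]
        have heq : iteratedDeriv k φ =ᶠ[𝓝 z] fun w => iteratedDeriv k L w / (N : ℂ) := by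
          filter_upwards [hUo.mem_nhds hz] with w hw
          exact ihk w hw
        rw [heq.deriv_eq]
        have h2 : HasDerivAt (fun w => iteratedDeriv k L w / (N : ℂ))
            (deriv (iteratedDeriv k L) z / (N : ℂ)) z :=
          ((hiterL k z hz).differentiableAt.hasDerivAt).div_const _
        exact h2.deriv
  have h0U : (0 : ℂ) ∈ U := Metric.mem_ball_self hα0
  have hcoef : iteratedDeriv n L 0 = ((magnetizationCumulant d Λ β n : ℝ) : ℂ) := by
    have := iteratedDeriv_log_eq hL hLre n (t := 0) (by simpa using hα0)
    rwa [Complex.ofReal_zero] at this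
  have hval : ‖iteratedDeriv n φ 0‖ = |magnetizationCumulant d Λ β n| / N := by
    rw [hiter n hn 0 h0U, hcoef, norm_div, Complex.norm_real, Complex.norm_real, Real.norm_eq_abs,
      Real.norm_eq_abs, abs_of_pos hNpos]
  rw [← hval]
  exact hC

end UniformBound

/-! ### The free energy is analytic on every disc `|h| < r` with `r < liminf_n α₁(B_n, β)` -/

section AnalyticBelow

variable {d}

/-- The cumulant series of the finite-volume free energy with the constant term removed:
`f_{Λ,β}(h) - f_{Λ,β}(0) = ∑_{k ≥ 1} (u_k(M_Λ)/(k!|Λ|)) hᵏ` for `|h| < α₁(Λ,β)` (JN (2.4) divided by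
`|Λ|`). [cite: JiangNewman2023, §2 eq. (2.4)] -/
theorem hasSum_freeEnergyIn_sub {β : ℝ} (hβ : 0 ≤ β) {Λ : Finset (Site d)} (hΛ : Λ.Nonempty)
    {h : ℝ} (hh : |h| < firstZero d Λ β) :
    HasSum (fun k : ℕ => (if k = 0 then 0 else
      magnetizationCumulant d Λ β k / ((k.factorial : ℝ) * #Λ)) * h ^ k)
      (freeEnergyIn d Λ β h - freeEnergyIn d Λ β 0) := by
  have H := (hasSum_magnetizationCumulant hβ hΛ hh).div_const (#Λ : ℝ)
  have H0 : HasSum (fun k : ℕ => if k = 0 then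
      magnetizationCumulant d Λ β 0 / ((Nat.factorial 0 : ℕ) : ℝ) * h ^ 0 / #Λ else 0)
      (magnetizationCumulant d Λ β 0 / ((Nat.factorial 0 : ℕ) : ℝ) * h ^ 0 / #Λ) := hasSum_ite_eq 0 _
  have H1 := H.sub H0
  have hf0 : freeEnergyIn d Λ β 0 =
      magnetizationCumulant d Λ β 0 / ((Nat.factorial 0 : ℕ) : ℝ) * h ^ 0 / #Λ := by
    simp [freeEnergyIn, magnetizationCumulant]
  have hfh : freeEnergyIn d Λ β h = Real.log (partitionFunction d Λ β h).re / #Λ := rfl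
  rw [hfh, hf0]
  have hfun : (fun b : ℕ => magnetizationCumulant d Λ β b / (b.factorial : ℝ) * h ^ b / #Λ -
      (if b = 0 then magnetizationCumulant d Λ β 0 / ((Nat.factorial 0 : ℕ) : ℝ) * h ^ 0 / #Λ else 0)) =
      fun k : ℕ => (if k = 0 then 0 else
        magnetizationCumulant d Λ β k / ((k.factorial : ℝ) * #Λ)) * h ^ k := by
    funext k
    split_ifs with hk
    · subst hk; simp
    · ring
  rw [hfun] at H1
  exact H1

/-- **Analyticity of the free energy below the first Lee–Yang zeros** (the Lee–Yang mechanism behind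
JN Theorem 1 / Prop. 3, "`α₁(ℤ^d,β)` is the radius of the largest disc … where `f_β` is analytic",
in the direction which needs neither Ott's analyticity nor the monotonicity of Ursell functions):
if `0 < r < R < α₁(B_n, β)` for all large `n`, then `f_β` extends holomorphically to `|h| < r`.
Proof: the finite-volume expansions `f_{B_n,β}(h) - f_{B_n,β}(0) = ∑_k c_{n,k} hᵏ` (JN (2.4)) have
`|c_{n,k}| ≤ C r^{-k}` uniformly in `n` (`abs_magnetizationCumulant_div_card_le`); along a
subsequence the coefficient vectors converge (compactness of `∏_k [-C r^{-k}, C r^{-k}]`), the sums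
converge to the limit series by dominated convergence and to `f_β(h) - f_β(0)` by clause (0), so
`f_β - f_β(0)` is a power series with radius `≥ r` on the real segment.
[cite: JiangNewman2023, Thm. 1 and Prop. 3 (analyticity radius ≥ lim α₁)] -/
theorem analyticOnDisc_of_eventually_lt_firstZero {β : ℝ} (hβ : 0 ≤ β) {r R : ℝ} (hr : 0 < r)
    (hrR : r < R) (hev : ∀ᶠ n : ℕ in atTop, R < firstZero d (box d n) β) :
    AnalyticOnDisc d β r := by
  set C : ℝ := 2 * R * r / (R - r) with hC
  have hRr : 0 < R - r := by linarith
  have hR0 : 0 < R := hr.trans hrR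
  have hC0 : 0 ≤ C := by rw [hC]; exact div_nonneg (by positivity) hRr.le
  -- coefficient sequences of `f_{B_n} - f_{B_n}(0)`
  set e : ℕ → ℕ → ℝ := fun n k => if k = 0 then 0 else
    magnetizationCumulant d (box d n) β k / ((k.factorial : ℝ) * #(box d n)) with he
  have hbd : ∀ᶠ n : ℕ in atTop, ∀ k, |e n k| ≤ C / r ^ k := by
    filter_upwards [hev] with n hn k
    by_cases hk : k = 0
    · simp only [he, hk, if_true, abs_zero]; positivity
    · have h1 := abs_magnetizationCumulant_div_card_le hβ (box_nonempty d n) hr hrR hn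
        (Nat.one_le_iff_ne_zero.2 hk) (n := k)
      have hN : (0 : ℝ) < #(box d n) := Nat.cast_pos.2 (Finset.card_pos.2 (box_nonempty d n))
      have hk! : (0 : ℝ) < k.factorial := Nat.cast_pos.2 (Nat.factorial_pos k)
      simp only [he, hk, if_false]
      rw [abs_div, abs_mul, Nat.abs_cast, Nat.abs_cast]
      calc |magnetizationCumulant d (box d n) β k| / ((k.factorial : ℝ) * #(box d n))
          = (|magnetizationCumulant d (box d n) β k| / #(box d n)) / k.factorial := by
            field_simp
        _ ≤ (k.factorial * (2 * R * r / (R - r)) / r ^ k) / k.factorial :=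
            div_le_div_of_nonneg_right h1 hk!.le
        _ = C / r ^ k := by rw [hC]; field_simp
  obtain ⟨n₀, hn₀⟩ := eventually_atTop.1 (hbd.and hev)
  -- compactness of the coefficient box and a convergent subsequence
  set K : Set (ℕ → ℝ) := Set.pi Set.univ fun k => Set.Icc (-(C / r ^ k)) (C / r ^ k) with hK
  have hKc : IsCompact K := isCompact_univ_pi fun _ => isCompact_Icc
  have hxK : ∀ j : ℕ, e (j + n₀) ∈ K := fun j =>
    Set.mem_univ_pi.2 fun k => abs_le.1 ((hn₀ (j + n₀) le_add_self).1 k)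
  obtain ⟨a, haK, φ, hφ, hlim⟩ := hKc.isSeqCompact hxK
  have hlimk : ∀ k, Tendsto (fun j => e (φ j + n₀) k) atTop (𝓝 (a k)) := fun k => by
    have := tendsto_pi_nhds.1 hlim k
    simpa [Function.comp] using this
  have haK' : ∀ k, |a k| ≤ C / r ^ k := fun k => abs_le.2 (Set.mem_univ_pi.1 haK k)
  have hsubseq : Tendsto (fun j => φ j + n₀) atTop atTop :=
    tendsto_atTop_atTop.2 fun b => ⟨b, fun j hj => hj.trans ((hφ.id_le j).trans le_self_add)⟩
  -- the limit series is `f_β(h) - f_β(0)` for `|h| < r`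
  have hseries : ∀ h : ℝ, |h| < r →
      HasSum (fun k => a k * h ^ k) (freeEnergy d β h - freeEnergy d β 0) := by
    intro h hh
    have hq : |h| / r < 1 := (div_lt_one hr).2 hh
    have hq0 : 0 ≤ |h| / r := by positivity
    have hgeom : Summable (fun k : ℕ => C * (|h| / r) ^ k) :=
      (summable_geometric_of_lt_one hq0 hq).mul_left C
    have hbound_of : ∀ (x : ℝ) (k : ℕ), |x| ≤ C / r ^ k → ‖x * h ^ k‖ ≤ C * (|h| / r) ^ k := by
      intro x k hx
      rw [Real.norm_eq_abs, abs_mul, abs_pow, div_pow]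
      calc |x| * |h| ^ k ≤ C / r ^ k * |h| ^ k := mul_le_mul_of_nonneg_right hx (by positivity)
        _ = C * (|h| ^ k / r ^ k) := by ring
    have hT := tendsto_tsum_of_dominated_convergence (𝓕 := atTop)
      (f := fun j k => e (φ j + n₀) k * h ^ k) (g := fun k => a k * h ^ k)
      (bound := fun k => C * (|h| / r) ^ k) hgeom (fun k => (hlimk k).mul_const _)
      (Eventually.of_forall fun j k => hbound_of _ k ((hn₀ (φ j + n₀) le_add_self).1 k))
    have hfin : ∀ j, ∑' k, e (φ j + n₀) k * h ^ k =
        freeEnergyIn d (box d (φ j + n₀)) β h - freeEnergyIn d (box d (φ j + n₀)) β 0 := by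
      intro j
      have hα : |h| < firstZero d (box d (φ j + n₀)) β :=
        hh.trans (hrR.trans (hn₀ (φ j + n₀) le_add_self).2)
      exact (hasSum_freeEnergyIn_sub hβ (box_nonempty d _) hα).tsum_eq
    have hconv : Tendsto (fun j => freeEnergyIn d (box d (φ j + n₀)) β h -
        freeEnergyIn d (box d (φ j + n₀)) β 0) atTop (𝓝 (freeEnergy d β h - freeEnergy d β 0)) :=
      ((tendsto_freeEnergyIn d β h).comp hsubseq).sub ((tendsto_freeEnergyIn d β 0).comp hsubseq)
    have hlim2 := tendsto_nhds_unique (hT.congr hfin) hconv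
    have hsumm : Summable (fun k => a k * h ^ k) :=
      hgeom.of_norm_bounded fun k => hbound_of _ k (haK' k)
    rw [← hlim2]
    exact hsumm.hasSum
  -- the analytic continuation: the power series `∑ aₖ zᵏ` on `|z| < r`
  set A : ℕ → ℂ := fun k => ((a k : ℝ) : ℂ) with hA
  set r' : NNReal := ⟨r, hr.le⟩ with hr'
  set p : FormalMultilinearSeries ℂ ℂ ℂ := FormalMultilinearSeries.ofScalars ℂ A with hp
  have hrad : (r' : ENNReal) ≤ p.radius := by
    refine p.le_radius_of_bound C fun k => ?_
    rw [hp, FormalMultilinearSeries.ofScalars_norm, hA]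
    dsimp only
    rw [Complex.norm_real, Real.norm_eq_abs]
    calc |a k| * (r' : ℝ) ^ k ≤ C / r ^ k * r ^ k := mul_le_mul_of_nonneg_right (haK' k) (by positivity)
      _ = C := by field_simp
  have hr'0 : (0 : NNReal) < r' := by rw [← NNReal.coe_pos]; exact hr
  have hrad0 : 0 < p.radius := lt_of_lt_of_le (ENNReal.coe_pos.2 hr'0) hrad
  have hps := p.hasFPowerSeriesOnBall hrad0
  set P : ℂ → ℂ := p.sum with hP
  have hball : ∀ z : ℂ, z ∈ Metric.ball (0 : ℂ) r → z ∈ Metric.eball (0 : ℂ) p.radius := by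
    intro z hz
    refine Metric.eball_subset_eball hrad ?_
    rw [Metric.eball_coe]
    exact hz
  have hPdiff : DifferentiableOn ℂ P (Metric.ball 0 r) := fun z hz =>
    (hps.analyticAt_of_mem (hball z hz)).differentiableAt.differentiableWithinAt
  have hPreal : ∀ h : ℝ, |h| < r → P h = ((freeEnergy d β h - freeEnergy d β 0 : ℝ) : ℂ) := by
    intro h hh
    have hPz : P h = ∑' k : ℕ, A k • (h : ℂ) ^ k := by
      rw [hP, hp]
      exact FormalMultilinearSeries.ofScalars_sum_eq A _
    have hCx := Complex.hasSum_ofReal.2 (hseries h hh)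
    rw [hPz, ← hCx.tsum_eq]
    refine tsum_congr fun k => ?_
    rw [hA, smul_eq_mul]
    push_cast
    ring
  refine ⟨fun z => P z + ((freeEnergy d β 0 : ℝ) : ℂ), hPdiff.add (differentiableOn_const _),
    fun h hh => ?_⟩
  dsimp only
  rw [hPreal h hh]
  push_cast
  ring

/-- **The free energy is analytic on `|h| < r` for every `r < liminf_n α₁(B_n, β)`** — in
particular, granted the limit `α₁(B_n,β) → a` (JN Thm. 1), on every disc of radius `< a`.
[cite: JiangNewman2023, Thm. 1 (analyticity radius ≥ α₁(ℤ^d,β))] -/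
theorem analyticOnDisc_of_lt_liminf {β : ℝ} (hβ : 0 ≤ β) {r : ℝ} (hr : 0 < r)
    (hlt : r < liminf (fun n : ℕ => firstZero d (box d n) β) atTop) : AnalyticOnDisc d β r := by
  obtain ⟨R, hrR, hR⟩ := exists_between hlt
  refine analyticOnDisc_of_eventually_lt_firstZero hβ hr hrR ?_
  exact eventually_lt_of_lt_liminf hR (isBoundedUnder_of_eventually_ge
    (Eventually.of_forall fun n => firstZero_nonneg d (box d n) β))

/-- Version with a limit: if `α₁(B_n, β) → a` then `f_β` is analytic on `|h| < r` for every
`0 < r < a`. [cite: JiangNewman2023, Thm. 1 (analyticity radius ≥ α₁(ℤ^d,β))] -/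
theorem analyticOnDisc_of_lt_lim {β : ℝ} (hβ : 0 ≤ β) {a r : ℝ}
    (ha : Tendsto (fun n : ℕ => firstZero d (box d n) β) atTop (𝓝 a)) (hr : 0 < r) (hra : r < a) :
    AnalyticOnDisc d β r :=
  analyticOnDisc_of_lt_liminf hβ hr (by rwa [ha.liminf_eq])

end AnalyticBelow

/-! ### Consequences of a positive limit `α₁(B_n, β) → a > 0`: Taylor coefficients of `f_β` -/

section PositiveLimit

variable {d}

/-- Real and complex iterated derivatives of a holomorphic function agree on the real diameter:
`(d/dt)ᵏ Re F(t) = Re F^{(k)}(t)` for `|t| < r`. [folklore] -/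
theorem iteratedDeriv_re_ofReal_eq {F : ℂ → ℂ} {r : ℝ} (hF : DifferentiableOn ℂ F (Metric.ball 0 r))
    (k : ℕ) {t : ℝ} (ht : |t| < r) :
    iteratedDeriv k (fun s : ℝ => (F s).re) t = (iteratedDeriv k F t).re := by
  set U : Set ℂ := Metric.ball 0 r with hU
  have hUo : IsOpen U := Metric.isOpen_ball
  set S : Set ℝ := {s : ℝ | |s| < r} with hS
  have hSo : IsOpen S := isOpen_lt continuous_abs continuous_const
  have hmemU : ∀ s ∈ S, ((s : ℂ)) ∈ U := fun s hs => by
    have hs' : |s| < r := hs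
    simpa [hU, Metric.mem_ball, Complex.norm_real] using hs'
  have hFan : AnalyticOnNhd ℂ F U := hF.analyticOnNhd hUo
  have hiter : ∀ k : ℕ, AnalyticOnNhd ℂ (iteratedDeriv k F) U := by
    intro k
    induction k with
    | zero => simpa using hFan
    | succ k ih => rw [iteratedDeriv_succ]; exact ih.deriv
  suffices H : ∀ k : ℕ, ∀ s ∈ S,
      iteratedDeriv k (fun s : ℝ => (F s).re) s = (iteratedDeriv k F s).re from H k t ht
  intro k
  induction k with
  | zero => intro s _; simp
  | succ k ih =>
    intro s hs
    have h1 : HasDerivAt (fun x : ℝ => (iteratedDeriv k F x).re)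
        (deriv (iteratedDeriv k F) (s : ℂ)).re s :=
      ((hiter k _ (hmemU s hs)).differentiableAt.hasDerivAt).real_of_complex
    have heq : iteratedDeriv k (fun x : ℝ => (F x).re) =ᶠ[𝓝 s]
        fun x : ℝ => (iteratedDeriv k F x).re := by
      filter_upwards [hSo.mem_nhds hs] with x hx
      exact ih x hx
    rw [iteratedDeriv_succ, iteratedDeriv_succ, heq.deriv_eq, h1.deriv]

/-- **The Taylor coefficients of `f_β` from a power-series representation on a real segment**: if
`∑_k a_k hᵏ = f_β(h) - f_β(0)` for all real `|h| < r` with `|a_k| ≤ C r^{-k}`, then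
`f_β^{(k)}(0) = k! a_k` for `k ≥ 1` (the series defines a holomorphic function on `|z| < r` whose real
trace is `f_β - f_β(0)`). [folklore] -/
theorem iteratedDeriv_freeEnergy_eq_of_hasSum {β : ℝ} {r C : ℝ} (hr : 0 < r) {a : ℕ → ℝ}
    (ha : ∀ k, |a k| ≤ C / r ^ k)
    (hsum : ∀ h : ℝ, |h| < r → HasSum (fun k => a k * h ^ k) (freeEnergy d β h - freeEnergy d β 0))
    {k : ℕ} (hk : 1 ≤ k) :
    iteratedDeriv k (freeEnergy d β) 0 = k.factorial * a k := by
  -- the power series `P(z) = ∑ aₖ zᵏ`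
  set A : ℕ → ℂ := fun k => ((a k : ℝ) : ℂ) with hA
  set r' : NNReal := ⟨r, hr.le⟩ with hr'
  set p : FormalMultilinearSeries ℂ ℂ ℂ := FormalMultilinearSeries.ofScalars ℂ A with hp
  have hC0 : 0 ≤ C := by
    have := ha 0
    rw [pow_zero, div_one] at this
    exact (abs_nonneg _).trans this
  have hrad : (r' : ENNReal) ≤ p.radius := by
    refine p.le_radius_of_bound C fun k => ?_
    rw [hp, FormalMultilinearSeries.ofScalars_norm, hA]
    dsimp only
    rw [Complex.norm_real, Real.norm_eq_abs]
    calc |a k| * (r' : ℝ) ^ k ≤ C / r ^ k * r ^ k := mul_le_mul_of_nonneg_right (ha k) (by positivity)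
      _ = C := by field_simp
  have hr'0 : (0 : NNReal) < r' := by rw [← NNReal.coe_pos]; exact hr
  have hrad0 : 0 < p.radius := lt_of_lt_of_le (ENNReal.coe_pos.2 hr'0) hrad
  have hps := p.hasFPowerSeriesOnBall hrad0
  set P : ℂ → ℂ := p.sum with hP
  have hball : ∀ z : ℂ, z ∈ Metric.ball (0 : ℂ) r → z ∈ Metric.eball (0 : ℂ) p.radius := by
    intro z hz
    refine Metric.eball_subset_eball hrad ?_
    rw [Metric.eball_coe]
    exact hz
  have hPdiff : DifferentiableOn ℂ P (Metric.ball 0 r) := fun z hz =>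
    (hps.analyticAt_of_mem (hball z hz)).differentiableAt.differentiableWithinAt
  have hPreal : ∀ h : ℝ, |h| < r → P h = ((freeEnergy d β h - freeEnergy d β 0 : ℝ) : ℂ) := by
    intro h hh
    have hPz : P h = ∑' k : ℕ, A k • (h : ℂ) ^ k := by
      rw [hP, hp]
      exact FormalMultilinearSeries.ofScalars_sum_eq A _
    have hCx := Complex.hasSum_ofReal.2 (hsum h hh)
    rw [hPz, ← hCx.tsum_eq]
    refine tsum_congr fun k => ?_
    rw [hA, smul_eq_mul]
    push_cast
    ring
  -- `F = f_β(0) + P` has real trace `f_β`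
  set F : ℂ → ℂ := fun z => ((freeEnergy d β 0 : ℝ) : ℂ) + P z with hFdef
  have hFdiff : DifferentiableOn ℂ F (Metric.ball 0 r) := (differentiableOn_const _).add hPdiff
  have hFreal : ∀ h : ℝ, |h| < r → (F h).re = freeEnergy d β h := by
    intro h hh
    simp only [hFdef, hPreal h hh, Complex.add_re, Complex.ofReal_re]
    ring
  -- `f_β^{(k)}(0) = Re F^{(k)}(0)`
  have hloc : freeEnergy d β =ᶠ[𝓝 (0 : ℝ)] fun h : ℝ => (F h).re := by
    have h0 : (0 : ℝ) ∈ {s : ℝ | |s| < r} := by simp [hr]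
    filter_upwards [(isOpen_lt continuous_abs continuous_const).mem_nhds h0] with h hh
    exact (hFreal h hh).symm
  rw [hloc.iteratedDeriv_eq, iteratedDeriv_re_ofReal_eq hFdiff k (by simpa using hr),
    Complex.ofReal_zero]
  -- `F^{(k)}(0) = P^{(k)}(0) = k! aₖ` for `k ≥ 1`
  have hkpos : 0 < k := hk
  have hFP : iteratedDeriv k F 0 = iteratedDeriv k P 0 := iteratedDeriv_const_add hkpos _
  have hPk : iteratedDeriv k P 0 = (k.factorial : ℂ) * A k := by
    have h := hps.factorial_smul 1 k
    rw [hp, FormalMultilinearSeries.ofScalars_apply_eq, one_pow, smul_eq_mul, mul_one,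
      nsmul_eq_mul] at h
    rw [iteratedDeriv_eq_iteratedFDeriv]
    exact h.symm
  rw [hFP, hPk, hA]
  dsimp only
  rw [show ((k.factorial : ℕ) : ℂ) * ((a k : ℝ) : ℂ) = (((k.factorial : ℝ) * a k : ℝ) : ℂ) by
    push_cast; ring, Complex.ofReal_re]

/-- The coefficient bound `|c_{n,k}| ≤ (2Rr/(R-r)) r^{-k}` for the normalised cumulant series of
`B_n` whenever `0 < r < R < α₁(B_n,β)` (`c_{n,0} := 0`). [cite: JiangNewman2023, §2 eqs. (2.4), (2.24)] -/
theorem abs_cumulantCoeff_le {β : ℝ} (hβ : 0 ≤ β) {r R : ℝ} (hr : 0 < r) (hrR : r < R) {n : ℕ}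
    (hn : R < firstZero d (box d n) β) (k : ℕ) :
    |(if k = 0 then (0 : ℝ) else
      magnetizationCumulant d (box d n) β k / ((k.factorial : ℝ) * #(box d n)))| ≤
      (2 * R * r / (R - r)) / r ^ k := by
  have hRr : 0 < R - r := by linarith
  have hR0 : 0 < R := hr.trans hrR
  have hC0 : 0 ≤ 2 * R * r / (R - r) := div_nonneg (by positivity) hRr.le
  by_cases hk : k = 0
  · simp only [hk, if_true, abs_zero]; positivity
  · have h1 := abs_magnetizationCumulant_div_card_le hβ (box_nonempty d n) hr hrR hn
      (Nat.one_le_iff_ne_zero.2 hk) (n := k)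
    have hk! : (0 : ℝ) < k.factorial := Nat.cast_pos.2 (Nat.factorial_pos k)
    simp only [hk, if_false]
    rw [abs_div, abs_mul, Nat.abs_cast, Nat.abs_cast]
    calc |magnetizationCumulant d (box d n) β k| / ((k.factorial : ℝ) * #(box d n))
        = (|magnetizationCumulant d (box d n) β k| / #(box d n)) / k.factorial := by
          field_simp
      _ ≤ (k.factorial * (2 * R * r / (R - r)) / r ^ k) / k.factorial :=
          div_le_div_of_nonneg_right h1 hk!.le
      _ = (2 * R * r / (R - r)) / r ^ k := by field_simp

/-- **Subsequential limits of the cumulant coefficient vectors** (the compactness step behind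
`analyticOnDisc_of_eventually_lt_firstZero`, along an arbitrary subsequence `ns`): if
`R < α₁(B_n,β)` for all large `n` and `0 < r < R`, then along a further subsequence the vectors
`(c_{n,k})_k` converge coordinatewise to some `b` with `|b_k| ≤ (2Rr/(R-r)) r^{-k}`, `b_0 = 0`,
`∑_k b_k hᵏ = f_β(h) - f_β(0)` for `|h| < r`, and consequently `f_β^{(k)}(0) = k! b_k` (`k ≥ 1`).
[cite: JiangNewman2023, Thm. 1 and Prop. 3 (analyticity radius ≥ lim α₁)] -/
theorem exists_cumulantCoeff_limit {β : ℝ} (hβ : 0 ≤ β) {r R : ℝ} (hr : 0 < r) (hrR : r < R)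
    {ns : ℕ → ℕ} (hns : Tendsto ns atTop atTop)
    (hev : ∀ᶠ n : ℕ in atTop, R < firstZero d (box d n) β) :
    ∃ (b : ℕ → ℝ) (ms : ℕ → ℕ), (∀ k, |b k| ≤ (2 * R * r / (R - r)) / r ^ k) ∧ b 0 = 0 ∧
      (∀ k, Tendsto (fun j => (if k = 0 then (0 : ℝ) else
        magnetizationCumulant d (box d (ns (ms j))) β k /
          ((k.factorial : ℝ) * #(box d (ns (ms j)))))) atTop (𝓝 (b k))) ∧
      (∀ h : ℝ, |h| < r → HasSum (fun k => b k * h ^ k) (freeEnergy d β h - freeEnergy d β 0)) ∧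
      (∀ k, 1 ≤ k → iteratedDeriv k (freeEnergy d β) 0 = k.factorial * b k) := by
  set C : ℝ := 2 * R * r / (R - r) with hC
  set e : ℕ → ℕ → ℝ := fun n k => if k = 0 then (0 : ℝ) else
    magnetizationCumulant d (box d n) β k / ((k.factorial : ℝ) * #(box d n)) with he
  -- from some index on, the subsequence stays in the region `R < α₁`
  obtain ⟨n₁, hn₁⟩ := eventually_atTop.1 hev
  obtain ⟨j₁, hj₁⟩ := eventually_atTop.1 (hns.eventually (eventually_ge_atTop n₁))
  have hgood : ∀ j, R < firstZero d (box d (ns (j + j₁))) β := fun j => hn₁ _ (hj₁ _ le_add_self)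
  have hbd : ∀ j k, |e (ns (j + j₁)) k| ≤ C / r ^ k := fun j k =>
    abs_cumulantCoeff_le hβ hr hrR (hgood j) k
  -- compactness
  set K : Set (ℕ → ℝ) := Set.pi Set.univ fun k => Set.Icc (-(C / r ^ k)) (C / r ^ k) with hK
  have hKc : IsCompact K := isCompact_univ_pi fun _ => isCompact_Icc
  have hxK : ∀ j : ℕ, e (ns (j + j₁)) ∈ K := fun j =>
    Set.mem_univ_pi.2 fun k => abs_le.1 (hbd j k)
  obtain ⟨b, hbK, φ, hφ, hlim⟩ := hKc.isSeqCompact hxK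
  have hlimk : ∀ k, Tendsto (fun j => e (ns (φ j + j₁)) k) atTop (𝓝 (b k)) := fun k => by
    have := tendsto_pi_nhds.1 hlim k
    simpa [Function.comp] using this
  have hbK' : ∀ k, |b k| ≤ C / r ^ k := fun k => abs_le.2 (Set.mem_univ_pi.1 hbK k)
  have hb0 : b 0 = 0 := by
    have h0 : Tendsto (fun j => e (ns (φ j + j₁)) 0) atTop (𝓝 0) := by
      simp only [he, if_true]; exact tendsto_const_nhds
    exact tendsto_nhds_unique (hlimk 0) h0
  have hsubseq : Tendsto (fun j => ns (φ j + j₁)) atTop atTop :=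
    hns.comp (tendsto_atTop_atTop.2 fun m => ⟨m, fun j hj => hj.trans ((hφ.id_le j).trans le_self_add)⟩)
  -- the limit series is `f_β(h) - f_β(0)` for `|h| < r` (dominated convergence)
  have hseries : ∀ h : ℝ, |h| < r →
      HasSum (fun k => b k * h ^ k) (freeEnergy d β h - freeEnergy d β 0) := by
    intro h hh
    have hq : |h| / r < 1 := (div_lt_one hr).2 hh
    have hq0 : 0 ≤ |h| / r := by positivity
    have hgeom : Summable (fun k : ℕ => C * (|h| / r) ^ k) :=
      (summable_geometric_of_lt_one hq0 hq).mul_left C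
    have hbound_of : ∀ (x : ℝ) (k : ℕ), |x| ≤ C / r ^ k → ‖x * h ^ k‖ ≤ C * (|h| / r) ^ k := by
      intro x k hx
      rw [Real.norm_eq_abs, abs_mul, abs_pow, div_pow]
      calc |x| * |h| ^ k ≤ C / r ^ k * |h| ^ k := mul_le_mul_of_nonneg_right hx (by positivity)
        _ = C * (|h| ^ k / r ^ k) := by ring
    have hT := tendsto_tsum_of_dominated_convergence (𝓕 := atTop)
      (f := fun j k => e (ns (φ j + j₁)) k * h ^ k) (g := fun k => b k * h ^ k)
      (bound := fun k => C * (|h| / r) ^ k) hgeom (fun k => (hlimk k).mul_const _)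
      (Eventually.of_forall fun j k => hbound_of _ k (hbd (φ j) k))
    have hfin : ∀ j, ∑' k, e (ns (φ j + j₁)) k * h ^ k =
        freeEnergyIn d (box d (ns (φ j + j₁))) β h - freeEnergyIn d (box d (ns (φ j + j₁))) β 0 := by
      intro j
      have hα : |h| < firstZero d (box d (ns (φ j + j₁))) β := hh.trans (hrR.trans (hgood (φ j)))
      exact (hasSum_freeEnergyIn_sub hβ (box_nonempty d _) hα).tsum_eq
    have hconv : Tendsto (fun j => freeEnergyIn d (box d (ns (φ j + j₁))) β h -
        freeEnergyIn d (box d (ns (φ j + j₁))) β 0) atTop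
        (𝓝 (freeEnergy d β h - freeEnergy d β 0)) :=
      ((tendsto_freeEnergyIn d β h).comp hsubseq).sub ((tendsto_freeEnergyIn d β 0).comp hsubseq)
    have hlim2 := tendsto_nhds_unique (hT.congr hfin) hconv
    have hsumm : Summable (fun k => b k * h ^ k) :=
      hgeom.of_norm_bounded fun k => hbound_of _ k (hbK' k)
    rw [← hlim2]
    exact hsumm.hasSum
  refine ⟨b, fun j => φ j + j₁, hbK', hb0, hlimk, hseries, fun k hk => ?_⟩
  exact iteratedDeriv_freeEnergy_eq_of_hasSum hr hbK' hseries hk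

/-- **Convergence of the cumulant densities (clause (iv)(a) of the fact), granted a positive
limit of the first zeros**: if `α₁(B_n,β) → a > 0`, then for every `k`,
`u_k(M_{B_n,β,0})/|B_n| → f_β^{(k)}(0)` (JN Prop. 1 with Prop. 3, eq. (2.21), there via
Theorem 2 = Lebowitz 1972 + ABF 1987; here: every subsequential limit of the normalised
coefficients is the Taylor coefficient of `f_β`). [cite: JiangNewman2023, Prop. 3, eq. (2.21)] -/
theorem tendsto_magnetizationCumulant_div_card {β : ℝ} (hβ : 0 ≤ β) {a : ℝ}
    (hlim : Tendsto (fun n : ℕ => firstZero d (box d n) β) atTop (𝓝 a)) (ha : 0 < a) (k : ℕ) :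
    Tendsto (fun n : ℕ => magnetizationCumulant d (box d n) β k / (#(box d n) : ℝ)) atTop
      (𝓝 (iteratedDeriv k (freeEnergy d β) 0)) := by
  rcases Nat.eq_zero_or_pos k with rfl | hkpos
  · -- `k = 0`: `u₀/|Λ| = f_{B_n}(0) → f_β(0)`
    simp only [iteratedDeriv_zero]
    refine (tendsto_freeEnergyIn d β 0).congr fun n => ?_
    simp [freeEnergyIn, magnetizationCumulant]
  -- `k ≥ 1`
  set r : ℝ := a / 3 with hr
  set R : ℝ := 2 * a / 3 with hR
  have hr0 : 0 < r := by rw [hr]; positivity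
  have hrR : r < R := by rw [hr, hR]; linarith
  have hRa : R < a := by rw [hR]; linarith
  have hev : ∀ᶠ n : ℕ in atTop, R < firstZero d (box d n) β := hlim.eventually (eventually_gt_nhds hRa)
  have hk! : (k.factorial : ℝ) ≠ 0 := Nat.cast_ne_zero.2 (Nat.factorial_ne_zero k)
  -- it suffices to treat the normalised coefficients `u_k/(k!|Λ|)`
  suffices H : Tendsto (fun n : ℕ => magnetizationCumulant d (box d n) β k /
      ((k.factorial : ℝ) * #(box d n))) atTop (𝓝 (iteratedDeriv k (freeEnergy d β) 0 / k.factorial)) by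
    have := H.const_mul (k.factorial : ℝ)
    rw [mul_div_cancel₀ _ hk!] at this
    refine this.congr fun n => ?_
    field_simp
  refine tendsto_of_subseq_tendsto fun ns hns => ?_
  obtain ⟨b, ms, -, -, hconv, -, hderiv⟩ := exists_cumulantCoeff_limit hβ hr0 hrR hns hev
  refine ⟨ms, ?_⟩
  have hbk : b k = iteratedDeriv k (freeEnergy d β) 0 / k.factorial := by
    rw [hderiv k hkpos, mul_div_cancel_left₀ _ hk!]
  have hk0 : k ≠ 0 := by omega
  have := hconv k
  simp only [hk0, if_false] at this
  rwa [hbk] at this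

/-- **Cauchy-type bounds on the Taylor coefficients of `f_β`**, granted `α₁(B_n,β) → a`: for
`0 < r < R < a` and `k ≥ 1`, `|f_β^{(k)}(0)|/k! ≤ (2Rr/(R-r)) r^{-k}`.
[cite: JiangNewman2023, Prop. 3 (radius of convergence of ∑ b_k h^k/k! is ≥ lim α₁)] -/
theorem abs_iteratedDeriv_freeEnergy_div_le {β : ℝ} (hβ : 0 ≤ β) {a : ℝ}
    (hlim : Tendsto (fun n : ℕ => firstZero d (box d n) β) atTop (𝓝 a)) {r R : ℝ} (hr : 0 < r)
    (hrR : r < R) (hRa : R < a) {k : ℕ} (hk : 1 ≤ k) :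
    |iteratedDeriv k (freeEnergy d β) 0| / k.factorial ≤ (2 * R * r / (R - r)) / r ^ k := by
  have hev : ∀ᶠ n : ℕ in atTop, R < firstZero d (box d n) β := hlim.eventually (eventually_gt_nhds hRa)
  obtain ⟨b, -, hbd, -, -, -, hderiv⟩ := exists_cumulantCoeff_limit hβ hr hrR tendsto_id hev
  have hk! : (0 : ℝ) < k.factorial := Nat.cast_pos.2 (Nat.factorial_pos k)
  rw [hderiv k hk, abs_mul, Nat.abs_cast, mul_div_cancel_left₀ _ hk!.ne']
  exact hbd k

/-- **Analyticity up to the limit of the first zeros (clause `ρ = a`)**: if `α₁(B_n,β) → a > 0`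
then `f_β` extends holomorphically to the full disc `|h| < a` — the Taylor series
`∑ f_β^{(k)}(0) hᵏ/k!` has radius `≥ r` for every `r < a`.
[cite: JiangNewman2023, Thm. 1 (analyticity radius ≥ α₁(ℤ^d,β))] -/
theorem analyticOnDisc_of_tendsto_firstZero {β : ℝ} (hβ : 0 ≤ β) {a : ℝ}
    (hlim : Tendsto (fun n : ℕ => firstZero d (box d n) β) atTop (𝓝 a)) (ha : 0 < a) :
    AnalyticOnDisc d β a := by
  -- the intrinsic coefficients
  set q : ℕ → ℝ := fun k => if k = 0 then 0 else iteratedDeriv k (freeEnergy d β) 0 / k.factorial with hq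
  set Q : ℕ → ℂ := fun k => ((q k : ℝ) : ℂ) with hQ
  set p : FormalMultilinearSeries ℂ ℂ ℂ := FormalMultilinearSeries.ofScalars ℂ Q with hp
  -- radius `≥ r` for every `r < a`
  have hrad_r : ∀ ρ : NNReal, 0 < (ρ : ℝ) → (ρ : ℝ) < a → (ρ : ENNReal) ≤ p.radius := by
    intro ρ hr hra
    set r : ℝ := (ρ : ℝ) with hrdef
    set R : ℝ := (r + a) / 2 with hR
    have hrR : r < R := by rw [hR]; linarith
    have hRa : R < a := by rw [hR]; linarith
    have hRr : 0 < R - r := by linarith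
    set C : ℝ := 2 * R * r / (R - r) with hC
    have hC0 : 0 ≤ C := by rw [hC]; exact div_nonneg (by positivity) hRr.le
    refine p.le_radius_of_bound C fun k => ?_
    rw [hp, FormalMultilinearSeries.ofScalars_norm, hQ]
    dsimp only
    rw [Complex.norm_real, Real.norm_eq_abs]
    have hqk : |q k| ≤ C / r ^ k := by
      by_cases hk : k = 0
      · simp only [hq, hk, if_true, abs_zero]; positivity
      · simp only [hq, hk, if_false]
        rw [abs_div, Nat.abs_cast]
        exact abs_iteratedDeriv_freeEnergy_div_le hβ hlim hr hrR hRa (Nat.one_le_iff_ne_zero.2 hk)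
    calc |q k| * r ^ k ≤ C / r ^ k * r ^ k := mul_le_mul_of_nonneg_right hqk (by positivity)
      _ = C := by field_simp
  set a' : NNReal := ⟨a, ha.le⟩ with ha'
  have hrad : (a' : ENNReal) ≤ p.radius := by
    refine ENNReal.le_of_forall_nnreal_lt fun ρ hρ => ?_
    have hρa : (ρ : ℝ) < a := by exact_mod_cast hρ
    rcases eq_or_lt_of_le (NNReal.coe_nonneg ρ) with hρ0 | hρ0
    · have : ρ = 0 := by exact_mod_cast hρ0.symm
      simp [this]
    · exact hrad_r ρ hρ0 hρa
  have ha'0 : (0 : NNReal) < a' := by rw [← NNReal.coe_pos]; exact ha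
  have hrad0 : 0 < p.radius := lt_of_lt_of_le (ENNReal.coe_pos.2 ha'0) hrad
  have hps := p.hasFPowerSeriesOnBall hrad0
  set P : ℂ → ℂ := p.sum with hP
  have hball : ∀ z : ℂ, z ∈ Metric.ball (0 : ℂ) a → z ∈ Metric.eball (0 : ℂ) p.radius := by
    intro z hz
    refine Metric.eball_subset_eball hrad ?_
    rw [Metric.eball_coe]
    exact hz
  have hPdiff : DifferentiableOn ℂ P (Metric.ball 0 a) := fun z hz =>
    (hps.analyticAt_of_mem (hball z hz)).differentiableAt.differentiableWithinAt
  -- the real trace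
  have hPreal : ∀ h : ℝ, |h| < a → P h = ((freeEnergy d β h - freeEnergy d β 0 : ℝ) : ℂ) := by
    intro h hh
    obtain ⟨r, hhr, hra⟩ := exists_between hh
    have hr : 0 < r := (abs_nonneg h).trans_lt hhr
    set R : ℝ := (r + a) / 2 with hR
    have hrR : r < R := by rw [hR]; linarith
    have hRa : R < a := by rw [hR]; linarith
    have hev : ∀ᶠ n : ℕ in atTop, R < firstZero d (box d n) β := hlim.eventually (eventually_gt_nhds hRa)
    obtain ⟨b, -, -, hb0, -, hseries, hderiv⟩ := exists_cumulantCoeff_limit hβ hr hrR tendsto_id hev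
    have hbq : ∀ k, b k = q k := by
      intro k
      by_cases hk : k = 0
      · simp [hq, hk, hb0]
      · have hk! : (k.factorial : ℝ) ≠ 0 := Nat.cast_ne_zero.2 (Nat.factorial_ne_zero k)
        simp only [hq, hk, if_false]
        rw [hderiv k (Nat.one_le_iff_ne_zero.2 hk), mul_div_cancel_left₀ _ hk!]
    have hsum := hseries h hhr
    simp_rw [hbq] at hsum
    have hPz : P h = ∑' k : ℕ, Q k • (h : ℂ) ^ k := by
      rw [hP, hp]
      exact FormalMultilinearSeries.ofScalars_sum_eq Q _
    have hCx := Complex.hasSum_ofReal.2 hsum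
    rw [hPz, ← hCx.tsum_eq]
    refine tsum_congr fun k => ?_
    rw [hQ, smul_eq_mul]
    push_cast
    ring
  refine ⟨fun z => P z + ((freeEnergy d β 0 : ℝ) : ℂ), hPdiff.add (differentiableOn_const _),
    fun h hh => ?_⟩
  dsimp only
  rw [hPreal h hh]
  push_cast
  ring

/-- **Half of clause (iv)(b), granted `α₁(B_n,β) → a > 0`**:
`limsup_k [|f_β^{(2k)}(0)|/(2k)!]^{1/(2k)} ≤ 1/a` (the Taylor series of `f_β` at `0` has radius
`≥ a`; Cauchy–Hadamard). [cite: JiangNewman2023, Prop. 3 (r(β) ≥ lim α₁)] -/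
theorem limsup_iteratedDeriv_freeEnergy_le {β : ℝ} (hβ : 0 ≤ β) {a : ℝ}
    (hlim : Tendsto (fun n : ℕ => firstZero d (box d n) β) atTop (𝓝 a)) (ha : 0 < a) :
    limsup (fun k : ℕ => (|iteratedDeriv (2 * k) (freeEnergy d β) 0| / ((2 * k).factorial : ℝ)) ^
      ((1 : ℝ) / (2 * k))) atTop ≤ a⁻¹ := by
  set v : ℕ → ℝ := fun k => (|iteratedDeriv (2 * k) (freeEnergy d β) 0| / ((2 * k).factorial : ℝ)) ^
    ((1 : ℝ) / (2 * k)) with hv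
  have hv0 : ∀ k, 0 ≤ v k := fun k => Real.rpow_nonneg (by positivity) _
  -- for `0 < r < a`: `limsup v ≤ 1/r`
  have hbound : ∀ r : ℝ, 0 < r → r < a → limsup v atTop ≤ r⁻¹ := by
    intro r hr hra
    set R : ℝ := (r + a) / 2 with hR
    have hrR : r < R := by rw [hR]; linarith
    have hRa : R < a := by rw [hR]; linarith
    have hRr : 0 < R - r := by linarith
    set C : ℝ := 2 * R * r / (R - r) with hC
    have hC0 : 0 < C := by rw [hC]; exact div_pos (by positivity) hRr
    -- `v k ≤ C^{1/(2k)} / r` for `k ≥ 1`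
    have hvle : ∀ k : ℕ, 1 ≤ k → v k ≤ C ^ ((1 : ℝ) / (2 * k)) * r⁻¹ := by
      intro k hk
      have h2k : 1 ≤ 2 * k := by omega
      have h2k0 : (2 * k : ℕ) ≠ 0 := by omega
      have hb := abs_iteratedDeriv_freeEnergy_div_le hβ hlim hr hrR hRa h2k
      have hexp : 0 ≤ (1 : ℝ) / (2 * k) := by positivity
      calc v k ≤ (C / r ^ (2 * k)) ^ ((1 : ℝ) / (2 * k)) :=
            Real.rpow_le_rpow (by positivity) hb hexp
        _ = C ^ ((1 : ℝ) / (2 * k)) * (r ^ (2 * k))⁻¹ ^ ((1 : ℝ) / (2 * k)) := by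
            rw [div_eq_mul_inv, Real.mul_rpow hC0.le (by positivity)]
        _ = C ^ ((1 : ℝ) / (2 * k)) * r⁻¹ := by
            congr 1
            rw [← inv_pow, show ((1 : ℝ) / (2 * k)) = ((2 * k : ℕ) : ℝ)⁻¹ by push_cast; ring]
            exact Real.pow_rpow_inv_natCast (inv_nonneg.2 hr.le) h2k0
    -- `C^{1/(2k)} → 1`
    have hexp0 : Tendsto (fun k : ℕ => (1 : ℝ) / (2 * k)) atTop (𝓝 0) := by
      have h1 : Tendsto (fun k : ℕ => (2 : ℝ) * k) atTop atTop :=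
        (tendsto_natCast_atTop_atTop (R := ℝ)).const_mul_atTop two_pos
      exact tendsto_const_nhds.div_atTop h1
    have hCk : Tendsto (fun k : ℕ => C ^ ((1 : ℝ) / (2 * k))) atTop (𝓝 1) := by
      have hcont : ContinuousAt (fun x : ℝ => C ^ x) 0 := Real.continuousAt_const_rpow hC0.ne'
      have := hcont.tendsto.comp hexp0
      rw [Real.rpow_zero] at this
      exact this
    have hwk : Tendsto (fun k : ℕ => C ^ ((1 : ℝ) / (2 * k)) * r⁻¹) atTop (𝓝 (1 * r⁻¹)) :=
      hCk.mul_const _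
    rw [one_mul] at hwk
    refine le_of_forall_pos_le_add fun ε hε => ?_
    refine limsup_le_of_le (isCoboundedUnder_le_of_le atTop hv0) ?_
    have hev2 : ∀ᶠ k : ℕ in atTop, C ^ ((1 : ℝ) / (2 * k)) * r⁻¹ < r⁻¹ + ε :=
      hwk.eventually (eventually_lt_nhds (by linarith))
    filter_upwards [hev2, eventually_ge_atTop 1] with k hk hk1
    exact ((hvle k hk1).trans hk.le)
  refine le_of_forall_gt_imp_ge_of_dense fun c hc => ?_
  have hc0 : 0 < c := (inv_pos.2 ha).trans hc
  have hca : c⁻¹ < a := by rwa [inv_lt_comm₀ hc0 ha]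
  obtain ⟨t, ht1, ht2⟩ := exists_between hca
  have ht0 : 0 < t := (inv_pos.2 hc0).trans ht1
  calc limsup v atTop ≤ t⁻¹ := hbound t ht0 ht2
    _ ≤ c := by rw [inv_le_comm₀ ht0 hc0]; exact ht1.le

end PositiveLimit

/-! ### The residual obligations, sharpened -/

section ResidualSharp

variable {d}

/-- An antitone sequence of first zeros converges (to its infimum). [folklore] -/
theorem tendsto_firstZero_of_antitone {β : ℝ}
    (hanti : Antitone fun n : ℕ => firstZero d (box d n) β) :
    ∃ a : ℝ, 0 ≤ a ∧ Tendsto (fun n : ℕ => firstZero d (box d n) β) atTop (𝓝 a) := by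
  have hbdd : BddBelow (Set.range fun n : ℕ => firstZero d (box d n) β) :=
    ⟨0, by rintro _ ⟨n, rfl⟩; exact firstZero_nonneg d (box d n) β⟩
  refine ⟨⨅ n, firstZero d (box d n) β, le_ciInf fun n => firstZero_nonneg d (box d n) β,
    tendsto_atTop_ciInf hanti hbdd⟩

/-- **`FirstZeroLimit` from three residual inputs** (everything else being proved in this file):
(i) the antitonicity of `n ↦ α₁(B_n, β)` for `d ≥ 2`, `β ≥ 0` (Camia–Jiang–Newman 2022, Cor. 1);
(ii) the positivity of its limit for `0 ≤ β < β_c(d)` (Jiang–Newman 2023, Cor. 1 — the uniform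
zero-free disc below `β_c`, via Ott 2020, Cor. 1.4, and (i)); (iii) for `0 ≤ β < β_c(d)` with limit
`a`: no holomorphic extension of `f_β` to a disc of radius `> a`, and
`1/a ≤ limsup_k [|f_β^{(2k)}(0)|/(2k)!]^{1/(2k)}` (JN (2.23): `1/α₁(B_n) ≤ 1/r(β)`, which rests on the
monotonicity of Ursell functions, CJN 2022 Thm. 1, through `|u_{2k}(M_{B_n})| ≤ |B_n||b_{2k}|`).
Given these, clause (0), the limit, the analyticity of `f_β` on every disc of radius `≤ a`
(`analyticOnDisc_of_lt_lim`, `analyticOnDisc_of_tendsto_firstZero`), `0 < a ↔ β < β_c`, the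
convergence of the cumulant densities (`tendsto_magnetizationCumulant_div_card`) and the reverse
inequality (`limsup_iteratedDeriv_freeEnergy_le`) are theorems of this file, as is the whole
statement at `β ≥ β_c`. [cite: JiangNewman2023, Thm. 1, Props. 1–3, Lemma 1, Cor. 1] -/
theorem firstZeroLimit_of_residual
    (hanti : ∀ d : ℕ, 2 ≤ d → ∀ β : ℝ, 0 ≤ β → Antitone fun n : ℕ => firstZero d (box d n) β)
    (hpos : ∀ d : ℕ, 2 ≤ d → ∀ β : ℝ, 0 ≤ β → β < criticalBeta d → ∀ a : ℝ,
      Tendsto (fun n : ℕ => firstZero d (box d n) β) atTop (𝓝 a) → 0 < a)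
    (hsup : ∀ d : ℕ, 2 ≤ d → ∀ β : ℝ, 0 ≤ β → β < criticalBeta d → ∀ a : ℝ,
      Tendsto (fun n : ℕ => firstZero d (box d n) β) atTop (𝓝 a) →
        (∀ ρ : ℝ, a < ρ → ¬ AnalyticOnDisc d β ρ) ∧
        a⁻¹ ≤ limsup (fun k : ℕ =>
          (|iteratedDeriv (2 * k) (freeEnergy d β) 0| / ((2 * k).factorial : ℝ)) ^ ((1 : ℝ) / (2 * k)))
          atTop) :
    FirstZeroLimit := by
  intro d hd β hβ
  by_cases hβc : β < criticalBeta d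
  · obtain ⟨a, ha0, hlim⟩ := tendsto_firstZero_of_antitone (hanti d hd β hβ)
    have ha : 0 < a := hpos d hd β hβ hβc a hlim
    obtain ⟨hnot, hge⟩ := hsup d hd β hβ hβc a hlim
    refine ⟨fun h => tendsto_freeEnergyIn d β h, hanti d hd β hβ, a, ha0, hlim, ?_, hnot,
      ⟨fun _ => hβc, fun _ => ha⟩, fun _ => ⟨tendsto_magnetizationCumulant_div_card hβ hlim ha, ?_⟩⟩
    · intro ρ hρ hρa
      rcases hρa.lt_or_eq with hlt | heq
      · exact analyticOnDisc_of_lt_lim hβ hlim hρ hlt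
      · rw [heq]; exact analyticOnDisc_of_tendsto_firstZero hβ hlim ha
    · exact le_antisymm hge (limsup_iteratedDeriv_freeEnergy_le hβ hlim ha)
  · exact firstZeroLimit_at_of_criticalBeta_le_of_antitone d hd (not_lt.1 hβc) (hanti d hd β hβ)

end ResidualSharp

/-! ### Volume monotonicity of `α₁` from Camia–Jiang–Newman 2023, Theorem 2 -/

section VolumeMonotone

variable {d}

/-- Subtype-indexed form of `sum_sum_ite_out`: for an edge `e' = {a₀, b₀}` with `a₀, b₀ ∈ Λ`,
`∑_{a,b ∈ Λ} [a₀ = a ∧ b₀ = b] s(a)s(b) = s(a₀)s(b₀)`. [folklore] -/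
theorem sum_sum_ite_out_coe {Λ₀ Λ : Finset (Site d)} (hsub : Λ₀ ⊆ Λ) (s : Site d → ℝ)
    {e' : Sym2 (Site d)} (he' : e' ∈ edgesIn (zdGraph d) Λ₀) :
    ∑ a : Λ, ∑ b : Λ, (if (Quot.out e' : Site d × Site d).1 = (a : Site d) ∧
        (Quot.out e' : Site d × Site d).2 = (b : Site d) then (1 : ℝ) else 0) * (s a * s b) =
      s (Quot.out e' : Site d × Site d).1 * s (Quot.out e' : Site d × Site d).2 := by
  obtain ⟨ha, hb, -⟩ := out_spec he'
  set a₀ := (Quot.out e' : Site d × Site d).1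
  set b₀ := (Quot.out e' : Site d × Site d).2
  rw [Finset.sum_eq_single (⟨a₀, hsub ha⟩ : Λ), Finset.sum_eq_single (⟨b₀, hsub hb⟩ : Λ)]
  · simp
  · intro b _ hb'
    rw [if_neg, zero_mul]
    exact fun h => hb' (Subtype.ext h.2.symm)
  · intro h; exact absurd (Finset.mem_univ _) h
  · intro a _ ha'
    refine Finset.sum_eq_zero fun b _ => ?_
    rw [if_neg, zero_mul]
    exact fun h => ha' (Subtype.ext h.1.symm)
  · intro h; exact absurd (Finset.mem_univ _) h

/-- The pair energy of the couplings induced by an edge set `E` (one ordered representative per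
edge, weight `β`) is `β ∑_{e ∈ E} σ_e`. [folklore] -/
theorem sum_sum_coupling_eq {Λ₀ Λ : Finset (Site d)} (hsub : Λ₀ ⊆ Λ) {E : Finset (Sym2 (Site d))}
    (hE : E ⊆ edgesIn (zdGraph d) Λ₀) (β : ℝ) (ρ : SpinConfig Λ) :
    ∑ a : Λ, ∑ b : Λ, (β * ∑ e' ∈ E, (if (Quot.out e' : Site d × Site d).1 = (a : Site d) ∧
        (Quot.out e' : Site d × Site d).2 = (b : Site d) then (1 : ℝ) else 0)) *
        (spinAt a ρ * spinAt b ρ) =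
      β * ∑ e' ∈ E, bondSpin (glue Λ ρ .free) e' := by
  set s : Site d → ℝ := fun x => spinAt x (glue Λ ρ .free) with hs
  have hsa : ∀ a : Λ, spinAt a ρ = s a := fun a => (spinAt_glue_coe ρ .free a).symm
  simp_rw [hsa]
  calc ∑ a : Λ, ∑ b : Λ, (β * ∑ e' ∈ E, (if (Quot.out e' : Site d × Site d).1 = (a : Site d) ∧
          (Quot.out e' : Site d × Site d).2 = (b : Site d) then (1 : ℝ) else 0)) * (s a * s b)
      = β * ∑ e' ∈ E, ∑ a : Λ, ∑ b : Λ, (if (Quot.out e' : Site d × Site d).1 = (a : Site d) ∧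
          (Quot.out e' : Site d × Site d).2 = (b : Site d) then (1 : ℝ) else 0) * (s a * s b) := by
        symm
        simp only [Finset.mul_sum, Finset.sum_mul, mul_assoc]
        rw [Finset.sum_comm (s := E) (t := (Finset.univ : Finset Λ))]
        refine Finset.sum_congr rfl fun a _ => ?_
        rw [Finset.sum_comm (s := E) (t := (Finset.univ : Finset Λ))]
    _ = β * ∑ e' ∈ E, bondSpin (glue Λ ρ .free) e' := by
        congr 1
        refine Finset.sum_congr rfl fun e' he' => ?_
        rw [sum_sum_ite_out_coe hsub s (hE he'), (out_spec (hE he')).2.2]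

/-- **The numerator of the CJN moment generating function with the couplings of `Λ` is the
complex-field partition function `Z_{Λ,β,h}`** (`λ ≡ 1`). [cite: CamiaJiangNewman2023, §1.2 eq. (8)] -/
theorem sum_exp_mul_weight_eq_partitionFunction (Λ : Finset (Site d)) (β : ℝ) (h : ℂ) :
    ∑ ρ : SpinConfig Λ, Complex.exp (h * (PairIsing.weightedMagnetization (fun _ => (1 : ℝ)) ρ : ℂ)) *
      (PairIsing.weight (fun a b : Λ => β * ∑ e' ∈ edgesIn (zdGraph d) Λ,
        (if (Quot.out e' : Site d × Site d).1 = (a : Site d) ∧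
          (Quot.out e' : Site d × Site d).2 = (b : Site d) then (1 : ℝ) else 0)) ρ : ℂ) =
      partitionFunction d Λ β h := by
  unfold partitionFunction
  refine Finset.sum_congr rfl fun ρ _ => ?_
  rw [PairIsing.weight, sum_sum_coupling_eq le_rfl le_rfl β ρ, Complex.ofReal_exp, ← Complex.exp_add]
  congr 1
  rw [PairIsing.weightedMagnetization, sum_spinAt_glue]
  simp only [one_mul, spinAt]
  push_cast
  ring

/-- **Decoupling**: with the couplings of the SUB-volume `Λ₀ ⊆ Λ` on the sites of `Λ`, the
numerator of the moment generating function factorises through `Z_{Λ₀,β,h}`; in particular it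
vanishes at the zeros of `Z_{Λ₀,β,·}`. [folklore] -/
theorem sum_exp_mul_weight_eq_zero_of {Λ₀ Λ : Finset (Site d)} (hsub : Λ₀ ⊆ Λ) (β : ℝ) {h : ℂ}
    (hz : partitionFunction d Λ₀ β h = 0) :
    ∑ ρ : SpinConfig Λ, Complex.exp (h * (PairIsing.weightedMagnetization (fun _ => (1 : ℝ)) ρ : ℂ)) *
      (PairIsing.weight (fun a b : Λ => β * ∑ e' ∈ edgesIn (zdGraph d) Λ₀,
        (if (Quot.out e' : Site d × Site d).1 = (a : Site d) ∧
          (Quot.out e' : Site d × Site d).2 = (b : Site d) then (1 : ℝ) else 0)) ρ : ℂ) = 0 := by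
  classical
  set p : Λ → Prop := fun a => (a : Site d) ∈ Λ₀ with hp
  -- values inside `Λ₀` coded by a configuration on `{a // p a}`
  set r : ({a : Λ // p a} → ℤˣ) → Site d → ℝ := fun ρ₁ x =>
    if hx : x ∈ Λ₀ then ((ρ₁ ⟨⟨x, hsub hx⟩, hx⟩ : ℤ) : ℝ) else 0 with hr
  set T₁ : ({a : Λ // p a} → ℤˣ) → ℂ := fun ρ₁ =>
    Complex.exp (h * ((∑ v, ((ρ₁ v : ℤ) : ℝ) : ℝ) : ℂ)) *
      (Real.exp (β * ∑ e' ∈ edgesIn (zdGraph d) Λ₀,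
        r ρ₁ (Quot.out e' : Site d × Site d).1 * r ρ₁ (Quot.out e' : Site d × Site d).2) : ℂ) with hT₁
  set T₂ : ({a : Λ // ¬ p a} → ℤˣ) → ℂ := fun ρ₂ =>
    Complex.exp (h * ((∑ w, ((ρ₂ w : ℤ) : ℝ) : ℝ) : ℂ)) with hT₂
  -- pointwise factorisation of the summand
  have hpoint : ∀ ρ : SpinConfig Λ,
      Complex.exp (h * (PairIsing.weightedMagnetization (fun _ => (1 : ℝ)) ρ : ℂ)) *
        (PairIsing.weight (fun a b : Λ => β * ∑ e' ∈ edgesIn (zdGraph d) Λ₀,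
          (if (Quot.out e' : Site d × Site d).1 = (a : Site d) ∧
            (Quot.out e' : Site d × Site d).2 = (b : Site d) then (1 : ℝ) else 0)) ρ : ℂ) =
        T₁ (fun v => ρ v) * T₂ (fun w => ρ w) := by
    intro ρ
    rw [PairIsing.weight, sum_sum_coupling_eq hsub le_rfl β ρ, PairIsing.weightedMagnetization]
    simp only [one_mul, hT₁, hT₂]
    -- the magnetisation splits
    have hM : ∑ u : Λ, spinAt u ρ = (∑ v : {a : Λ // p a}, ((ρ v : ℤ) : ℝ)) +
        ∑ w : {a : Λ // ¬ p a}, ((ρ w : ℤ) : ℝ) := by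
      rw [← Fintype.sum_subtype_add_sum_subtype p fun u : Λ => spinAt u ρ]
      rfl
    -- the bonds inside `Λ₀` only see the `p`-part
    have hB : ∑ e' ∈ edgesIn (zdGraph d) Λ₀, bondSpin (glue Λ ρ .free) e' =
        ∑ e' ∈ edgesIn (zdGraph d) Λ₀,
          r (fun v => ρ v) (Quot.out e' : Site d × Site d).1 *
            r (fun v => ρ v) (Quot.out e' : Site d × Site d).2 := by
      refine Finset.sum_congr rfl fun e' he' => ?_
      obtain ⟨ha, hb, hbond⟩ := out_spec he'
      rw [hbond]
      simp only [hr, ha, hb, dif_pos]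
      rw [spinAt_glue_of_mem _ _ (hsub ha), spinAt_glue_of_mem _ _ (hsub hb)]
      rfl
    rw [hM, hB]
    push_cast
    rw [mul_add, Complex.exp_add]
    ring
  -- sum over the product decomposition
  set E₁ := Equiv.piEquivPiSubtypeProd p (fun _ : Λ => ℤˣ) with hE₁
  have hsum : ∑ ρ : SpinConfig Λ, T₁ (fun v => ρ v) * T₂ (fun w => ρ w) =
      (∑ ρ₁, T₁ ρ₁) * ∑ ρ₂, T₂ ρ₂ := by
    rw [Fintype.sum_equiv E₁ (fun ρ => T₁ (fun v => ρ v) * T₂ (fun w => ρ w))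
      (fun q => T₁ q.1 * T₂ q.2) (fun ρ => rfl), Fintype.sum_prod_type, Finset.sum_mul_sum]
  -- the first factor is `Z_{Λ₀,β,h}`
  set E₂ : {a : Λ // p a} ≃ Λ₀ :=
    { toFun := fun v => ⟨v.1.1, v.2⟩
      invFun := fun x => ⟨⟨x.1, hsub x.2⟩, x.2⟩
      left_inv := fun v => rfl
      right_inv := fun x => rfl } with hE₂
  have hfirst : ∑ ρ₁, T₁ ρ₁ = partitionFunction d Λ₀ β h := by
    unfold partitionFunction
    refine Fintype.sum_equiv (Equiv.arrowCongr E₂ (Equiv.refl ℤˣ)) _ _ fun ρ₁ => ?_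
    set τ : Λ₀ → ℤˣ := Equiv.arrowCongr E₂ (Equiv.refl ℤˣ) ρ₁ with hτ
    have hτv : ∀ x (hx : x ∈ Λ₀), τ ⟨x, hx⟩ = ρ₁ ⟨⟨x, hsub hx⟩, hx⟩ := fun x hx => rfl
    have hrx : ∀ x (hx : x ∈ Λ₀), r ρ₁ x = spinAt x (glue Λ₀ τ .free) := by
      intro x hx
      rw [spinAt_glue_of_mem _ _ hx, spinAt, hτv x hx]
      simp [hr, hx]
    have hS : ∑ e' ∈ edgesIn (zdGraph d) Λ₀,
        r ρ₁ (Quot.out e' : Site d × Site d).1 * r ρ₁ (Quot.out e' : Site d × Site d).2 =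
        ∑ e' ∈ edgesIn (zdGraph d) Λ₀, bondSpin (glue Λ₀ τ .free) e' := by
      refine Finset.sum_congr rfl fun e' he' => ?_
      obtain ⟨ha, hb, hbond⟩ := out_spec he'
      rw [hbond, hrx _ ha, hrx _ hb]
    have hMτ : ∑ x ∈ Λ₀, spinAt x (glue Λ₀ τ .free) = ∑ v : {a : Λ // p a}, ((ρ₁ v : ℤ) : ℝ) := by
      rw [sum_spinAt_glue, ← Equiv.sum_comp E₂]
      rfl
    simp only [hT₁]
    rw [hS, hMτ, Complex.ofReal_exp, ← Complex.exp_add]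
    congr 1
    push_cast
    ring
  rw [Finset.sum_congr rfl fun ρ _ => hpoint ρ, hsum, hfirst, hz, zero_mul]

/-- **`α₁` is antitone in the volume, from Camia–Jiang–Newman 2023, Thm. 2** (their Cor. 1 for
`Λ₀ ⊆ Λ`: the model on `Λ₀` is the model on `Λ` with the couplings outside `Λ₀` switched off):
for `β ≥ 0` and nonempty `Λ₀ ⊆ Λ`, `α₁(Λ, β) ≤ α₁(Λ₀, β)`. Relies on the named fact
`CamiaJiangNewman2023_thm2` (hypothesis `h2`) and the Lee–Yang theorem for `Z_{Λ,β,h}`.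
[cite: CamiaJiangNewman2023, Cor 1] -/
theorem firstZero_mono_of_CJN (h2 : CamiaJiangNewman2023_thm2) {β : ℝ} (hβ : 0 ≤ β)
    {Λ₀ Λ : Finset (Site d)} (hsub : Λ₀ ⊆ Λ) (hΛ₀ : Λ₀.Nonempty) :
    firstZero d Λ β ≤ firstZero d Λ₀ β := by
  classical
  obtain ⟨hα0, -, hzero⟩ := firstZero_spec hβ hΛ₀
  set α := firstZero d Λ₀ β with hα
  -- the two coupling matrices on the sites of `Λ`
  set c : Λ → Λ → ℝ := fun a b => β * ∑ e' ∈ edgesIn (zdGraph d) Λ₀,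
    (if (Quot.out e' : Site d × Site d).1 = (a : Site d) ∧
      (Quot.out e' : Site d × Site d).2 = (b : Site d) then (1 : ℝ) else 0) with hc
  set c' : Λ → Λ → ℝ := fun a b => β * ∑ e' ∈ edgesIn (zdGraph d) Λ,
    (if (Quot.out e' : Site d × Site d).1 = (a : Site d) ∧
      (Quot.out e' : Site d × Site d).2 = (b : Site d) then (1 : ℝ) else 0) with hc'
  have hterm : ∀ (e' : Sym2 (Site d)) (a b : Λ), (0 : ℝ) ≤
      (if (Quot.out e' : Site d × Site d).1 = (a : Site d) ∧
        (Quot.out e' : Site d × Site d).2 = (b : Site d) then (1 : ℝ) else 0) :=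
    fun e' a b => by split_ifs <;> norm_num
  have hc0 : ∀ a b, 0 ≤ c a b := fun a b => mul_nonneg hβ (Finset.sum_nonneg fun e' _ => hterm e' a b)
  have hcc' : ∀ a b, c a b ≤ c' a b := fun a b => mul_le_mul_of_nonneg_left
    (Finset.sum_le_sum_of_subset_of_nonneg (edgesIn_mono (zdGraph d) hsub) fun e' _ _ => hterm e' a b) hβ
  -- `iα` is a zero of the `c`-mgf
  have hnum := sum_exp_mul_weight_eq_zero_of hsub β (h := (α : ℂ) * I) hzero
  have hmgf : PairIsing.mgf c (fun _ => (1 : ℝ)) ((α : ℂ) * I) = 0 := by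
    rw [PairIsing.mgf, hnum, zero_div]
  obtain ⟨h', hz', hnorm⟩ := h2 Λ c c' (fun _ => 1) hc0 hcc' (fun _ => zero_le_one) _ hmgf
  -- `h'` is a zero of `Z_{Λ,β,·}`
  have hZ : partitionFunction d Λ β h' = 0 := by
    rw [PairIsing.mgf, div_eq_zero_iff] at hz'
    rcases hz' with hz' | hz'
    · rwa [sum_exp_mul_weight_eq_partitionFunction] at hz'
    · exact absurd hz' (Complex.ofReal_ne_zero.2 (PairIsing.sum_weight_pos c').ne')
  -- hence purely imaginary, nonzero, and `α₁(Λ) ≤ |Im h'| = ‖h'‖ ≤ α`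
  have hre : h'.re = 0 := by
    by_contra hre
    exact partitionFunction_ne_zero_of_re_ne_zero hβ Λ hre hZ
  have hh' : h' = (h'.im : ℂ) * I := by apply Complex.ext <;> simp [hre]
  have him : h'.im ≠ 0 := by
    intro him
    have : h' = 0 := by rw [hh', him]; simp
    rw [this] at hZ
    exact partitionFunction_zero_ne_zero Λ β hZ
  have hnorm' : ‖h'‖ = |h'.im| := by
    conv_lhs => rw [hh']
    rw [norm_mul, Complex.norm_real, Complex.norm_I, mul_one, Real.norm_eq_abs]
  have hαnorm : ‖(α : ℂ) * I‖ = α := by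
    rw [norm_mul, Complex.norm_real, Complex.norm_I, mul_one, Real.norm_eq_abs, abs_of_pos hα0]
  have hzero' : partitionFunction d Λ β ((|h'.im| : ℝ) * I) = 0 := by
    rcases lt_or_gt_of_ne him with hlt | hgt
    · rw [abs_of_neg hlt, Complex.ofReal_neg, neg_mul, partitionFunction_neg, ← hh']; exact hZ
    · rw [abs_of_pos hgt, ← hh']; exact hZ
  calc firstZero d Λ β ≤ |h'.im| := firstZero_le_of_zero Λ β (abs_pos.2 him) hzero'
    _ = ‖h'‖ := hnorm'.symm
    _ ≤ α := by rw [← hαnorm]; exact hnorm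

/-- **Antitonicity of `n ↦ α₁(B_n, β)` from Camia–Jiang–Newman 2023, Thm. 2** (residual input (i)
of `firstZeroLimit_of_residual`, reduced to the tree's named fact `CamiaJiangNewman2023_thm2`).
[cite: CamiaJiangNewman2023, Cor 1] -/
theorem antitone_firstZero_of_CJN (h2 : CamiaJiangNewman2023_thm2) {β : ℝ} (hβ : 0 ≤ β) :
    Antitone fun n : ℕ => firstZero d (box d n) β :=
  antitone_nat_of_succ_le fun n =>
    firstZero_mono_of_CJN h2 hβ (box_mono d (Nat.le_succ n)) (box_nonempty d n)

/-- **`FirstZeroLimit` from `CamiaJiangNewman2023_thm2` and the two analytic residual inputs**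
(positivity of the limit below `β_c` = JN Cor. 1 via Ott 2020; and the direction (2.23)).
Relies on: hypothesis `h2` (the named fact `CamiaJiangNewman2023_thm2`).
[cite: JiangNewman2023, Thm. 1, Props. 1–3, Lemma 1, Cor. 1] -/
theorem firstZeroLimit_of_CJN_of_residual (h2 : CamiaJiangNewman2023_thm2)
    (hpos : ∀ d : ℕ, 2 ≤ d → ∀ β : ℝ, 0 ≤ β → β < criticalBeta d → ∀ a : ℝ,
      Tendsto (fun n : ℕ => firstZero d (box d n) β) atTop (𝓝 a) → 0 < a)
    (hsup : ∀ d : ℕ, 2 ≤ d → ∀ β : ℝ, 0 ≤ β → β < criticalBeta d → ∀ a : ℝ,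
      Tendsto (fun n : ℕ => firstZero d (box d n) β) atTop (𝓝 a) →
        (∀ ρ : ℝ, a < ρ → ¬ AnalyticOnDisc d β ρ) ∧
        a⁻¹ ≤ limsup (fun k : ℕ =>
          (|iteratedDeriv (2 * k) (freeEnergy d β) 0| / ((2 * k).factorial : ℝ)) ^ ((1 : ℝ) / (2 * k)))
          atTop) :
    FirstZeroLimit :=
  firstZeroLimit_of_residual (fun d _ _ hβ => antitone_firstZero_of_CJN (d := d) h2 hβ) hpos hsup

end VolumeMonotone

end JiangNewman

end Literature.Probability.LatticeModels

end
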